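import Mathlib
import Literature.NumberTheory.Sieve.MaynardTaoLargeKProofs
import Literature.Analysis.Calculus.SmoothTransitionDerivBound
import HarnessLib

/-!
# Maynard 2016 (*Dense clusters of primes in subsets*), §7–§8: the test function `F` and Lemma 8.6

Topic `Literature/NumberTheory/Sieve`; namespace `Literature.NumberTheory.Sieve.MaynardDense`.
J. Maynard, *Dense clusters of primes in subsets*, Compositio Math. 152 (2016), 1517–1554 =
arXiv:1405.2593, §7 displays (7.4) [`F`], (7.6) [`F_1`, `F_2`] and Lemma 8.6 (p. 17 of the arXiv
version) with its proof (pp. 17–18).  This is the analytic leaf of the uniform-in-`k` sieve of that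
paper (the input «`I_k`, `J_k` bounds ⇐ [M, Lemma 8.6]» of Ford–Green–Konyagin–Maynard–Tao, *Long gaps
between primes*, Thm 6; see `FGKMT2018Theorem6Decomposition.Maynard2016DenseClusters_prop61Z`).

## The objects (as printed)

* `ψ : [0, ∞) → [0, 1]` «a fixed smooth non-increasing function supported on `[0, 1]` which is `1` on
  `[0, 9/10]`» — here FIXED as `ψ(t) = 1 − Real.smoothTransition (10 t − 9)` (`psi`);
* `T_k = k log k`, `U_k = k^{−1/2}` (`T`, `U`);
* `F(t₁,…,t_k) = ψ(∑ tᵢ) ∏ᵢ ψ(tᵢ/U_k)/(1 + T_k tᵢ)` ((7.4), `F`), `F₁ = ∏ᵢ ψ(tᵢ/U_k)/(1 + T_k tᵢ)`,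
  `F₂ = ∑ⱼ (ψ(tⱼ/2)/(1 + T_k tⱼ)) ∏_{i ≠ j} ψ(tᵢ/U_k)/(1 + T_k tᵢ)` ((7.6), `F₁`, `F₂`), written with
  the one-variable profiles `g_k(t) = ψ(t/U_k)/(1 + T_k t)` (`prof`) and `h_k(t) = ψ(t/2)/(1 + T_k t)`
  (`prof₂`);
* `I_k(G) = ∫_{[0,∞)^k} G²`, `J_k(G) = ∫_{[0,∞)^{k−1}} (∫₀^∞ G dt_k)²` (Lemma 8.6; `orthantI`,
  `orthantJ m` — we allow the distinguished coordinate `m` to be any index, the printed `J_k` being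
  `m = k`; for the symmetric `F`, `F₁`, `F₂` all `m` give the same value).

## Lemma 8.6 and its proof, made explicit

Printed: `(2k log k)^{−k} ≪ I_k(F) ≤ (k log k)^{−k}`, `log k/k ≪ J_k(F)/I_k(F) ≪ log k/k`,
`I_k(F) ≤ I_k(F₁) ≤ I_k(F₂)/k² ≪ I_k(F)`, `J_k(F) ≤ J_k(F₁) ≤ J_k(F₂)/k² ≪ J_k(F)`.  We follow the
printed proof: (i) `F₁` is a product, so `I_k(F₁) = γ_k^k`, `J_k(F₁) = L_k² γ_k^{k−1}` with the
one-variable moments `γ_k = ∫₀^∞ g_k²`, `L_k = ∫₀^∞ g_k`; (ii) the pointwise comparisons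
`0 ≤ F ≤ F₁`, `k F₁ ≤ F₂` («trivial bounds»); (iii) the «concentration of measure argument» of
Maynard 2015 §8 — here the tree's second-moment tail bound (`MaynardLargeK.setIntegral_tail_prod_sq_le`,
(8.6)–(8.10) of *Small gaps*), re-run at a general threshold `θ` — gives `I_k(F) ≥ γ^k − tail ≥ γ^k/2`
and `J_k(F) ≥ L²(γ^{k−1} − tail) ≥ J_k(F₁)/2`; (iv) the three one-variable integrals of the proof
(display after «For our choice of ψ, T_k, U_k») are bounded explicitly:
`(1 − 1/(1 + (9/10)T_kU_k))/T_k ≤ γ_k ≤ 1/T_k`, `log(1 + (9/10)T_kU_k)/T_k ≤ L_k ≤ log(1 + T_kU_k)/T_k`,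
`∫ t g_k² ≤ log(1 + T_kU_k)/T_k²`, `∫ h_k² ≤ 1/T_k`, `∫ h_k ≤ log(1 + 2T_k)/T_k`.  Every `≪` is an
explicit constant valid for `k ≥ k₀` with `k₀` explicit (see the main theorems `lemma86_*`).

## Also in this file (analytic inputs of Lemmas 8.2, 8.4, 8.5 and Proposition 9.2 of the same paper)

§11: the derivative / Lipschitz API of `ψ`, `g_k`, `h_k` (`|ψ'| ≤ 30`, `|g_k'| ≤ 30/U_k + T_k`, antitonicity on
`[0, ∞)`, monotonicity of `F`, `F₁`, `F₂` under coordinatewise increase) and a `C^∞` extension `profExt` of `g_k`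
across `0` (a legitimate `G` for Lemma 8.3); §12: the slice integral of Proposition 9.2 (p. 22),
`∫_{t_m = 0} F₂² ≤ k² T_k² J_k^{(m)}(F)` (`sliceI_F₂_le'`, `k ≥ 2^18`); §13: the analytic core of Lemma 8.2,
display (8.8): `|F(u; u_j + ε) − F(u)| ≤ (30 + 30/U_k + T_k)·ε·F₂(u)` for `u` in the orthant and `ε ≥ 0`
(`abs_F_update_sub_le`; `30 + 30/U_k + T_k ≤ 3T_k` for `k ≥ 2^18`, `shift_const_le`); §14: Lemma 8.2 (ii) in
analytic form — (8.8) applied to each coordinate in turn, `F₂` decreasing: `|F(v) − F(u)| ≤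
(30 + 30/U_k + T_k)·(Σᵢ (vᵢ − uᵢ))·F₂(u)` for `u ≤ v` (`abs_F_sub_F_le_of_le`) and the two-point form under a
common upper point (`abs_F_sub_F_le_of_le_of_le`), plus the `Ω_G` hypothesis of Lemma 8.4 for `G = g_k`:
`|G| + |G'| ≤ 4kT_k ∫₀^∞ G` on `[0,1]`, `G = profExt k`, `k ≥ 2^18` (`profExt_sup_le_omega_mul_integral`).

## References

* J. Maynard, *Dense clusters of primes in subsets*, Compositio Math. 152 (2016), 1517–1554;
  arXiv:1405.2593, §7 (7.4)–(7.6), Lemma 8.6. [Maynard2016DenseClusters]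
* J. Maynard, *Small gaps between primes*, Ann. of Math. (2) 181 (2015), 383–413, §8 (8.1)–(8.11)
  (the concentration argument). [MaynardAnnals2015]
-/

noncomputable section

open MeasureTheory Set Filter Finset Real
open scoped BigOperators Topology

namespace Literature.NumberTheory.Sieve

namespace MaynardDense

/-! ## §1 The cut-off `ψ` -/

/-- The smooth cut-off `ψ(t) = 1 − smoothTransition(10t − 9)`: smooth, non-increasing, `= 1` on
`(−∞, 9/10]`, `= 0` on `[1, ∞)`, values in `[0, 1]` (one admissible choice of the printed `ψ`).
[cite: Maynard2016DenseClusters, §7 after (7.4) («ψ … smooth non-increasing, supported on [0,1], 1 on [0,9/10]»)] -/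
def psi (t : ℝ) : ℝ := 1 - Real.smoothTransition (10 * t - 9)

/-- `ψ` is smooth. [cite: Maynard2016DenseClusters, §7 after (7.4)] -/
theorem contDiff_psi {n : ℕ∞} : ContDiff ℝ n psi := by
  unfold psi
  exact contDiff_const.sub (Real.smoothTransition.contDiff.comp
    ((contDiff_const.mul contDiff_id).sub contDiff_const))

/-- `ψ` is continuous. [cite: Maynard2016DenseClusters, §7 after (7.4)] -/
theorem continuous_psi : Continuous psi := (contDiff_psi (n := 0)).continuous

/-- `ψ` is measurable. [cite: Maynard2016DenseClusters, §7 after (7.4)] -/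
theorem measurable_psi : Measurable psi := continuous_psi.measurable

/-- `0 ≤ ψ`. [cite: Maynard2016DenseClusters, §7 after (7.4)] -/
theorem psi_nonneg (t : ℝ) : 0 ≤ psi t := by
  unfold psi; linarith [Real.smoothTransition.le_one (10 * t - 9)]

/-- `ψ ≤ 1`. [cite: Maynard2016DenseClusters, §7 after (7.4)] -/
theorem psi_le_one (t : ℝ) : psi t ≤ 1 := by
  unfold psi; linarith [Real.smoothTransition.nonneg (10 * t - 9)]

/-- `ψ(t) = 1` for `t ≤ 9/10`. [cite: Maynard2016DenseClusters, §7 after (7.4)] -/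
theorem psi_eq_one {t : ℝ} (ht : t ≤ 9 / 10) : psi t = 1 := by
  unfold psi
  rw [Real.smoothTransition.zero_of_nonpos (by linarith), sub_zero]

/-- `ψ(t) = 0` for `t ≥ 1`. [cite: Maynard2016DenseClusters, §7 after (7.4)] -/
theorem psi_eq_zero {t : ℝ} (ht : 1 ≤ t) : psi t = 0 := by
  unfold psi
  rw [Real.smoothTransition.one_of_one_le (by linarith), sub_self]

/-- `ψ` is non-increasing. [cite: Maynard2016DenseClusters, §7 after (7.4)] -/
theorem psi_antitone : Antitone psi := by
  intro a b hab
  unfold psi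
  have := Real.smoothTransition.monotone (show 10 * a - 9 ≤ 10 * b - 9 by linarith)
  linarith

/-- The support of `ψ` is contained in `(−∞, 1)`; in particular `ψ(t) ≠ 0 → t < 1`.
[cite: Maynard2016DenseClusters, §7 after (7.4)] -/
theorem lt_one_of_psi_ne_zero {t : ℝ} (h : psi t ≠ 0) : t < 1 := by
  by_contra h'
  exact h (psi_eq_zero (not_lt.1 h'))

/-! ## §2 The parameters `T_k`, `U_k` and the profiles -/

/-- `T_k = k log k`. [cite: Maynard2016DenseClusters, (7.4)] -/
def T (k : ℕ) : ℝ := k * Real.log k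

/-- `U_k = k^{−1/2}`. [cite: Maynard2016DenseClusters, (7.4)] -/
def U (k : ℕ) : ℝ := (k : ℝ) ^ (-(1 / 2 : ℝ))

/-- The one-variable profile `g_k(t) = ψ(t/U_k)/(1 + T_k t)` of `F` and `F₁`.
[cite: Maynard2016DenseClusters, (7.4)] -/
def prof (k : ℕ) (t : ℝ) : ℝ := psi (t / U k) / (1 + T k * t)

/-- The one-variable profile `h_k(t) = ψ(t/2)/(1 + T_k t)` of `F₂`.
[cite: Maynard2016DenseClusters, (7.6)] -/
def prof₂ (k : ℕ) (t : ℝ) : ℝ := psi (t / 2) / (1 + T k * t)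

/-- **The test function** `F(t) = ψ(∑ᵢ tᵢ) ∏ᵢ ψ(tᵢ/U_k)/(1 + T_k tᵢ)`.
[cite: Maynard2016DenseClusters, (7.4)] -/
def F (k : ℕ) (t : Fin k → ℝ) : ℝ := psi (∑ i, t i) * ∏ i, prof k (t i)

/-- `F₁(t) = ∏ᵢ ψ(tᵢ/U_k)/(1 + T_k tᵢ)`. [cite: Maynard2016DenseClusters, (7.6)] -/
def F₁ (k : ℕ) (t : Fin k → ℝ) : ℝ := ∏ i, prof k (t i)

/-- `F₂(t) = ∑ⱼ (ψ(tⱼ/2)/(1 + T_k tⱼ)) ∏_{i ≠ j} ψ(tᵢ/U_k)/(1 + T_k tᵢ)`.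
[cite: Maynard2016DenseClusters, (7.6)] -/
def F₂ (k : ℕ) (t : Fin k → ℝ) : ℝ := ∑ j, prof₂ k (t j) * ∏ i ∈ univ.erase j, prof k (t i)

/-! ## §3 The functionals `I_k`, `J_k` of Lemma 8.6 -/

/-- The closed orthant `[0, ∞)^k`. [cite: Maynard2016DenseClusters, Lemma 8.6] -/
def orthant (k : ℕ) : Set (Fin k → ℝ) := Set.univ.pi fun _ => Ici 0

/-- `I_k(G) = ∫₀^∞ ⋯ ∫₀^∞ G² dt₁ ⋯ dt_k`. [cite: Maynard2016DenseClusters, Lemma 8.6] -/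
def orthantI (k : ℕ) (G : (Fin k → ℝ) → ℝ) : ℝ := ∫ t in orthant k, G t ^ 2

/-- `J_k^{(m)}(G) = ∫_{[0,∞)^{k−1}} (∫₀^∞ G dt_m)²` (`k = n + 1`; the printed `J_k` is `m = k`, i.e.
`m = Fin.last n`). [cite: Maynard2016DenseClusters, Lemma 8.6] -/
def orthantJ (n : ℕ) (m : Fin (n + 1)) (G : (Fin (n + 1) → ℝ) → ℝ) : ℝ :=
  ∫ s in orthant n, (∫ u in Ici (0 : ℝ), G (Fin.insertNth m u s)) ^ 2

/-! ### Basic properties of the parameters -/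

/-- `T_k > 0` for `k ≥ 2`. [cite: Maynard2016DenseClusters, (7.4)] -/
theorem T_pos {k : ℕ} (hk : 2 ≤ k) : 0 < T k := by
  unfold T
  have hk1 : (1 : ℝ) < k := by exact_mod_cast hk
  exact mul_pos (by linarith) (Real.log_pos hk1)

/-- `U_k > 0` for `k ≥ 1`. [cite: Maynard2016DenseClusters, (7.4)] -/
theorem U_pos {k : ℕ} (hk : 1 ≤ k) : 0 < U k := by
  unfold U
  exact Real.rpow_pos_of_pos (by exact_mod_cast hk) _

/-- `U_k = 1/√k`. [cite: Maynard2016DenseClusters, (7.4)] -/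
theorem U_eq_inv_sqrt (k : ℕ) : U k = (Real.sqrt k)⁻¹ := by
  unfold U
  rw [Real.sqrt_eq_rpow, ← Real.rpow_neg (Nat.cast_nonneg k)]

/-- `U_k ≤ 1` for `k ≥ 1`. [cite: Maynard2016DenseClusters, (7.4)] -/
theorem U_le_one {k : ℕ} (hk : 1 ≤ k) : U k ≤ 1 := by
  rw [U_eq_inv_sqrt]
  have h1 : (1 : ℝ) ≤ Real.sqrt k := by
    rw [Real.one_le_sqrt]; exact_mod_cast hk
  exact inv_le_one_of_one_le₀ h1

/-- `U_k · √k = 1`. [cite: Maynard2016DenseClusters, (7.4)] -/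
theorem U_mul_sqrt {k : ℕ} (hk : 1 ≤ k) : U k * Real.sqrt k = 1 := by
  rw [U_eq_inv_sqrt]
  have : 0 < Real.sqrt k := Real.sqrt_pos.2 (by exact_mod_cast hk)
  field_simp

/-- `T_k U_k = √k log k`. [cite: Maynard2016DenseClusters, (7.4)] -/
theorem T_mul_U {k : ℕ} (hk : 1 ≤ k) : T k * U k = Real.sqrt k * Real.log k := by
  have hs : Real.sqrt k * Real.sqrt k = k := Real.mul_self_sqrt (Nat.cast_nonneg k)
  have hU := U_mul_sqrt hk
  unfold T
  calc (k : ℝ) * Real.log k * U k = Real.sqrt k * Real.sqrt k * Real.log k * U k := by rw [hs]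
    _ = Real.sqrt k * (U k * Real.sqrt k) * Real.log k := by ring
    _ = _ := by rw [hU, mul_one]

/-! ### Basic properties of the profiles -/

/-- `g_k(t) ≥ 0` for `t ≥ 0`. [cite: Maynard2016DenseClusters, (7.4)] -/
theorem prof_nonneg {k : ℕ} (hk : 2 ≤ k) {t : ℝ} (ht : 0 ≤ t) : 0 ≤ prof k t := by
  unfold prof
  exact div_nonneg (psi_nonneg _) (by nlinarith [T_pos hk])

/-- `g_k(t) ≤ 1` for `t ≥ 0`. [cite: Maynard2016DenseClusters, (7.4)] -/
theorem prof_le_one {k : ℕ} (hk : 2 ≤ k) {t : ℝ} (ht : 0 ≤ t) : prof k t ≤ 1 := by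
  unfold prof
  have h1 : 1 ≤ 1 + T k * t := by nlinarith [T_pos hk]
  exact div_le_one_of_le₀ ((psi_le_one _).trans h1) (by linarith)

/-- `g_k(t) = 0` for `t ≥ U_k`. [cite: Maynard2016DenseClusters, (7.4)–(7.5)] -/
theorem prof_eq_zero {k : ℕ} (hk : 1 ≤ k) {t : ℝ} (ht : U k ≤ t) : prof k t = 0 := by
  unfold prof
  rw [psi_eq_zero ((one_le_div (U_pos hk)).2 ht), zero_div]

/-- `g_k(t) = 1/(1 + T_k t)` for `0 ≤ t ≤ (9/10) U_k`. [cite: Maynard2016DenseClusters, (7.4)] -/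
theorem prof_eq_inv {k : ℕ} (hk : 1 ≤ k) {t : ℝ} (ht : t ≤ 9 / 10 * U k) :
    prof k t = 1 / (1 + T k * t) := by
  unfold prof
  rw [psi_eq_one ((div_le_iff₀ (U_pos hk)).2 (by linarith))]

/-- `g_k(t) ≤ 1/(1 + T_k t)` for `t ≥ 0`. [cite: Maynard2016DenseClusters, (7.4)] -/
theorem prof_le_inv {k : ℕ} (hk : 2 ≤ k) {t : ℝ} (ht : 0 ≤ t) : prof k t ≤ 1 / (1 + T k * t) := by
  unfold prof
  exact div_le_div_of_nonneg_right (psi_le_one _) (by nlinarith [T_pos hk])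

/-- `h_k(t) ≥ 0` for `t ≥ 0`. [cite: Maynard2016DenseClusters, (7.6)] -/
theorem prof₂_nonneg {k : ℕ} (hk : 2 ≤ k) {t : ℝ} (ht : 0 ≤ t) : 0 ≤ prof₂ k t := by
  unfold prof₂
  exact div_nonneg (psi_nonneg _) (by nlinarith [T_pos hk])

/-- `h_k(t) ≤ 1/(1 + T_k t)` for `t ≥ 0`. [cite: Maynard2016DenseClusters, (7.6)] -/
theorem prof₂_le_inv {k : ℕ} (hk : 2 ≤ k) {t : ℝ} (ht : 0 ≤ t) : prof₂ k t ≤ 1 / (1 + T k * t) := by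
  unfold prof₂
  exact div_le_div_of_nonneg_right (psi_le_one _) (by nlinarith [T_pos hk])

/-- `h_k(t) = 0` for `t ≥ 2`. [cite: Maynard2016DenseClusters, (7.6)] -/
theorem prof₂_eq_zero {k : ℕ} {t : ℝ} (ht : 2 ≤ t) : prof₂ k t = 0 := by
  unfold prof₂
  rw [psi_eq_zero (by linarith), zero_div]

/-- `g_k ≤ h_k` on `[0, ∞)` (`ψ` is non-increasing and `U_k ≤ 2`). [cite: Maynard2016DenseClusters, proof of Lemma 8.6 («trivial bounds»)] -/
theorem prof_le_prof₂ {k : ℕ} (hk : 2 ≤ k) {t : ℝ} (ht : 0 ≤ t) : prof k t ≤ prof₂ k t := by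
  unfold prof prof₂
  have hk1 : 1 ≤ k := le_trans (by norm_num) hk
  have hU := U_pos hk1
  have hU2 : U k ≤ 2 := (U_le_one hk1).trans (by norm_num)
  have harg : t / 2 ≤ t / U k := div_le_div_of_nonneg_left ht hU hU2
  exact div_le_div_of_nonneg_right (psi_antitone harg) (by nlinarith [T_pos hk])

/-- The profiles are measurable. [cite: Maynard2016DenseClusters, (7.4)] -/
theorem measurable_prof (k : ℕ) : Measurable (prof k) := by
  unfold prof
  exact (measurable_psi.comp (measurable_id.div_const _)).div
    (measurable_const.add (measurable_const.mul measurable_id))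

/-- The profiles are measurable. [cite: Maynard2016DenseClusters, (7.6)] -/
theorem measurable_prof₂ (k : ℕ) : Measurable (prof₂ k) := by
  unfold prof₂
  exact (measurable_psi.comp (measurable_id.div_const _)).div
    (measurable_const.add (measurable_const.mul measurable_id))

/-! ### Pointwise comparisons of `F`, `F₁`, `F₂` on the orthant («trivial bounds») -/

/-- `F = ψ(∑ tᵢ) F₁`. [cite: Maynard2016DenseClusters, (7.4)–(7.6)] -/
theorem F_eq_psi_mul_F₁ (k : ℕ) (t : Fin k → ℝ) : F k t = psi (∑ i, t i) * F₁ k t := rfl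

/-- `F₁ ≥ 0` on the orthant. [cite: Maynard2016DenseClusters, proof of Lemma 8.6] -/
theorem F₁_nonneg {k : ℕ} (hk : 2 ≤ k) {t : Fin k → ℝ} (ht : t ∈ orthant k) : 0 ≤ F₁ k t :=
  Finset.prod_nonneg fun i _ => prof_nonneg hk (ht i (Set.mem_univ _))

/-- `0 ≤ F` on the orthant. [cite: Maynard2016DenseClusters, §7 after (7.4) («this choice of F is non-negative»)] -/
theorem F_nonneg {k : ℕ} (hk : 2 ≤ k) {t : Fin k → ℝ} (ht : t ∈ orthant k) : 0 ≤ F k t :=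
  mul_nonneg (psi_nonneg _) (F₁_nonneg hk ht)

/-- `F ≤ F₁` on the orthant. [cite: Maynard2016DenseClusters, proof of Lemma 8.6 («trivial bounds»)] -/
theorem F_le_F₁ {k : ℕ} (hk : 2 ≤ k) {t : Fin k → ℝ} (ht : t ∈ orthant k) : F k t ≤ F₁ k t := by
  rw [F_eq_psi_mul_F₁]
  exact mul_le_of_le_one_left (F₁_nonneg hk ht) (psi_le_one _)

/-- `F = F₁` where `∑ tᵢ ≤ 9/10`. [cite: Maynard2016DenseClusters, proof of Lemma 8.6 (8.13)–(8.14)] -/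
theorem F_eq_F₁ {k : ℕ} {t : Fin k → ℝ} (ht : ∑ i, t i ≤ 9 / 10) : F k t = F₁ k t := by
  rw [F_eq_psi_mul_F₁, psi_eq_one ht, one_mul]

/-- `k F₁ ≤ F₂` on the orthant (each summand of `F₂` dominates `F₁` since `g_k ≤ h_k`).
[cite: Maynard2016DenseClusters, proof of Lemma 8.6 («trivial bounds … ≤ k^{-2} I_k(F_2)»)] -/
theorem mul_F₁_le_F₂ {k : ℕ} (hk : 2 ≤ k) {t : Fin k → ℝ} (ht : t ∈ orthant k) :
    k * F₁ k t ≤ F₂ k t := by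
  unfold F₁ F₂
  have hterm : ∀ j ∈ (univ : Finset (Fin k)),
      ∏ i, prof k (t i) ≤ prof₂ k (t j) * ∏ i ∈ univ.erase j, prof k (t i) := by
    intro j _
    rw [← Finset.mul_prod_erase _ _ (Finset.mem_univ j)]
    exact mul_le_mul_of_nonneg_right (prof_le_prof₂ hk (ht j (Set.mem_univ _)))
      (Finset.prod_nonneg fun i _ => prof_nonneg hk (ht i (Set.mem_univ _)))
  calc (k : ℝ) * ∏ i, prof k (t i) = ∑ _j : Fin k, ∏ i, prof k (t i) := by
        rw [Finset.sum_const, Finset.card_univ, Fintype.card_fin, nsmul_eq_mul]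
    _ ≤ _ := Finset.sum_le_sum hterm

/-! ## §4 The one-variable profiles restricted to `[0, ∞)` and their moments

The integrals over `[0, ∞)` of the proof of Lemma 8.6 are written as whole-line integrals of the
profiles cut off at `0` (`profCut`, `prof₂Cut`), which are supported in `[0, U_k]`, `[0, 2]`; they are
squeezed between the explicit profiles `1_{[0,τ]}(x)/(1 + T_k x)` of Maynard 2015 (8.17), whose three
moments are computed in the tree (`MaynardLargeK.integral_indicator_inv`, `…_inv_sq`,
`integral_mul_indicator_inv_sq`). -/

/-- `g_k` cut off at `0`: `1_{[0,∞)} g_k`. [cite: Maynard2016DenseClusters, Lemma 8.6 (integrals over [0,∞))] -/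
def profCut (k : ℕ) : ℝ → ℝ := (Ici (0 : ℝ)).indicator (prof k)

/-- `h_k` cut off at `0`: `1_{[0,∞)} h_k`. [cite: Maynard2016DenseClusters, Lemma 8.6 (integrals over [0,∞))] -/
def prof₂Cut (k : ℕ) : ℝ → ℝ := (Ici (0 : ℝ)).indicator (prof₂ k)

/-- `γ_k = ∫₀^∞ g_k²`. [cite: Maynard2016DenseClusters, proof of Lemma 8.6, display (second line)] -/
def gam (k : ℕ) : ℝ := ∫ x, profCut k x ^ 2

/-- `L_k = ∫₀^∞ g_k`. [cite: Maynard2016DenseClusters, proof of Lemma 8.6, display (first line)] -/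
def ell (k : ℕ) : ℝ := ∫ x, profCut k x

/-- `μ_k = ∫₀^∞ x g_k(x)²` (the first moment of `g_k²`, for the concentration argument).
[cite: MaynardAnnals2015, §8 (8.7) («μ»)] -/
def mom (k : ℕ) : ℝ := ∫ x, x * profCut k x ^ 2

/-- `∫₀^∞ h_k²`. [cite: Maynard2016DenseClusters, proof of Lemma 8.6, display (third line)] -/
def gam₂ (k : ℕ) : ℝ := ∫ x, prof₂Cut k x ^ 2

/-- `∫₀^∞ h_k`. [cite: Maynard2016DenseClusters, proof of Lemma 8.6] -/
def ell₂ (k : ℕ) : ℝ := ∫ x, prof₂Cut k x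

section CutProfiles

variable {k : ℕ}

/-- `1_{[0,∞)} g_k` is measurable. [cite: Maynard2016DenseClusters, (7.4)] -/
theorem measurable_profCut (k : ℕ) : Measurable (profCut k) :=
  (measurable_prof k).indicator measurableSet_Ici

/-- `1_{[0,∞)} h_k` is measurable. [cite: Maynard2016DenseClusters, (7.6)] -/
theorem measurable_prof₂Cut (k : ℕ) : Measurable (prof₂Cut k) :=
  (measurable_prof₂ k).indicator measurableSet_Ici

/-- `1_{[0,∞)} g_k = g_k` on `[0, ∞)`. [cite: Maynard2016DenseClusters, (7.4)] -/
theorem profCut_of_nonneg {x : ℝ} (hx : 0 ≤ x) : profCut k x = prof k x :=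
  indicator_of_mem (Set.mem_Ici.2 hx) _

/-- `1_{[0,∞)} g_k = 0` on `(−∞, 0)`. [cite: Maynard2016DenseClusters, (7.4)] -/
theorem profCut_of_neg {x : ℝ} (hx : x < 0) : profCut k x = 0 :=
  indicator_of_notMem (by simpa using hx) _

/-- `1_{[0,∞)} h_k = h_k` on `[0, ∞)`. [cite: Maynard2016DenseClusters, (7.6)] -/
theorem prof₂Cut_of_nonneg {x : ℝ} (hx : 0 ≤ x) : prof₂Cut k x = prof₂ k x :=
  indicator_of_mem (Set.mem_Ici.2 hx) _

/-- `1_{[0,∞)} h_k = 0` on `(−∞, 0)`. [cite: Maynard2016DenseClusters, (7.6)] -/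
theorem prof₂Cut_of_neg {x : ℝ} (hx : x < 0) : prof₂Cut k x = 0 :=
  indicator_of_notMem (by simpa using hx) _

/-- `0 ≤ 1_{[0,∞)} g_k`. [cite: Maynard2016DenseClusters, (7.4)] -/
theorem profCut_nonneg (hk : 2 ≤ k) (x : ℝ) : 0 ≤ profCut k x := by
  by_cases hx : 0 ≤ x
  · rw [profCut_of_nonneg hx]; exact prof_nonneg hk hx
  · rw [profCut_of_neg (not_le.1 hx)]

/-- `1_{[0,∞)} g_k ≤ 1`. [cite: Maynard2016DenseClusters, (7.4)] -/
theorem profCut_le_one (hk : 2 ≤ k) (x : ℝ) : profCut k x ≤ 1 := by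
  by_cases hx : 0 ≤ x
  · rw [profCut_of_nonneg hx]; exact prof_le_one hk hx
  · rw [profCut_of_neg (not_le.1 hx)]; exact zero_le_one

/-- `|1_{[0,∞)} g_k| ≤ 1`. [cite: Maynard2016DenseClusters, (7.4)] -/
theorem abs_profCut_le_one (hk : 2 ≤ k) (x : ℝ) : |profCut k x| ≤ 1 := by
  rw [abs_of_nonneg (profCut_nonneg hk x)]; exact profCut_le_one hk x

/-- `1_{[0,∞)} g_k` is supported in `[0, U_k]`. [cite: Maynard2016DenseClusters, (7.4)–(7.5)] -/
theorem mem_Icc_of_profCut_ne_zero (hk : 1 ≤ k) {x : ℝ} (hx : profCut k x ≠ 0) :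
    x ∈ Icc 0 (U k) := by
  by_cases h0 : 0 ≤ x
  · refine ⟨h0, ?_⟩
    by_contra hU
    exact hx (by rw [profCut_of_nonneg h0, prof_eq_zero hk (not_le.1 hU).le])
  · exact absurd (profCut_of_neg (not_le.1 h0)) hx

/-- `0 ≤ 1_{[0,∞)} h_k`. [cite: Maynard2016DenseClusters, (7.6)] -/
theorem prof₂Cut_nonneg (hk : 2 ≤ k) (x : ℝ) : 0 ≤ prof₂Cut k x := by
  by_cases hx : 0 ≤ x
  · rw [prof₂Cut_of_nonneg hx]; exact prof₂_nonneg hk hx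
  · rw [prof₂Cut_of_neg (not_le.1 hx)]

/-- `1_{[0,∞)} h_k ≤ 1`. [cite: Maynard2016DenseClusters, (7.6)] -/
theorem prof₂Cut_le_one (hk : 2 ≤ k) (x : ℝ) : prof₂Cut k x ≤ 1 := by
  by_cases hx : 0 ≤ x
  · rw [prof₂Cut_of_nonneg hx]
    refine (prof₂_le_inv hk hx).trans ?_
    rw [one_div]
    exact inv_le_one_of_one_le₀ (by nlinarith [T_pos hk])
  · rw [prof₂Cut_of_neg (not_le.1 hx)]; exact zero_le_one

/-- `|1_{[0,∞)} h_k| ≤ 1`. [cite: Maynard2016DenseClusters, (7.6)] -/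
theorem abs_prof₂Cut_le_one (hk : 2 ≤ k) (x : ℝ) : |prof₂Cut k x| ≤ 1 := by
  rw [abs_of_nonneg (prof₂Cut_nonneg hk x)]; exact prof₂Cut_le_one hk x

/-- `1_{[0,∞)} h_k` is supported in `[0, 2]`. [cite: Maynard2016DenseClusters, (7.6)] -/
theorem mem_Icc_of_prof₂Cut_ne_zero {x : ℝ} (hx : prof₂Cut k x ≠ 0) : x ∈ Set.Icc (0 : ℝ) 2 := by
  by_cases h0 : 0 ≤ x
  · refine ⟨h0, ?_⟩
    by_contra h2
    exact hx (by rw [prof₂Cut_of_nonneg h0, prof₂_eq_zero (not_le.1 h2).le])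
  · exact absurd (prof₂Cut_of_neg (not_le.1 h0)) hx

/-- Upper squeeze: `1_{[0,∞)} g_k ≤ 1_{[0,U_k]}(x)/(1 + T_k x)`. [cite: Maynard2016DenseClusters, proof of Lemma 8.6, display] -/
theorem profCut_le_indicator_inv (hk : 2 ≤ k) (x : ℝ) :
    profCut k x ≤ (Icc 0 (U k)).indicator (fun x => (1 + T k * x)⁻¹) x := by
  have hk1 : 1 ≤ k := le_trans (by norm_num) hk
  by_cases hx : x ∈ Icc 0 (U k)
  · rw [indicator_of_mem hx, profCut_of_nonneg hx.1, ← one_div]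
    exact prof_le_inv hk hx.1
  · have : profCut k x = 0 := by
      by_contra h; exact hx (mem_Icc_of_profCut_ne_zero hk1 h)
    rw [this, indicator_of_notMem hx]

/-- Lower squeeze: `1_{[0,(9/10)U_k]}(x)/(1 + T_k x) ≤ 1_{[0,∞)} g_k`. [cite: Maynard2016DenseClusters, proof of Lemma 8.6, display] -/
theorem indicator_inv_le_profCut (hk : 2 ≤ k) (x : ℝ) :
    (Icc 0 (9 / 10 * U k)).indicator (fun x => (1 + T k * x)⁻¹) x ≤ profCut k x := by
  have hk1 : 1 ≤ k := le_trans (by norm_num) hk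
  by_cases hx : x ∈ Icc 0 (9 / 10 * U k)
  · rw [indicator_of_mem hx, profCut_of_nonneg hx.1, prof_eq_inv hk1 hx.2, one_div]
  · rw [indicator_of_notMem hx]; exact profCut_nonneg hk x

/-- Upper squeeze for `h_k`: `1_{[0,∞)} h_k ≤ 1_{[0,2]}(x)/(1 + T_k x)`. [cite: Maynard2016DenseClusters, proof of Lemma 8.6, display (third line)] -/
theorem prof₂Cut_le_indicator_inv (hk : 2 ≤ k) (x : ℝ) :
    prof₂Cut k x ≤ (Icc 0 (2 : ℝ)).indicator (fun x => (1 + T k * x)⁻¹) x := by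
  by_cases hx : x ∈ Icc 0 (2 : ℝ)
  · rw [indicator_of_mem hx, prof₂Cut_of_nonneg hx.1, ← one_div]
    exact prof₂_le_inv hk hx.1
  · have : prof₂Cut k x = 0 := by
      by_contra h; exact hx (mem_Icc_of_prof₂Cut_ne_zero h)
    rw [this, indicator_of_notMem hx]

/-! ### Integrability -/

/-- `1_{[0,∞)} g_k` is integrable. [cite: Maynard2016DenseClusters, Lemma 8.6] -/
theorem integrable_profCut (hk : 2 ≤ k) : Integrable (profCut k) :=
  MaynardLargeK.integrable_of_forall_mem_Icc (measurable_profCut k) (abs_profCut_le_one hk)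
    (fun _ h => mem_Icc_of_profCut_ne_zero (le_trans (by norm_num) hk) h)

/-- `(1_{[0,∞)} g_k)²` is integrable. [cite: Maynard2016DenseClusters, Lemma 8.6] -/
theorem integrable_profCut_sq (hk : 2 ≤ k) : Integrable fun x => profCut k x ^ 2 :=
  MaynardLargeK.integrable_sq_of_forall_mem_Icc (measurable_profCut k) (abs_profCut_le_one hk)
    (fun _ h => mem_Icc_of_profCut_ne_zero (le_trans (by norm_num) hk) h)

/-- `x (1_{[0,∞)} g_k)²` is integrable. [cite: MaynardAnnals2015, §8 (8.7)] -/
theorem integrable_mul_profCut_sq (hk : 2 ≤ k) : Integrable fun x => x * profCut k x ^ 2 := by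
  have h := MaynardLargeK.integrable_mul_of_forall_mem_Icc
    ((measurable_profCut k).pow_const 2) (g := fun x => profCut k x ^ 2)
    (fun x => by
      rw [abs_of_nonneg (sq_nonneg _)]
      exact pow_le_one₀ (profCut_nonneg hk x) (profCut_le_one hk x))
    (fun x h => mem_Icc_of_profCut_ne_zero (le_trans (by norm_num) hk)
      (fun h' => h (by rw [h']; ring))) continuous_id
  simpa using h

/-- `1_{[0,∞)} h_k` is integrable. [cite: Maynard2016DenseClusters, Lemma 8.6] -/
theorem integrable_prof₂Cut (hk : 2 ≤ k) : Integrable (prof₂Cut k) :=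
  MaynardLargeK.integrable_of_forall_mem_Icc (measurable_prof₂Cut k) (abs_prof₂Cut_le_one hk)
    (fun _ h => mem_Icc_of_prof₂Cut_ne_zero h)

/-- `(1_{[0,∞)} h_k)²` is integrable. [cite: Maynard2016DenseClusters, Lemma 8.6] -/
theorem integrable_prof₂Cut_sq (hk : 2 ≤ k) : Integrable fun x => prof₂Cut k x ^ 2 :=
  MaynardLargeK.integrable_sq_of_forall_mem_Icc (measurable_prof₂Cut k) (abs_prof₂Cut_le_one hk)
    (fun _ h => mem_Icc_of_prof₂Cut_ne_zero h)

/-- The explicit profile `1_{[0,τ]}(x)/(1 + Bx)` is integrable (`B, τ ≥ 0`). [cite: MaynardAnnals2015, §8 (8.17)] -/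
theorem integrable_indicator_inv {B τ : ℝ} (hB : 0 ≤ B) :
    Integrable fun x => (Icc 0 τ).indicator (fun x => (1 + B * x)⁻¹) x :=
  MaynardLargeK.integrable_of_forall_mem_Icc MaynardLargeK.measurable_indicator_inv
    (fun x => by
      rw [abs_of_nonneg (MaynardLargeK.indicator_inv_nonneg hB x)]
      exact MaynardLargeK.indicator_inv_le_one hB x)
    (fun x h => by by_contra hx; exact h (indicator_of_notMem hx _))

/-- The square of the explicit profile is integrable. [cite: MaynardAnnals2015, §8 (8.17)] -/
theorem integrable_indicator_inv_sq {B τ : ℝ} (hB : 0 ≤ B) :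
    Integrable fun x => ((Icc 0 τ).indicator (fun x => (1 + B * x)⁻¹) x) ^ 2 :=
  MaynardLargeK.integrable_sq_of_forall_mem_Icc MaynardLargeK.measurable_indicator_inv
    (fun x => by
      rw [abs_of_nonneg (MaynardLargeK.indicator_inv_nonneg hB x)]
      exact MaynardLargeK.indicator_inv_le_one hB x)
    (fun x h => by by_contra hx; exact h (indicator_of_notMem hx _))

/-- `x` times the square of the explicit profile is integrable. [cite: MaynardAnnals2015, §8 (8.19)] -/
theorem integrable_mul_indicator_inv_sq {B τ : ℝ} (hB : 0 ≤ B) :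
    Integrable fun x => x * ((Icc 0 τ).indicator (fun x => (1 + B * x)⁻¹) x) ^ 2 := by
  have h := MaynardLargeK.integrable_mul_of_forall_mem_Icc
    (MaynardLargeK.measurable_indicator_inv.pow_const 2)
    (g := fun x => ((Icc 0 τ).indicator (fun x => (1 + B * x)⁻¹) x) ^ 2)
    (fun x => by
      rw [abs_of_nonneg (sq_nonneg _)]
      exact pow_le_one₀ (MaynardLargeK.indicator_inv_nonneg hB x)
        (MaynardLargeK.indicator_inv_le_one hB x))
    (fun x h => by
      by_contra hx; exact h (by rw [indicator_of_notMem hx]; ring)) continuous_id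
  simpa using h

/-! ### The explicit bounds for the one-variable moments -/

/-- `γ_k ≤ (1 − 1/(1 + T_kU_k))/T_k`. [cite: Maynard2016DenseClusters, proof of Lemma 8.6, display (second line)] -/
theorem gam_le (hk : 2 ≤ k) : gam k ≤ (1 - (1 + T k * U k)⁻¹) / T k := by
  have hk1 : 1 ≤ k := le_trans (by norm_num) hk
  rw [gam, ← MaynardLargeK.integral_indicator_inv_sq (T_pos hk) (U_pos hk1).le]
  refine integral_mono (integrable_profCut_sq hk) (integrable_indicator_inv_sq (T_pos hk).le)
    fun x => ?_
  exact pow_le_pow_left₀ (profCut_nonneg hk x) (profCut_le_indicator_inv hk x) 2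

/-- `γ_k ≤ 1/T_k`. [cite: Maynard2016DenseClusters, proof of Lemma 8.6, display (second line)] -/
theorem gam_le_inv (hk : 2 ≤ k) : gam k ≤ (T k)⁻¹ := by
  have hk1 : 1 ≤ k := le_trans (by norm_num) hk
  refine (gam_le hk).trans ?_
  rw [div_le_iff₀ (T_pos hk), inv_mul_cancel₀ (T_pos hk).ne']
  have : 0 ≤ (1 + T k * U k)⁻¹ := by
    have := mul_pos (T_pos hk) (U_pos hk1); positivity
  linarith

/-- `γ_k ≥ (1 − 1/(1 + (9/10)T_kU_k))/T_k`. [cite: Maynard2016DenseClusters, proof of Lemma 8.6, display (second line)] -/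
theorem gam_ge (hk : 2 ≤ k) : (1 - (1 + T k * (9 / 10 * U k))⁻¹) / T k ≤ gam k := by
  have hk1 : 1 ≤ k := le_trans (by norm_num) hk
  have h9 : (0 : ℝ) ≤ 9 / 10 * U k := by have := U_pos hk1; positivity
  rw [gam, ← MaynardLargeK.integral_indicator_inv_sq (T_pos hk) h9]
  refine integral_mono (integrable_indicator_inv_sq (T_pos hk).le) (integrable_profCut_sq hk)
    fun x => ?_
  exact pow_le_pow_left₀ (MaynardLargeK.indicator_inv_nonneg (T_pos hk).le x)
    (indicator_inv_le_profCut hk x) 2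

/-- `γ_k > 0`. [cite: Maynard2016DenseClusters, Lemma 8.6] -/
theorem gam_pos (hk : 2 ≤ k) : 0 < gam k := by
  have hk1 : 1 ≤ k := le_trans (by norm_num) hk
  refine lt_of_lt_of_le ?_ (gam_ge hk)
  have hTU : 0 < T k * (9 / 10 * U k) := by
    have := U_pos hk1; have := T_pos hk; positivity
  refine div_pos ?_ (T_pos hk)
  have : (1 + T k * (9 / 10 * U k))⁻¹ < 1 := inv_lt_one_of_one_lt₀ (by linarith)
  linarith

/-- `L_k ≤ log(1 + T_kU_k)/T_k`. [cite: Maynard2016DenseClusters, proof of Lemma 8.6, display (first line)] -/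
theorem ell_le (hk : 2 ≤ k) : ell k ≤ Real.log (1 + T k * U k) / T k := by
  have hk1 : 1 ≤ k := le_trans (by norm_num) hk
  rw [ell, ← MaynardLargeK.integral_indicator_inv (T_pos hk) (U_pos hk1).le]
  exact integral_mono (integrable_profCut hk) (integrable_indicator_inv (T_pos hk).le)
    (profCut_le_indicator_inv hk)

/-- `L_k ≥ log(1 + (9/10)T_kU_k)/T_k`. [cite: Maynard2016DenseClusters, proof of Lemma 8.6, display (first line)] -/
theorem ell_ge (hk : 2 ≤ k) : Real.log (1 + T k * (9 / 10 * U k)) / T k ≤ ell k := by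
  have hk1 : 1 ≤ k := le_trans (by norm_num) hk
  have h9 : (0 : ℝ) ≤ 9 / 10 * U k := by have := U_pos hk1; positivity
  rw [ell, ← MaynardLargeK.integral_indicator_inv (T_pos hk) h9]
  exact integral_mono (integrable_indicator_inv (T_pos hk).le) (integrable_profCut hk)
    (indicator_inv_le_profCut hk)

/-- `L_k > 0`. [cite: Maynard2016DenseClusters, Lemma 8.6] -/
theorem ell_pos (hk : 2 ≤ k) : 0 < ell k := by
  have hk1 : 1 ≤ k := le_trans (by norm_num) hk
  refine lt_of_lt_of_le (div_pos (Real.log_pos ?_) (T_pos hk)) (ell_ge hk)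
  have := U_pos hk1; have := T_pos hk
  nlinarith

/-- `μ_k ≤ (log(1 + T_kU_k) − 1 + 1/(1 + T_kU_k))/T_k²`. [cite: MaynardAnnals2015, §8 (8.19) (third formula)] -/
theorem mom_le (hk : 2 ≤ k) :
    mom k ≤ (Real.log (1 + T k * U k) - 1 + (1 + T k * U k)⁻¹) / T k ^ 2 := by
  have hk1 : 1 ≤ k := le_trans (by norm_num) hk
  rw [mom, ← MaynardLargeK.integral_mul_indicator_inv_sq (T_pos hk) (U_pos hk1).le]
  refine integral_mono (integrable_mul_profCut_sq hk) (integrable_mul_indicator_inv_sq (T_pos hk).le)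
    fun x => ?_
  dsimp only
  by_cases hx : 0 ≤ x
  · exact mul_le_mul_of_nonneg_left
      (pow_le_pow_left₀ (profCut_nonneg hk x) (profCut_le_indicator_inv hk x) 2) hx
  · rw [profCut_of_neg (not_le.1 hx), indicator_of_notMem (fun h => hx h.1)]

/-- `μ_k ≤ log(1 + T_kU_k)/T_k²`. [cite: MaynardAnnals2015, §8 (8.19)] -/
theorem mom_le' (hk : 2 ≤ k) : mom k ≤ Real.log (1 + T k * U k) / T k ^ 2 := by
  have hk1 : 1 ≤ k := le_trans (by norm_num) hk
  refine (mom_le hk).trans (div_le_div_of_nonneg_right ?_ (by positivity))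
  have hTU : 0 < T k * U k := mul_pos (T_pos hk) (U_pos hk1)
  have : (1 + T k * U k)⁻¹ ≤ 1 := inv_le_one_of_one_le₀ (by linarith)
  linarith

/-- `μ_k ≥ 0`. [cite: MaynardAnnals2015, §8 (8.7)] -/
theorem mom_nonneg (k : ℕ) : 0 ≤ mom k := by
  rw [mom]
  refine integral_nonneg fun x => ?_
  dsimp only
  by_cases hx : 0 ≤ x
  · positivity
  · rw [profCut_of_neg (not_le.1 hx)]; simp

/-- `∫₀^∞ h_k² ≤ 1/T_k`. [cite: Maynard2016DenseClusters, proof of Lemma 8.6, display (third line)] -/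
theorem gam₂_le_inv (hk : 2 ≤ k) : gam₂ k ≤ (T k)⁻¹ := by
  have h2 : (0 : ℝ) ≤ 2 := by norm_num
  have hle : gam₂ k ≤ (1 - (1 + T k * 2)⁻¹) / T k := by
    rw [gam₂, ← MaynardLargeK.integral_indicator_inv_sq (T_pos hk) h2]
    refine integral_mono (integrable_prof₂Cut_sq hk) (integrable_indicator_inv_sq (T_pos hk).le)
      fun x => ?_
    exact pow_le_pow_left₀ (prof₂Cut_nonneg hk x) (prof₂Cut_le_indicator_inv hk x) 2
  refine hle.trans ?_
  rw [div_le_iff₀ (T_pos hk), inv_mul_cancel₀ (T_pos hk).ne']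
  have : 0 ≤ (1 + T k * 2)⁻¹ := by have := T_pos hk; positivity
  linarith

/-- `∫₀^∞ h_k ≤ log(1 + 2T_k)/T_k`. [cite: Maynard2016DenseClusters, proof of Lemma 8.6] -/
theorem ell₂_le (hk : 2 ≤ k) : ell₂ k ≤ Real.log (1 + T k * 2) / T k := by
  rw [ell₂, ← MaynardLargeK.integral_indicator_inv (T_pos hk) (by norm_num : (0 : ℝ) ≤ 2)]
  exact integral_mono (integrable_prof₂Cut hk) (integrable_indicator_inv (T_pos hk).le)
    (prof₂Cut_le_indicator_inv hk)

/-- `∫₀^∞ h_k² ≥ 0`. [cite: Maynard2016DenseClusters, Lemma 8.6] -/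
theorem gam₂_nonneg (k : ℕ) : 0 ≤ gam₂ k := integral_nonneg fun _ => sq_nonneg _

/-- `∫₀^∞ h_k ≥ 0`. [cite: Maynard2016DenseClusters, Lemma 8.6] -/
theorem ell₂_nonneg (hk : 2 ≤ k) : 0 ≤ ell₂ k := integral_nonneg (prof₂Cut_nonneg hk)

end CutProfiles

/-! ## §5 `F₁` is a product: `I(F₁) = γ^k`, `J(F₁) = L² γ^{k−1}` -/

section ProductStructure

variable {k n : ℕ}

/-- The orthant is measurable. [cite: Maynard2016DenseClusters, Lemma 8.6] -/
theorem measurableSet_orthant (n : ℕ) : MeasurableSet (orthant n) :=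
  MeasurableSet.univ_pi fun _ => measurableSet_Ici

/-- Membership in the orthant. [cite: Maynard2016DenseClusters, Lemma 8.6] -/
theorem mem_orthant {t : Fin n → ℝ} : t ∈ orthant n ↔ ∀ i, 0 ≤ t i := by
  simp only [orthant, Set.mem_univ_pi, Set.mem_Ici]

/-- On the orthant `(∏ⱼ g_k(tⱼ))² = ∏ⱼ (1_{[0,∞)}g_k)(tⱼ)²`, and off it the right side vanishes:
`1_{[0,∞)^n} (∏ g_k)² = ∏ (1_{[0,∞)} g_k)²`. [cite: Maynard2016DenseClusters, proof of Lemma 8.6] -/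
theorem indicator_orthant_prod_sq (k n : ℕ) (t : Fin n → ℝ) :
    (orthant n).indicator (fun t => (∏ j, prof k (t j)) ^ 2) t = ∏ j, profCut k (t j) ^ 2 := by
  by_cases ht : t ∈ orthant n
  · rw [indicator_of_mem ht, ← Finset.prod_pow]
    exact Finset.prod_congr rfl fun j _ => by rw [profCut_of_nonneg (mem_orthant.1 ht j)]
  · rw [indicator_of_notMem ht]
    obtain ⟨j, hj⟩ : ∃ j, t j < 0 := by
      have h := ht; rw [mem_orthant] at h; simpa only [not_forall, not_le] using h
    exact (Finset.prod_eq_zero (Finset.mem_univ j) (by rw [profCut_of_neg hj]; ring)).symm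

/-- `∫_{[0,∞)^n} (∏ⱼ g_k(tⱼ))² dt = γ_k^n` (Fubini). [cite: Maynard2016DenseClusters, proof of Lemma 8.6 («I_k(F_1)»)] -/
theorem setIntegral_orthant_prod_sq (k n : ℕ) :
    ∫ t in orthant n, (∏ j, prof k (t j)) ^ 2 = gam k ^ n := by
  rw [← integral_indicator (measurableSet_orthant n)]
  simp_rw [indicator_orthant_prod_sq k n]
  rw [integral_fintype_prod_volume_eq_pow (fun x => profCut k x ^ 2), Fintype.card_fin, gam]

/-- **`I_k(F₁) = γ_k^k`.** [cite: Maynard2016DenseClusters, proof of Lemma 8.6 («I_k(F_1)»)] -/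
theorem orthantI_F₁ (k : ℕ) : orthantI k (F₁ k) = gam k ^ k :=
  setIntegral_orthant_prod_sq k k

/-- `∫₀^∞ g_k = L_k` as a set integral. [cite: Maynard2016DenseClusters, proof of Lemma 8.6] -/
theorem setIntegral_Ici_prof (k : ℕ) : ∫ u in Ici (0 : ℝ), prof k u = ell k := by
  rw [ell, profCut, integral_indicator measurableSet_Ici]

/-- `∫₀^∞ h_k = ∫ 1_{[0,∞)} h_k` as a set integral. [cite: Maynard2016DenseClusters, proof of Lemma 8.6] -/
theorem setIntegral_Ici_prof₂ (k : ℕ) : ∫ u in Ici (0 : ℝ), prof₂ k u = ell₂ k := by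
  rw [ell₂, prof₂Cut, integral_indicator measurableSet_Ici]

/-- `F₁(t; t_m := u) = g_k(u) ∏ⱼ g_k(sⱼ)` (`k = n + 1`). [cite: Maynard2016DenseClusters, proof of Lemma 8.6] -/
theorem F₁_insertNth (m : Fin (n + 1)) (u : ℝ) (s : Fin n → ℝ) :
    F₁ (n + 1) (Fin.insertNth m u s) = prof (n + 1) u * ∏ j, prof (n + 1) (s j) :=
  MaynardLargeK.prodProfile_insertNth (G := F₁ (n + 1)) (g := prof (n + 1)) rfl m u s

/-- The inner integral of `J^{(m)}(F₁)`: `∫₀^∞ F₁(t; t_m := u) du = L_k ∏ⱼ g_k(sⱼ)` (`k = n + 1`).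
[cite: Maynard2016DenseClusters, proof of Lemma 8.6 («J_k(F_1)»)] -/
theorem inner_F₁ (m : Fin (n + 1)) (s : Fin n → ℝ) :
    ∫ u in Ici (0 : ℝ), F₁ (n + 1) (Fin.insertNth m u s) = ell (n + 1) * ∏ j, prof (n + 1) (s j) := by
  simp_rw [F₁_insertNth m]
  rw [integral_mul_const, setIntegral_Ici_prof, mul_comm]

/-- **`J_k^{(m)}(F₁) = L_k² γ_k^{k−1}`** (`k = n + 1`). [cite: Maynard2016DenseClusters, proof of Lemma 8.6 («J_k(F_1)»)] -/
theorem orthantJ_F₁ (n : ℕ) (m : Fin (n + 1)) : orthantJ n m (F₁ (n + 1)) = ell (n + 1) ^ 2 * gam (n + 1) ^ n := by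
  rw [orthantJ]
  simp_rw [inner_F₁ m, mul_pow]
  rw [integral_const_mul, setIntegral_orthant_prod_sq]

end ProductStructure

/-! ## §6 The concentration (second-moment) tail bound at a general threshold

Maynard 2015 (8.6)–(8.10), as in the tree (`MaynardLargeK.setIntegral_tail_prod_sq_le`, threshold
`1 − τ`), re-run verbatim with an arbitrary threshold `θ > n μ₁/γ`. -/

section Tail

variable {n : ℕ} {g : ℝ → ℝ} {τ θ : ℝ}

/-- **Tail bound at threshold `θ`.** For measurable `0 ≤ g ≤ 1` supported in `[0, τ]` with
`γ = ∫ g² > 0`, `μ₁ = ∫ x g(x)²` and `n μ₁/γ < θ`: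
`∫_{∑ sⱼ > θ} ∏ⱼ g(sⱼ)² ds ≤ n γ^{n−1} τ μ₁ / (θ − n μ₁/γ)²` — on the tail
`1 ≤ (θ − nμ₁/γ)^{-2} (∑ⱼ sⱼ − n μ₁/γ)²`, the square is expanded (cross terms vanish,
`MaynardLargeK.integral_sq_sum_mul_prod`) and `x² g² ≤ τ x g²` on the support.
[cite: MaynardAnnals2015, §8 of arXiv:1311.4600v3, (8.5)–(8.10) (threshold 1 − T/k there; the argument is identical for any threshold)] -/
theorem setIntegral_tail_prod_sq_le_of_lt (hg : Measurable g) (h0 : ∀ x, 0 ≤ g x) (h1 : ∀ x, g x ≤ 1)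
    (hsupp : ∀ x, g x ≠ 0 → x ∈ Set.Icc 0 τ) (hW : 0 < ∫ x, g x ^ 2)
    (hD : n * ((∫ x, x * g x ^ 2) / ∫ x, g x ^ 2) < θ) :
    ∫ s in {s : Fin n → ℝ | θ < ∑ j, s j}, ∏ j, g (s j) ^ 2 ≤
      n * (∫ x, g x ^ 2) ^ (n - 1) * (τ * ∫ x, x * g x ^ 2) /
        (θ - n * ((∫ x, x * g x ^ 2) / ∫ x, g x ^ 2)) ^ 2 := by
  set W := ∫ x, g x ^ 2 with hWdef
  set M1 := ∫ x, x * g x ^ 2 with hM1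
  set ν := M1 / W with hν
  set D := θ - n * ν with hDdef
  have hDpos : 0 < D := by rw [hDdef]; linarith
  obtain ⟨w, hw⟩ : ∃ w : ℝ → ℝ, w = fun x => g x ^ 2 := ⟨_, rfl⟩
  obtain ⟨a, ha⟩ : ∃ a : ℝ → ℝ, a = fun x => x - ν := ⟨_, rfl⟩
  have hwm : Measurable w := by rw [hw]; exact hg.pow_const 2
  have hw0 : ∀ x, 0 ≤ w x := fun x => by rw [hw]; exact sq_nonneg _
  have hw1 : ∀ x, |w x| ≤ 1 := fun x => by
    rw [hw]; dsimp only
    rw [abs_of_nonneg (sq_nonneg _)]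
    exact pow_le_one₀ (h0 x) (h1 x)
  have hwsupp : ∀ x, w x ≠ 0 → x ∈ Set.Icc 0 τ := fun x hx => by
    refine hsupp x fun h => hx ?_
    rw [hw]; dsimp only; rw [h]; ring
  have hwint : Integrable w := MaynardLargeK.integrable_of_forall_mem_Icc hwm hw1 hwsupp
  have hxw : Integrable fun x => x * w x :=
    MaynardLargeK.integrable_mul_of_forall_mem_Icc hwm hw1 hwsupp continuous_id
  have hx2w : Integrable fun x => x ^ 2 * w x :=
    MaynardLargeK.integrable_mul_of_forall_mem_Icc hwm hw1 hwsupp (continuous_pow 2)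
  have haw : Integrable fun x => a x * w x := by
    rw [ha]
    exact MaynardLargeK.integrable_mul_of_forall_mem_Icc hwm hw1 hwsupp
      (continuous_id.sub continuous_const)
  have ha2w : Integrable fun x => a x ^ 2 * w x := by
    rw [ha]
    exact MaynardLargeK.integrable_mul_of_forall_mem_Icc hwm hw1 hwsupp
      ((continuous_id.sub continuous_const).pow 2)
  have hWw : ∫ x, w x = W := by rw [hw]
  have hM1w : ∫ x, x * w x = M1 := by rw [hw]
  have hνW : ν * W = M1 := by rw [hν]; field_simp
  -- `∫ a w = 0`
  have h0aw : ∫ x, a x * w x = 0 := by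
    have : (fun x => a x * w x) = fun x => x * w x - ν * w x := by
      funext x; rw [ha]; dsimp only; ring
    rw [this, integral_sub hxw (hwint.const_mul ν), integral_const_mul, hM1w, hWw, hνW, sub_self]
  -- `∫ a² w ≤ τ M1`
  have ha2le : ∫ x, a x ^ 2 * w x ≤ τ * M1 := by
    have h1' : ∫ x, a x ^ 2 * w x = (∫ x, x ^ 2 * w x) - ν ^ 2 * W := by
      have : (fun x => a x ^ 2 * w x) =
          fun x => x ^ 2 * w x - (2 * ν) * (x * w x) + ν ^ 2 * w x := by
        funext x; rw [ha]; dsimp only; ring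
      rw [this, integral_add (hx2w.sub' (hxw.const_mul _)) (hwint.const_mul _),
        integral_sub hx2w (hxw.const_mul _), integral_const_mul, integral_const_mul, hM1w, hWw,
        ← hνW]
      ring
    have h2' : ∫ x, x ^ 2 * w x ≤ ∫ x, τ * (x * w x) := by
      refine integral_mono hx2w (hxw.const_mul τ) fun x => ?_
      dsimp only
      by_cases hx : w x = 0
      · rw [hx]; simp
      · have hxI := hwsupp x hx
        have : x ^ 2 ≤ τ * x := by nlinarith [hxI.1, hxI.2]
        nlinarith [hw0 x]
    rw [integral_const_mul, hM1w] at h2'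
    have : 0 ≤ ν ^ 2 * W := by positivity
    linarith
  -- pointwise domination of the tail indicator by the second moment
  have hpt : ∀ s : Fin n → ℝ,
      {s : Fin n → ℝ | θ < ∑ j, s j}.indicator (fun s => ∏ j, w (s j)) s ≤
        D⁻¹ ^ 2 * ((∑ j, a (s j)) ^ 2 * ∏ j, w (s j)) := by
    intro s
    have hP0 : 0 ≤ ∏ j, w (s j) := Finset.prod_nonneg fun j _ => hw0 _
    by_cases hs : s ∈ {s : Fin n → ℝ | θ < ∑ j, s j}
    · rw [indicator_of_mem hs]
      have hsum : ∑ j, a (s j) = ∑ j, s j - n * ν := by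
        rw [ha]; dsimp only
        rw [Finset.sum_sub_distrib, Finset.sum_const, Finset.card_univ, Fintype.card_fin,
          nsmul_eq_mul]
      have hlt : D < ∑ j, a (s j) := by
        rw [hsum, hDdef]; have := hs; simp only [mem_setOf_eq] at this; linarith
      have h1le : 1 ≤ D⁻¹ ^ 2 * (∑ j, a (s j)) ^ 2 := by
        rw [← mul_pow]
        have : 1 ≤ D⁻¹ * ∑ j, a (s j) := by
          rw [inv_mul_eq_div, le_div_iff₀ hDpos]; linarith
        nlinarith
      calc ∏ j, w (s j) = 1 * ∏ j, w (s j) := (one_mul _).symm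
        _ ≤ (D⁻¹ ^ 2 * (∑ j, a (s j)) ^ 2) * ∏ j, w (s j) :=
            mul_le_mul_of_nonneg_right h1le hP0
        _ = _ := by ring
    · rw [indicator_of_notMem hs]
      have : 0 ≤ (∑ j, a (s j)) ^ 2 := sq_nonneg _
      positivity
  -- integrate
  have hprodint : Integrable fun s : Fin n → ℝ => ∏ j, w (s j) :=
    Integrable.fintype_prod (f := fun _ => w) fun _ => hwint
  have hmeas : MeasurableSet {s : Fin n → ℝ | θ < ∑ j, s j} :=
    measurableSet_lt measurable_const (Finset.measurable_sum _ fun i _ => measurable_pi_apply i)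
  calc ∫ s in {s : Fin n → ℝ | θ < ∑ j, s j}, ∏ j, g (s j) ^ 2
      = ∫ s, {s : Fin n → ℝ | θ < ∑ j, s j}.indicator (fun s => ∏ j, w (s j)) s := by
        rw [integral_indicator hmeas, hw]
    _ ≤ ∫ s : Fin n → ℝ, D⁻¹ ^ 2 * ((∑ j, a (s j)) ^ 2 * ∏ j, w (s j)) :=
        integral_mono (hprodint.indicator hmeas)
          ((MaynardLargeK.integrable_sq_sum_mul_prod hwint haw ha2w).const_mul _) hpt
    _ = D⁻¹ ^ 2 * (n * W ^ (n - 1) * ∫ x, a x ^ 2 * w x) := by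
        rw [integral_const_mul, MaynardLargeK.integral_sq_sum_mul_prod hwint haw ha2w h0aw, hWw]
    _ ≤ D⁻¹ ^ 2 * (n * W ^ (n - 1) * (τ * M1)) := by
        have : 0 ≤ (n : ℝ) * W ^ (n - 1) := by positivity
        gcongr
    _ = n * W ^ (n - 1) * (τ * M1) / D ^ 2 := by
        rw [inv_pow, inv_mul_eq_div]

/-- Splitting `(∫ g²)ⁿ = ∫_{ℝⁿ} ∏ⱼ g(sⱼ)²` at the threshold `θ`: `(∫ g²)ⁿ = ∫_{∑ sⱼ ≤ θ} + ∫_{∑ sⱼ > θ}`.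
[cite: MaynardAnnals2015, §8 of arXiv:1311.4600v3, (8.4)–(8.5)] -/
theorem pow_eq_setIntegral_add_setIntegral_of (hg : Measurable g) (h0 : ∀ x, 0 ≤ g x)
    (h1 : ∀ x, g x ≤ 1) (hsupp : ∀ x, g x ≠ 0 → x ∈ Set.Icc 0 τ) (θ : ℝ) :
    (∫ x, g x ^ 2) ^ n = (∫ s in {s : Fin n → ℝ | ∑ j, s j ≤ θ}, ∏ j, g (s j) ^ 2) +
      ∫ s in {s : Fin n → ℝ | θ < ∑ j, s j}, ∏ j, g (s j) ^ 2 := by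
  have habs : ∀ x, |g x| ≤ 1 := fun x => by rw [abs_of_nonneg (h0 x)]; exact h1 x
  have hint : Integrable fun s : Fin n → ℝ => ∏ j, g (s j) ^ 2 :=
    Integrable.fintype_prod (f := fun _ x => g x ^ 2)
      fun _ => MaynardLargeK.integrable_sq_of_forall_mem_Icc hg habs hsupp
  have hAm : MeasurableSet {s : Fin n → ℝ | ∑ j, s j ≤ θ} :=
    measurableSet_le (Finset.measurable_sum _ fun i _ => measurable_pi_apply i) measurable_const
  have hcompl : {s : Fin n → ℝ | ∑ j, s j ≤ θ}ᶜ = {s : Fin n → ℝ | θ < ∑ j, s j} := by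
    ext s; simp [not_le]
  rw [← hcompl, integral_add_compl hAm hint,
    integral_fintype_prod_volume_eq_pow (fun x => g x ^ 2), Fintype.card_fin]

/-- **The truncated product integral is almost all of `γⁿ`.** For the cut profile `g = 1_{[0,∞)} g_k`
(supported in `[0, U_k]`) and a threshold `θ > n μ_k/γ_k`:
`∫_{∑ sⱼ ≤ θ} ∏ⱼ g(sⱼ)² ≥ γ_kⁿ − n γ_k^{n−1} U_k μ_k/(θ − n μ_k/γ_k)²`.
[cite: MaynardAnnals2015, §8 of arXiv:1311.4600v3, (8.5)–(8.10)] -/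
theorem setIntegral_le_threshold_ge {k : ℕ} (hk : 2 ≤ k) (hD : n * (mom k / gam k) < θ) :
    gam k ^ n - n * gam k ^ (n - 1) * (U k * mom k) / (θ - n * (mom k / gam k)) ^ 2 ≤
      ∫ s in {s : Fin n → ℝ | ∑ j, s j ≤ θ}, ∏ j, profCut k (s j) ^ 2 := by
  have hk1 : 1 ≤ k := le_trans (by norm_num) hk
  have hsplit := pow_eq_setIntegral_add_setIntegral_of (n := n) (measurable_profCut k)
    (profCut_nonneg hk) (profCut_le_one hk) (fun _ h => mem_Icc_of_profCut_ne_zero hk1 h) θ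
  have htail := setIntegral_tail_prod_sq_le_of_lt (n := n) (measurable_profCut k)
    (profCut_nonneg hk) (profCut_le_one hk) (fun _ h => mem_Icc_of_profCut_ne_zero hk1 h)
    (gam_pos hk) hD
  rw [gam, mom] at *
  linarith

end Tail

/-! ## §7 The concentration argument for `F`: `I(F) ≥ γ^k − tail`, `J(F) ≥ L²(γ^{k−1} − tail)`,
and the trivial upper bounds `I(F) ≤ I(F₁)`, `J(F) ≤ J(F₁)` -/

section Concentration

variable {k n : ℕ}

/-- `F₁` is measurable. [cite: Maynard2016DenseClusters, (7.6)] -/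
theorem measurable_F₁ (k : ℕ) : Measurable (F₁ k) :=
  Finset.measurable_prod _ fun i _ => (measurable_prof k).comp (measurable_pi_apply i)

/-- `F` is measurable. [cite: Maynard2016DenseClusters, (7.4)] -/
theorem measurable_F (k : ℕ) : Measurable (F k) :=
  (measurable_psi.comp (Finset.measurable_sum _ fun i _ => measurable_pi_apply i)).mul
    (measurable_F₁ k)

/-- `∏ⱼ g_k(sⱼ)²` (cut profiles) is integrable on `ℝⁿ`. [cite: Maynard2016DenseClusters, proof of Lemma 8.6] -/
theorem integrable_prod_profCut_sq (hk : 2 ≤ k) (n : ℕ) :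
    Integrable fun s : Fin n → ℝ => ∏ j, profCut k (s j) ^ 2 :=
  Integrable.fintype_prod (f := fun _ x => profCut k x ^ 2) fun _ => integrable_profCut_sq hk

/-- `(∏ⱼ g_k(tⱼ))²` is integrable on the orthant. [cite: Maynard2016DenseClusters, proof of Lemma 8.6] -/
theorem integrableOn_prod_sq (hk : 2 ≤ k) (n : ℕ) :
    IntegrableOn (fun t : Fin n → ℝ => (∏ j, prof k (t j)) ^ 2) (orthant n) := by
  rw [← integrable_indicator_iff (measurableSet_orthant n)]
  have : (orthant n).indicator (fun t : Fin n → ℝ => (∏ j, prof k (t j)) ^ 2) =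
      fun t => ∏ j, profCut k (t j) ^ 2 := funext (indicator_orthant_prod_sq k n)
  rw [this]
  exact integrable_prod_profCut_sq hk n

/-- `F²` is integrable on the orthant (`0 ≤ F ≤ F₁`). [cite: Maynard2016DenseClusters, Lemma 8.6] -/
theorem integrableOn_F_sq (hk : 2 ≤ k) : IntegrableOn (fun t => F k t ^ 2) (orthant k) := by
  refine Integrable.mono' (integrableOn_prod_sq hk k)
    ((measurable_F k).pow_const 2).aestronglyMeasurable ?_
  refine ae_restrict_of_forall_mem (measurableSet_orthant k) fun t ht => ?_
  rw [Real.norm_eq_abs, abs_of_nonneg (sq_nonneg _)]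
  exact pow_le_pow_left₀ (F_nonneg hk ht) (F_le_F₁ hk ht) 2

/-- The set integral over `{∑ ≤ θ}` of `∏ g_k²` (cut) as an orthant integral of the truncated `(∏ g_k)²`.
[cite: Maynard2016DenseClusters, proof of Lemma 8.6 (8.13)–(8.14)] -/
theorem setIntegral_threshold_eq (k n : ℕ) (θ : ℝ) :
    ∫ s in {s : Fin n → ℝ | ∑ j, s j ≤ θ}, ∏ j, profCut k (s j) ^ 2 =
      ∫ t in orthant n, {t : Fin n → ℝ | ∑ j, t j ≤ θ}.indicator
        (fun t => (∏ j, prof k (t j)) ^ 2) t := by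
  have hAm : MeasurableSet {s : Fin n → ℝ | ∑ j, s j ≤ θ} :=
    measurableSet_le (Finset.measurable_sum _ fun i _ => measurable_pi_apply i) measurable_const
  rw [← integral_indicator hAm, ← integral_indicator (measurableSet_orthant n)]
  refine integral_congr_ae (ae_of_all _ fun t => ?_)
  change {s : Fin n → ℝ | ∑ j, s j ≤ θ}.indicator (fun s => ∏ j, profCut k (s j) ^ 2) t =
    (orthant n).indicator ({t : Fin n → ℝ | ∑ j, t j ≤ θ}.indicator
      fun t => (∏ j, prof k (t j)) ^ 2) t
  rw [Set.indicator_indicator, Set.inter_comm, ← Set.indicator_indicator]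
  congr 1
  exact funext fun t' => (indicator_orthant_prod_sq k n t').symm

/-- **Lower bound for `I_k(F)` by concentration**: if `k μ_k/γ_k < 9/10` then
`I_k(F) ≥ γ_k^k − k γ_k^{k−1} U_k μ_k/(9/10 − k μ_k/γ_k)²` (restrict to `∑ tᵢ ≤ 9/10`, where
`F = F₁`, and bound the discarded tail by the second-moment argument).
[cite: Maynard2016DenseClusters, proof of Lemma 8.6 (8.14)] -/
theorem orthantI_F_ge (hk : 2 ≤ k) (hD : k * (mom k / gam k) < 9 / 10) :
    gam k ^ k - k * gam k ^ (k - 1) * (U k * mom k) / (9 / 10 - k * (mom k / gam k)) ^ 2 ≤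
      orthantI k (F k) := by
  have hAm : MeasurableSet {s : Fin k → ℝ | ∑ j, s j ≤ 9 / 10} :=
    measurableSet_le (Finset.measurable_sum _ fun i _ => measurable_pi_apply i) measurable_const
  refine (setIntegral_le_threshold_ge (n := k) hk hD).trans ?_
  rw [setIntegral_threshold_eq, orthantI]
  refine setIntegral_mono_on ((integrableOn_prod_sq hk k).indicator hAm) (integrableOn_F_sq hk)
    (measurableSet_orthant k) fun t ht => ?_
  by_cases hA : t ∈ {s : Fin k → ℝ | ∑ j, s j ≤ 9 / 10}
  · rw [indicator_of_mem hA, F_eq_F₁ (by simpa using hA)]; rfl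
  · rw [indicator_of_notMem hA]; exact sq_nonneg _

/-- **`I_k(F) ≤ I_k(F₁)`.** [cite: Maynard2016DenseClusters, proof of Lemma 8.6 («trivial bounds»)] -/
theorem orthantI_F_le (hk : 2 ≤ k) : orthantI k (F k) ≤ orthantI k (F₁ k) :=
  setIntegral_mono_on (integrableOn_F_sq hk) (integrableOn_prod_sq hk k) (measurableSet_orthant k)
    fun _ ht => pow_le_pow_left₀ (F_nonneg hk ht) (F_le_F₁ hk ht) 2

/-! ### The fibres of `J^{(m)}` -/

/-- `∑ᵢ (s; s_m := u)ᵢ = u + ∑ⱼ sⱼ`. [cite: Maynard2016DenseClusters, proof of Lemma 8.6] -/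
theorem sum_insertNth (m : Fin (n + 1)) (u : ℝ) (s : Fin n → ℝ) :
    ∑ i, Fin.insertNth m u s i = u + ∑ j, s j := by
  rw [Fin.sum_univ_succAbove _ m]
  simp only [Fin.insertNth_apply_same, Fin.insertNth_apply_succAbove]

/-- `(s; s_m := u) ∈ [0,∞)^{n+1} ↔ u ≥ 0 ∧ s ∈ [0,∞)ⁿ`. [cite: Maynard2016DenseClusters, proof of Lemma 8.6] -/
theorem insertNth_mem_orthant_iff (m : Fin (n + 1)) (u : ℝ) (s : Fin n → ℝ) :
    Fin.insertNth m u s ∈ orthant (n + 1) ↔ 0 ≤ u ∧ s ∈ orthant n := by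
  rw [mem_orthant, mem_orthant, Fin.forall_iff_succAbove m]
  simp only [Fin.insertNth_apply_same, Fin.insertNth_apply_succAbove]

/-- The fibre `u ↦ F₁(s; s_m := u)` is integrable on `[0, ∞)`. [cite: Maynard2016DenseClusters, proof of Lemma 8.6] -/
theorem integrableOn_F₁_insertNth (hn : 2 ≤ n + 1) (m : Fin (n + 1)) (s : Fin n → ℝ) :
    IntegrableOn (fun u => F₁ (n + 1) (Fin.insertNth m u s)) (Ici 0) := by
  simp_rw [F₁_insertNth m]
  refine Integrable.mul_const ?_ _
  have h := integrable_profCut hn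
  rwa [profCut, integrable_indicator_iff measurableSet_Ici] at h

/-- The fibre `u ↦ F(s; s_m := u)` is integrable on `[0, ∞)` for `s` in the orthant.
[cite: Maynard2016DenseClusters, proof of Lemma 8.6] -/
theorem integrableOn_F_insertNth (hn : 2 ≤ n + 1) (m : Fin (n + 1)) {s : Fin n → ℝ}
    (hs : s ∈ orthant n) :
    IntegrableOn (fun u => F (n + 1) (Fin.insertNth m u s)) (Ici 0) := by
  have hmeas : Measurable fun u : ℝ => F (n + 1) (Fin.insertNth m u s) :=
    (measurable_F (n + 1)).comp (continuous_id.finInsertNth m continuous_const).measurable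
  refine Integrable.mono' (integrableOn_F₁_insertNth hn m s) hmeas.aestronglyMeasurable ?_
  refine ae_restrict_of_forall_mem measurableSet_Ici fun u hu => ?_
  have ht : Fin.insertNth m u s ∈ orthant (n + 1) := (insertNth_mem_orthant_iff m u s).2 ⟨hu, hs⟩
  rw [Real.norm_eq_abs, abs_of_nonneg (F_nonneg hn ht)]
  exact F_le_F₁ hn ht

/-- `0 ≤ ∫₀^∞ F(s; s_m := u) du` for `s` in the orthant. [cite: Maynard2016DenseClusters, proof of Lemma 8.6] -/
theorem inner_F_nonneg (hn : 2 ≤ n + 1) (m : Fin (n + 1)) {s : Fin n → ℝ} (hs : s ∈ orthant n) :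
    0 ≤ ∫ u in Ici (0 : ℝ), F (n + 1) (Fin.insertNth m u s) :=
  setIntegral_nonneg measurableSet_Ici fun u hu =>
    F_nonneg hn ((insertNth_mem_orthant_iff m u s).2 ⟨hu, hs⟩)

/-- `∫₀^∞ F(s; s_m := u) du ≤ ∫₀^∞ F₁(s; s_m := u) du = L ∏ g(sⱼ)` for `s` in the orthant.
[cite: Maynard2016DenseClusters, proof of Lemma 8.6 («trivial bounds»)] -/
theorem inner_F_le (hn : 2 ≤ n + 1) (m : Fin (n + 1)) {s : Fin n → ℝ} (hs : s ∈ orthant n) :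
    ∫ u in Ici (0 : ℝ), F (n + 1) (Fin.insertNth m u s) ≤ ell (n + 1) * ∏ j, prof (n + 1) (s j) := by
  rw [← inner_F₁ m s]
  exact setIntegral_mono_on (integrableOn_F_insertNth hn m hs) (integrableOn_F₁_insertNth hn m s)
    measurableSet_Ici fun u hu => F_le_F₁ hn ((insertNth_mem_orthant_iff m u s).2 ⟨hu, hs⟩)

/-- On the fibres with `∑ⱼ sⱼ ≤ 9/10 − U_k` the cut-off `ψ(∑ tᵢ)` is invisible:
`∫₀^∞ F(s; s_m := u) du = L_k ∏ⱼ g_k(sⱼ)` (for `u ≤ U_k` the sum is `≤ 9/10`, for `u > U_k` both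
sides' integrands vanish). [cite: Maynard2016DenseClusters, proof of Lemma 8.6 (8.13)] -/
theorem inner_F_eq (hn : 2 ≤ n + 1) (m : Fin (n + 1)) {s : Fin n → ℝ}
    (hsum : ∑ j, s j ≤ 9 / 10 - U (n + 1)) :
    ∫ u in Ici (0 : ℝ), F (n + 1) (Fin.insertNth m u s) = ell (n + 1) * ∏ j, prof (n + 1) (s j) := by
  have hn1 : 1 ≤ n + 1 := le_trans (by norm_num) hn
  rw [← inner_F₁ m s]
  refine setIntegral_congr_fun measurableSet_Ici fun u _ => ?_
  by_cases hu : u ≤ U (n + 1)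
  · exact F_eq_F₁ (by rw [sum_insertNth]; linarith)
  · rw [F_eq_psi_mul_F₁, F₁_insertNth, prof_eq_zero hn1 (not_le.1 hu).le]; ring

/-- The outer integrand of `J^{(m)}(F)` is a.e.-strongly measurable (Fubini measurability).
[cite: Maynard2016DenseClusters, proof of Lemma 8.6] -/
theorem aestronglyMeasurable_inner_F (m : Fin (n + 1)) {μ : Measure (Fin n → ℝ)} :
    AEStronglyMeasurable (fun s => (∫ u in Ici (0 : ℝ), F (n + 1) (Fin.insertNth m u s)) ^ 2) μ := by
  have h : StronglyMeasurable fun p : (Fin n → ℝ) × ℝ => F (n + 1) (Fin.insertNth m p.2 p.1) :=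
    ((measurable_F (n + 1)).comp
      (continuous_snd.finInsertNth m continuous_fst).measurable).stronglyMeasurable
  have := h.integral_prod_right' (ν := volume.restrict (Ici (0 : ℝ)))
  exact (this.measurable.pow_const 2).aestronglyMeasurable

/-- The outer integrand of `J^{(m)}(F)` is integrable on the orthant (dominated by that of `F₁`).
[cite: Maynard2016DenseClusters, proof of Lemma 8.6] -/
theorem integrableOn_inner_F_sq (hn : 2 ≤ n + 1) (m : Fin (n + 1)) :
    IntegrableOn (fun s => (∫ u in Ici (0 : ℝ), F (n + 1) (Fin.insertNth m u s)) ^ 2) (orthant n) := by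
  have hdom : IntegrableOn (fun s : Fin n → ℝ => ell (n + 1) ^ 2 * (∏ j, prof (n + 1) (s j)) ^ 2)
      (orthant n) := (integrableOn_prod_sq hn n).const_mul _
  refine Integrable.mono' hdom (aestronglyMeasurable_inner_F m) ?_
  refine ae_restrict_of_forall_mem (measurableSet_orthant n) fun s hs => ?_
  rw [Real.norm_eq_abs, abs_of_nonneg (sq_nonneg _), ← mul_pow]
  exact pow_le_pow_left₀ (inner_F_nonneg hn m hs) (inner_F_le hn m hs) 2

/-- **`J^{(m)}(F) ≤ J^{(m)}(F₁)`.** [cite: Maynard2016DenseClusters, proof of Lemma 8.6 («trivial bounds»)] -/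
theorem orthantJ_F_le (hn : 2 ≤ n + 1) (m : Fin (n + 1)) :
    orthantJ n m (F (n + 1)) ≤ orthantJ n m (F₁ (n + 1)) := by
  rw [orthantJ, orthantJ]
  simp_rw [inner_F₁ m]
  refine setIntegral_mono_on (integrableOn_inner_F_sq hn m) ?_ (measurableSet_orthant n)
    fun s hs => ?_
  · simp_rw [mul_pow]; exact (integrableOn_prod_sq hn n).const_mul _
  · exact pow_le_pow_left₀ (inner_F_nonneg hn m hs) (inner_F_le hn m hs) 2

/-- **Lower bound for `J^{(m)}(F)` by concentration** (`k = n + 1`): if `n μ_k/γ_k < 9/10 − U_k` then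
`J^{(m)}(F) ≥ L_k² (γ_k^n − n γ_k^{n−1} U_k μ_k/(9/10 − U_k − n μ_k/γ_k)²)` (restrict the outer integral
to `∑ sⱼ ≤ 9/10 − U_k`, where the inner integral is exactly `L_k ∏ g_k(sⱼ)`).
[cite: Maynard2016DenseClusters, proof of Lemma 8.6 (8.13)] -/
theorem orthantJ_F_ge (hn : 2 ≤ n + 1) (m : Fin (n + 1))
    (hD : n * (mom (n + 1) / gam (n + 1)) < 9 / 10 - U (n + 1)) :
    ell (n + 1) ^ 2 * (gam (n + 1) ^ n - n * gam (n + 1) ^ (n - 1) * (U (n + 1) * mom (n + 1)) /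
        (9 / 10 - U (n + 1) - n * (mom (n + 1) / gam (n + 1))) ^ 2) ≤
      orthantJ n m (F (n + 1)) := by
  set θ := 9 / 10 - U (n + 1) with hθ
  have hAm : MeasurableSet {s : Fin n → ℝ | ∑ j, s j ≤ θ} :=
    measurableSet_le (Finset.measurable_sum _ fun i _ => measurable_pi_apply i) measurable_const
  have h1 := mul_le_mul_of_nonneg_left (setIntegral_le_threshold_ge (n := n) hn hD)
    (sq_nonneg (ell (n + 1)))
  refine h1.trans ?_
  rw [setIntegral_threshold_eq, ← integral_const_mul, orthantJ]
  refine setIntegral_mono_on (((integrableOn_prod_sq hn n).indicator hAm).const_mul _)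
    (integrableOn_inner_F_sq hn m) (measurableSet_orthant n) fun s hs => ?_
  by_cases hA : s ∈ {s : Fin n → ℝ | ∑ j, s j ≤ θ}
  · rw [indicator_of_mem hA, inner_F_eq hn m (by simpa [hθ] using hA), mul_pow]
  · rw [indicator_of_notMem hA, mul_zero]; exact sq_nonneg _

end Concentration

/-! ## §8 The function `F₂`: `k² I(F₁) ≤ I(F₂) ≤ k² (∫h²) γ^{k−1}`, and the same for `J` -/

section FTwo

variable {k n : ℕ}

/-- The profile vector of the `j`-th summand of `F₂`: `h_k` in the `j`-th coordinate, `g_k` elsewhere.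
[cite: Maynard2016DenseClusters, (7.6)] -/
def profIte (k : ℕ) {n : ℕ} (j i : Fin n) (x : ℝ) : ℝ := if i = j then prof₂ k x else prof k x

/-- `∑ⱼ ∏ᵢ (h_k if i = j else g_k)(tᵢ)` — the `n`-variable version of `F₂` with profile index `k`
(`F₂ = sumH k k`, `F₂_eq_sumH`). [cite: Maynard2016DenseClusters, (7.6)] -/
def sumH (k n : ℕ) (t : Fin n → ℝ) : ℝ := ∑ j, ∏ i, profIte k j i (t i)

/-- `F₂(t) = ∑ⱼ ∏ᵢ (h_k if i = j else g_k)(tᵢ)`. [cite: Maynard2016DenseClusters, (7.6)] -/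
theorem F₂_eq_sumH (t : Fin k → ℝ) : F₂ k t = sumH k k t := by
  unfold F₂ sumH
  refine Finset.sum_congr rfl fun j _ => ?_
  rw [← Finset.mul_prod_erase univ (fun i => profIte k j i (t i)) (Finset.mem_univ j)]
  dsimp only [profIte]
  rw [if_pos rfl]
  congr 1
  exact (Finset.prod_congr rfl fun i hi => by rw [if_neg (Finset.ne_of_mem_erase hi)]).symm

/-- `∏ᵢ g_k((s; s_m := u)ᵢ) = g_k(u) ∏ⱼ g_k(sⱼ)`. [cite: Maynard2016DenseClusters, proof of Lemma 8.6] -/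
theorem prod_prof_insertNth (m : Fin (n + 1)) (u : ℝ) (s : Fin n → ℝ) :
    ∏ i, prof k ((Fin.insertNth m u s : Fin (n + 1) → ℝ) i) = prof k u * ∏ j, prof k (s j) :=
  MaynardLargeK.prodProfile_insertNth (G := fun t : Fin (n + 1) → ℝ => ∏ i, prof k (t i))
    (g := prof k) rfl m u s

/-- The fibre of `sumH`: `sumH k (n+1) (s; s_m := u) = h_k(u) ∏ⱼ g_k(sⱼ) + g_k(u) · sumH k n s`.
[cite: Maynard2016DenseClusters, proof of Lemma 8.6] -/
theorem sumH_insertNth (m : Fin (n + 1)) (u : ℝ) (s : Fin n → ℝ) :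
    sumH k (n + 1) (Fin.insertNth m u s) = prof₂ k u * ∏ j, prof k (s j) + prof k u * sumH k n s := by
  unfold sumH
  rw [Fin.sum_univ_succAbove _ m]
  congr 1
  · rw [Fin.prod_univ_succAbove _ m]
    simp only [profIte, Fin.insertNth_apply_same, Fin.insertNth_apply_succAbove, if_true,
      Fin.succAbove_ne, if_false]
  · rw [Finset.mul_sum]
    refine Finset.sum_congr rfl fun j' _ => ?_
    rw [Fin.prod_univ_succAbove _ m]
    simp only [profIte, Fin.insertNth_apply_same, Fin.insertNth_apply_succAbove,
      Fin.succAbove_right_inj, if_neg (Fin.ne_succAbove m j')]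

/-- `sumH` is measurable. [cite: Maynard2016DenseClusters, (7.6)] -/
theorem measurable_sumH (k n : ℕ) : Measurable (sumH k n) := by
  unfold sumH
  refine Finset.measurable_sum _ fun j _ => Finset.measurable_prod _ fun i _ => ?_
  unfold profIte
  split_ifs
  · exact (measurable_prof₂ k).comp (measurable_pi_apply i)
  · exact (measurable_prof k).comp (measurable_pi_apply i)

/-- `F₂` is measurable. [cite: Maynard2016DenseClusters, (7.6)] -/
theorem measurable_F₂ (k : ℕ) : Measurable (F₂ k) := by
  have : F₂ k = sumH k k := funext F₂_eq_sumH
  rw [this]; exact measurable_sumH k k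

/-- `n ∏ᵢ g_k(tᵢ) ≤ sumH k n t` on the orthant (each summand dominates the product, `g_k ≤ h_k`).
[cite: Maynard2016DenseClusters, proof of Lemma 8.6 («trivial bounds»)] -/
theorem mul_prod_le_sumH (hk : 2 ≤ k) {t : Fin n → ℝ} (ht : t ∈ orthant n) :
    n * ∏ i, prof k (t i) ≤ sumH k n t := by
  unfold sumH
  have hterm : ∀ j ∈ (univ : Finset (Fin n)), ∏ i, prof k (t i) ≤ ∏ i, profIte k j i (t i) := by
    intro j _
    refine Finset.prod_le_prod (fun i _ => prof_nonneg hk (mem_orthant.1 ht i)) fun i _ => ?_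
    unfold profIte
    split_ifs
    · exact prof_le_prof₂ hk (mem_orthant.1 ht i)
    · exact le_rfl
  calc (n : ℝ) * ∏ i, prof k (t i) = ∑ _j : Fin n, ∏ i, prof k (t i) := by
        rw [Finset.sum_const, Finset.card_univ, Fintype.card_fin, nsmul_eq_mul]
    _ ≤ _ := Finset.sum_le_sum hterm

/-- `sumH ≥ 0` on the orthant. [cite: Maynard2016DenseClusters, (7.6)] -/
theorem sumH_nonneg (hk : 2 ≤ k) {t : Fin n → ℝ} (ht : t ∈ orthant n) : 0 ≤ sumH k n t := by
  unfold sumH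
  refine Finset.sum_nonneg fun j _ => Finset.prod_nonneg fun i _ => ?_
  unfold profIte
  split_ifs
  · exact prof₂_nonneg hk (mem_orthant.1 ht i)
  · exact prof_nonneg hk (mem_orthant.1 ht i)

/-- The squared weights of the `j`-th summand: `h_k²` (cut) in coordinate `j`, `g_k²` (cut) elsewhere.
[cite: Maynard2016DenseClusters, proof of Lemma 8.6] -/
def wIte (k : ℕ) {n : ℕ} (j i : Fin n) (x : ℝ) : ℝ :=
  if i = j then prof₂Cut k x ^ 2 else profCut k x ^ 2

/-- On the orthant `(∏ᵢ profIte)² = ∏ᵢ wIte`, and off it the right side vanishes.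
[cite: Maynard2016DenseClusters, proof of Lemma 8.6] -/
theorem indicator_orthant_prod_profIte_sq (j : Fin n) (t : Fin n → ℝ) :
    (orthant n).indicator (fun t => (∏ i, profIte k j i (t i)) ^ 2) t = ∏ i, wIte k j i (t i) := by
  by_cases ht : t ∈ orthant n
  · rw [indicator_of_mem ht, ← Finset.prod_pow]
    refine Finset.prod_congr rfl fun i _ => ?_
    unfold profIte wIte
    split_ifs
    · rw [prof₂Cut_of_nonneg (mem_orthant.1 ht i)]
    · rw [profCut_of_nonneg (mem_orthant.1 ht i)]
  · rw [indicator_of_notMem ht]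
    obtain ⟨i, hi⟩ : ∃ i, t i < 0 := by
      have h := ht; rw [mem_orthant] at h; simpa only [not_forall, not_le] using h
    refine (Finset.prod_eq_zero (Finset.mem_univ i) ?_).symm
    unfold wIte
    split_ifs
    · rw [prof₂Cut_of_neg hi]; ring
    · rw [profCut_of_neg hi]; ring

/-- `∏ᵢ wIte` is integrable. [cite: Maynard2016DenseClusters, proof of Lemma 8.6] -/
theorem integrable_prod_wIte (hk : 2 ≤ k) (j : Fin n) :
    Integrable fun t : Fin n → ℝ => ∏ i, wIte k j i (t i) := by
  refine Integrable.fintype_prod (f := fun i x => wIte k j i x) fun i => ?_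
  unfold wIte
  split_ifs
  · exact integrable_prof₂Cut_sq hk
  · exact integrable_profCut_sq hk

/-- `∫ ∏ᵢ wIte = (∫ h_k²) γ_k^{n−1}`. [cite: Maynard2016DenseClusters, proof of Lemma 8.6] -/
theorem integral_prod_wIte (j : Fin n) :
    ∫ t : Fin n → ℝ, ∏ i, wIte k j i (t i) = gam₂ k * gam k ^ (n - 1) := by
  rw [integral_fintype_prod_volume_eq_prod (fun i x => wIte k j i x),
    ← Finset.mul_prod_erase univ _ (Finset.mem_univ j)]
  have hj : (∫ x, wIte k j j x) = gam₂ k := by simp only [wIte, if_true, gam₂]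
  have hi : ∀ i ∈ univ.erase j, (∫ x, wIte k j i x) = gam k := fun i hi => by
    simp only [wIte, if_neg (Finset.ne_of_mem_erase hi), gam]
  rw [hj, Finset.prod_congr rfl hi, Finset.prod_const, Finset.card_erase_of_mem (Finset.mem_univ j),
    Finset.card_univ, Fintype.card_fin]

/-- Each squared summand is integrable on the orthant. [cite: Maynard2016DenseClusters, proof of Lemma 8.6] -/
theorem integrableOn_prod_profIte_sq (hk : 2 ≤ k) (j : Fin n) :
    IntegrableOn (fun t : Fin n → ℝ => (∏ i, profIte k j i (t i)) ^ 2) (orthant n) := by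
  rw [← integrable_indicator_iff (measurableSet_orthant n)]
  have : (orthant n).indicator (fun t : Fin n → ℝ => (∏ i, profIte k j i (t i)) ^ 2) =
      fun t => ∏ i, wIte k j i (t i) := funext (indicator_orthant_prod_profIte_sq j)
  rw [this]
  exact integrable_prod_wIte hk j

/-- `∫_{[0,∞)ⁿ} (∏ᵢ profIte)² = (∫ h_k²) γ_k^{n−1}`. [cite: Maynard2016DenseClusters, proof of Lemma 8.6] -/
theorem setIntegral_orthant_prod_profIte_sq (j : Fin n) :
    ∫ t in orthant n, (∏ i, profIte k j i (t i)) ^ 2 = gam₂ k * gam k ^ (n - 1) := by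
  rw [← integral_indicator (measurableSet_orthant n)]
  simp_rw [indicator_orthant_prod_profIte_sq j]
  exact integral_prod_wIte j

/-- Cauchy–Schwarz: `sumH² ≤ n ∑ⱼ (∏ᵢ profIte)²`. [cite: Maynard2016DenseClusters, proof of Lemma 8.6] -/
theorem sumH_sq_le (t : Fin n → ℝ) :
    sumH k n t ^ 2 ≤ n * ∑ j, (∏ i, profIte k j i (t i)) ^ 2 := by
  have h := sq_sum_le_card_mul_sum_sq (s := (univ : Finset (Fin n)))
    (f := fun j => ∏ i, profIte k j i (t i))
  rw [Finset.card_univ, Fintype.card_fin] at h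
  exact h

/-- `sumH²` is integrable on the orthant. [cite: Maynard2016DenseClusters, proof of Lemma 8.6] -/
theorem integrableOn_sumH_sq (hk : 2 ≤ k) :
    IntegrableOn (fun t : Fin n → ℝ => sumH k n t ^ 2) (orthant n) := by
  have hdom : IntegrableOn (fun t : Fin n → ℝ => n * ∑ j, (∏ i, profIte k j i (t i)) ^ 2)
      (orthant n) :=
    (integrable_finsetSum _ fun j _ => integrableOn_prod_profIte_sq hk j).const_mul _
  refine Integrable.mono' hdom ((measurable_sumH k n).pow_const 2).aestronglyMeasurable
    (ae_of_all _ fun t => ?_)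
  rw [Real.norm_eq_abs, abs_of_nonneg (sq_nonneg _)]
  exact sumH_sq_le t

/-- **`∫_{[0,∞)ⁿ} sumH² ≤ n² (∫ h_k²) γ_k^{n−1}`.** [cite: Maynard2016DenseClusters, proof of Lemma 8.6 («k^{-2} I_k(F_2) ≪ I_k(F_1)»)] -/
theorem setIntegral_orthant_sumH_sq_le (hk : 2 ≤ k) :
    ∫ t in orthant n, sumH k n t ^ 2 ≤ n ^ 2 * (gam₂ k * gam k ^ (n - 1)) := by
  calc ∫ t in orthant n, sumH k n t ^ 2
      ≤ ∫ t in orthant n, n * ∑ j, (∏ i, profIte k j i (t i)) ^ 2 :=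
        setIntegral_mono_on (integrableOn_sumH_sq hk)
          ((integrable_finsetSum _ fun j _ => integrableOn_prod_profIte_sq hk j).const_mul _)
          (measurableSet_orthant n) fun t _ => sumH_sq_le t
    _ = n * ∑ j : Fin n, (gam₂ k * gam k ^ (n - 1)) := by
        rw [integral_const_mul, integral_finsetSum _ fun j _ => integrableOn_prod_profIte_sq hk j]
        simp_rw [setIntegral_orthant_prod_profIte_sq]
    _ = _ := by rw [Finset.sum_const, Finset.card_univ, Fintype.card_fin, nsmul_eq_mul]; ring

/-- `F₂²` is integrable on the orthant. [cite: Maynard2016DenseClusters, Lemma 8.6] -/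
theorem integrableOn_F₂_sq (hk : 2 ≤ k) : IntegrableOn (fun t => F₂ k t ^ 2) (orthant k) := by
  have : (fun t => F₂ k t ^ 2) = fun t => sumH k k t ^ 2 := funext fun t => by rw [F₂_eq_sumH]
  rw [this]; exact integrableOn_sumH_sq hk

/-- **`I_k(F₂) ≤ k² (∫ h_k²) γ_k^{k−1}`.** [cite: Maynard2016DenseClusters, proof of Lemma 8.6 («k^{-2} I_k(F_2) ≪ I_k(F_1)»)] -/
theorem orthantI_F₂_le (hk : 2 ≤ k) : orthantI k (F₂ k) ≤ k ^ 2 * (gam₂ k * gam k ^ (k - 1)) := by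
  rw [orthantI]
  simp_rw [F₂_eq_sumH]
  exact setIntegral_orthant_sumH_sq_le hk

/-- **`k² I_k(F₁) ≤ I_k(F₂)`.** [cite: Maynard2016DenseClusters, Lemma 8.6 («I_k(F_1) ≤ I_k(F_2)/k²»)] -/
theorem orthantI_F₁_le_F₂ (hk : 2 ≤ k) : k ^ 2 * orthantI k (F₁ k) ≤ orthantI k (F₂ k) := by
  rw [orthantI, orthantI, ← integral_const_mul]
  refine setIntegral_mono_on ((integrableOn_prod_sq hk k).const_mul _) (integrableOn_F₂_sq hk)
    (measurableSet_orthant k) fun t ht => ?_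
  rw [← mul_pow, F₂_eq_sumH]
  exact pow_le_pow_left₀ (mul_nonneg (Nat.cast_nonneg k) (F₁_nonneg hk ht))
    (mul_prod_le_sumH hk ht) 2

/-- `L_k ≤ ∫₀^∞ h_k` (`g_k ≤ h_k`). [cite: Maynard2016DenseClusters, proof of Lemma 8.6] -/
theorem ell_le_ell₂ (hk : 2 ≤ k) : ell k ≤ ell₂ k := by
  rw [ell, ell₂]
  refine integral_mono (integrable_profCut hk) (integrable_prof₂Cut hk) fun x => ?_
  by_cases hx : 0 ≤ x
  · rw [profCut_of_nonneg hx, prof₂Cut_of_nonneg hx]; exact prof_le_prof₂ hk hx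
  · rw [profCut_of_neg (not_le.1 hx), prof₂Cut_of_neg (not_le.1 hx)]

/-- The inner integral of `J^{(m)}(F₂)` in closed form:
`∫₀^∞ F₂(s; s_m := u) du = (∫ h_k) ∏ⱼ g_k(sⱼ) + L_k · sumH k n s` (`k = n + 1`).
[cite: Maynard2016DenseClusters, proof of Lemma 8.6 («k^{-2} J_k(F_2) ≪ J_k(F_1)»)] -/
theorem inner_F₂_eq (hn : 2 ≤ n + 1) (m : Fin (n + 1)) (s : Fin n → ℝ) :
    ∫ u in Ici (0 : ℝ), F₂ (n + 1) (Fin.insertNth m u s) =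
      ell₂ (n + 1) * ∏ j, prof (n + 1) (s j) + ell (n + 1) * sumH (n + 1) n s := by
  simp_rw [F₂_eq_sumH, sumH_insertNth m]
  have h1 : IntegrableOn (prof₂ (n + 1)) (Ici 0) := by
    have h := integrable_prof₂Cut hn
    rwa [prof₂Cut, integrable_indicator_iff measurableSet_Ici] at h
  have h2 : IntegrableOn (prof (n + 1)) (Ici 0) := by
    have h := integrable_profCut hn
    rwa [profCut, integrable_indicator_iff measurableSet_Ici] at h
  rw [integral_add (h1.mul_const _) (h2.mul_const _), integral_mul_const, integral_mul_const,
    setIntegral_Ici_prof, setIntegral_Ici_prof₂]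

/-- **`J^{(m)}(F₂) ≤ 2 (∫h_k)² γ_k^n + 2 L_k² n² (∫h_k²) γ_k^{n−1}`** (`k = n + 1`).
[cite: Maynard2016DenseClusters, proof of Lemma 8.6 («k^{-2} J_k(F_2) ≪ J_k(F_1)»)] -/
theorem orthantJ_F₂_le (hn : 2 ≤ n + 1) (m : Fin (n + 1)) :
    orthantJ n m (F₂ (n + 1)) ≤
      2 * ell₂ (n + 1) ^ 2 * gam (n + 1) ^ n +
        2 * ell (n + 1) ^ 2 * (n ^ 2 * (gam₂ (n + 1) * gam (n + 1) ^ (n - 1))) := by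
  rw [orthantJ]
  simp_rw [inner_F₂_eq hn m]
  have hP := integrableOn_prod_sq hn n (k := n + 1)
  have hQ := integrableOn_sumH_sq hn (n := n) (k := n + 1)
  have hdom : IntegrableOn (fun s : Fin n → ℝ =>
      2 * ell₂ (n + 1) ^ 2 * (∏ j, prof (n + 1) (s j)) ^ 2 +
        2 * ell (n + 1) ^ 2 * sumH (n + 1) n s ^ 2) (orthant n) :=
    (hP.const_mul _).add (hQ.const_mul _)
  have hmeas : Measurable fun s : Fin n → ℝ =>
      (ell₂ (n + 1) * ∏ j, prof (n + 1) (s j) + ell (n + 1) * sumH (n + 1) n s) ^ 2 :=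
    ((measurable_const.mul (Finset.measurable_prod _ fun i _ =>
      (measurable_prof (n + 1)).comp (measurable_pi_apply i))).add
      (measurable_const.mul (measurable_sumH (n + 1) n))).pow_const 2
  have hpt : ∀ s : Fin n → ℝ,
      (ell₂ (n + 1) * ∏ j, prof (n + 1) (s j) + ell (n + 1) * sumH (n + 1) n s) ^ 2 ≤
        2 * ell₂ (n + 1) ^ 2 * (∏ j, prof (n + 1) (s j)) ^ 2 +
          2 * ell (n + 1) ^ 2 * sumH (n + 1) n s ^ 2 := fun s => by
    nlinarith [sq_nonneg (ell₂ (n + 1) * ∏ j, prof (n + 1) (s j) - ell (n + 1) * sumH (n + 1) n s)]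
  have hint : IntegrableOn (fun s : Fin n → ℝ =>
      (ell₂ (n + 1) * ∏ j, prof (n + 1) (s j) + ell (n + 1) * sumH (n + 1) n s) ^ 2) (orthant n) :=
    Integrable.mono' hdom hmeas.aestronglyMeasurable (ae_of_all _ fun s => by
      rw [Real.norm_eq_abs, abs_of_nonneg (sq_nonneg _)]; exact hpt s)
  calc ∫ s in orthant n,
        (ell₂ (n + 1) * ∏ j, prof (n + 1) (s j) + ell (n + 1) * sumH (n + 1) n s) ^ 2
      ≤ ∫ s in orthant n, (2 * ell₂ (n + 1) ^ 2 * (∏ j, prof (n + 1) (s j)) ^ 2 +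
          2 * ell (n + 1) ^ 2 * sumH (n + 1) n s ^ 2) :=
        setIntegral_mono_on hint hdom (measurableSet_orthant n) fun s _ => hpt s
    _ = 2 * ell₂ (n + 1) ^ 2 * gam (n + 1) ^ n +
          2 * ell (n + 1) ^ 2 * ∫ s in orthant n, sumH (n + 1) n s ^ 2 := by
        rw [integral_add (hP.const_mul _) (hQ.const_mul _), integral_const_mul, integral_const_mul,
          setIntegral_orthant_prod_sq]
    _ ≤ _ := by
        have := setIntegral_orthant_sumH_sq_le (n := n) hn (k := n + 1)
        have h0 : 0 ≤ 2 * ell (n + 1) ^ 2 := by positivity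
        nlinarith

/-- **`k² J^{(m)}(F₁) ≤ J^{(m)}(F₂)`** (`k = n + 1`). [cite: Maynard2016DenseClusters, Lemma 8.6 («J_k(F_1) ≤ J_k(F_2)/k²»)] -/
theorem orthantJ_F₁_le_F₂ (hn : 2 ≤ n + 1) (m : Fin (n + 1)) :
    ((n + 1 : ℕ) : ℝ) ^ 2 * orthantJ n m (F₁ (n + 1)) ≤ orthantJ n m (F₂ (n + 1)) := by
  rw [orthantJ, orthantJ, ← integral_const_mul]
  simp_rw [inner_F₁ m, inner_F₂_eq hn m]
  have hP := integrableOn_prod_sq hn n (k := n + 1)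
  have hQ := integrableOn_sumH_sq hn (n := n) (k := n + 1)
  have hmeas : Measurable fun s : Fin n → ℝ =>
      (ell₂ (n + 1) * ∏ j, prof (n + 1) (s j) + ell (n + 1) * sumH (n + 1) n s) ^ 2 :=
    ((measurable_const.mul (Finset.measurable_prod _ fun i _ =>
      (measurable_prof (n + 1)).comp (measurable_pi_apply i))).add
      (measurable_const.mul (measurable_sumH (n + 1) n))).pow_const 2
  have hdom : IntegrableOn (fun s : Fin n → ℝ =>
      2 * ell₂ (n + 1) ^ 2 * (∏ j, prof (n + 1) (s j)) ^ 2 +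
        2 * ell (n + 1) ^ 2 * sumH (n + 1) n s ^ 2) (orthant n) :=
    (hP.const_mul _).add (hQ.const_mul _)
  have hint : IntegrableOn (fun s : Fin n → ℝ =>
      (ell₂ (n + 1) * ∏ j, prof (n + 1) (s j) + ell (n + 1) * sumH (n + 1) n s) ^ 2) (orthant n) :=
    Integrable.mono' hdom hmeas.aestronglyMeasurable (ae_of_all _ fun s => by
        rw [Real.norm_eq_abs, abs_of_nonneg (sq_nonneg _)]
        nlinarith [sq_nonneg (ell₂ (n + 1) * ∏ j, prof (n + 1) (s j) -
          ell (n + 1) * sumH (n + 1) n s)])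
  have hlhs : IntegrableOn (fun s : Fin n → ℝ =>
      ((n + 1 : ℕ) : ℝ) ^ 2 * (ell (n + 1) * ∏ j, prof (n + 1) (s j)) ^ 2) (orthant n) := by
    simp_rw [mul_pow]; exact (hP.const_mul _).const_mul _
  refine setIntegral_mono_on hlhs hint (measurableSet_orthant n) fun s hs => ?_
  have hPs : 0 ≤ ∏ j, prof (n + 1) (s j) :=
    Finset.prod_nonneg fun j _ => prof_nonneg hn (mem_orthant.1 hs j)
  have hQs := mul_prod_le_sumH (n := n) hn hs (k := n + 1)
  have hell := ell_pos hn
  have hell₂ := ell_le_ell₂ hn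
  rw [← mul_pow]
  refine pow_le_pow_left₀ (by positivity) ?_ 2
  push_cast
  have h1 : ell (n + 1) * ∏ j, prof (n + 1) (s j) ≤ ell₂ (n + 1) * ∏ j, prof (n + 1) (s j) :=
    mul_le_mul_of_nonneg_right hell₂ hPs
  have h2 : ell (n + 1) * (n * ∏ j, prof (n + 1) (s j)) ≤ ell (n + 1) * sumH (n + 1) n s :=
    mul_le_mul_of_nonneg_left hQs hell.le
  nlinarith

end FTwo

/-! ## §9 Numerics for `k ≥ 2^18` and the explicit form of Lemma 8.6

Throughout `k ≥ 2^18 = 262144`, so that `log k ≥ 12`, `√k ≥ 512`, `U_k ≤ 1/512`, `T_kU_k = √k log k ≥ 6144`.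
The printed `O(·)`'s become: `log(1 + T_kU_k) ≤ 0.81 log k`, `k μ_k/γ_k ≤ 0.82` (the centre of mass
of `g_k²` summed over the `k` coordinates lies at `≤ 0.82 < 9/10`), and both tails are at most half of
the corresponding main terms. -/

section Numerics

variable {k : ℕ}

/-- `log 2^18 ≥ 12`, so `log k ≥ 12` for `k ≥ 2^18`. [cite: Maynard2016DenseClusters, Lemma 8.6 («k sufficiently large»)] -/
theorem twelve_le_log (hk : 262144 ≤ k) : 12 ≤ Real.log k := by
  have h2 : Real.log 262144 = 18 * Real.log 2 := by
    rw [show (262144 : ℝ) = 2 ^ 18 by norm_num, Real.log_pow]; norm_num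
  have hk' : (262144 : ℝ) ≤ k := by exact_mod_cast hk
  have hmono := Real.log_le_log (by norm_num) hk'
  linarith [Real.log_two_gt_d9]

/-- `√k ≥ 512` for `k ≥ 2^18`. [cite: Maynard2016DenseClusters, Lemma 8.6 («k sufficiently large»)] -/
theorem sqrt_ge (hk : 262144 ≤ k) : 512 ≤ Real.sqrt k := by
  have hk' : (262144 : ℝ) ≤ k := by exact_mod_cast hk
  exact Real.le_sqrt_of_sq_le (by nlinarith)

/-- `U_k ≤ 1/512` for `k ≥ 2^18`. [cite: Maynard2016DenseClusters, (7.4)] -/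
theorem U_le (hk : 262144 ≤ k) : U k ≤ 1 / 512 := by
  rw [U_eq_inv_sqrt, ← one_div]
  exact div_le_div_of_nonneg_left zero_le_one (by norm_num) (sqrt_ge hk)

/-- `T_kU_k ≥ 6144` for `k ≥ 2^18`. [cite: Maynard2016DenseClusters, (7.4)] -/
theorem TU_ge (hk : 262144 ≤ k) : 6144 ≤ T k * U k := by
  have hk1 : 1 ≤ k := le_trans (by norm_num) hk
  rw [T_mul_U hk1]
  nlinarith [sqrt_ge hk, twelve_le_log hk, Real.sqrt_nonneg (k : ℝ)]

/-- `log y ≤ y/4` for `y ≥ 12`. [cite: Maynard2016DenseClusters, Lemma 8.6 («k sufficiently large»)] -/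
theorem log_le_quarter {y : ℝ} (hy : 12 ≤ y) : Real.log y ≤ y / 4 := by
  have h3 : Real.log 12 ≤ 3 := by
    have he : (12 : ℝ) ≤ Real.exp 3 := by
      have h27 : (27 / 10 : ℝ) ≤ Real.exp 1 := by linarith [Real.exp_one_gt_d9]
      have hcube : (27 / 10 : ℝ) ^ 3 ≤ Real.exp 1 ^ 3 := pow_le_pow_left₀ (by norm_num) h27 3
      have : Real.exp 3 = Real.exp 1 ^ 3 := by rw [← Real.exp_nat_mul]; norm_num
      rw [this]; norm_num at hcube; linarith
    calc Real.log 12 ≤ Real.log (Real.exp 3) := Real.log_le_log (by norm_num) he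
      _ = 3 := Real.log_exp 3
  have hsplit : Real.log y = Real.log 12 + Real.log (y / 12) := by
    rw [← Real.log_mul (by norm_num) (by positivity)]; congr 1; ring
  have hle : Real.log (y / 12) ≤ y / 12 - 1 := Real.log_le_sub_one_of_pos (by positivity)
  linarith

/-- `log log k ≤ (log k)/4` for `k ≥ 2^18`. [cite: Maynard2016DenseClusters, Lemma 8.6 («k sufficiently large»)] -/
theorem log_log_le (hk : 262144 ≤ k) : Real.log (Real.log k) ≤ Real.log k / 4 :=
  log_le_quarter (twelve_le_log hk)

/-- `log(1 + T_kU_k) ≤ 0.81 log k` (`1 + √k log k ≤ 2√k log k`, `log 2 ≤ 0.06 log k`,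
`log log k ≤ (log k)/4`). [cite: Maynard2016DenseClusters, proof of Lemma 8.6 (the O(·) of the first display line)] -/
theorem log_one_add_TU_le (hk : 262144 ≤ k) :
    Real.log (1 + T k * U k) ≤ 81 / 100 * Real.log k := by
  have hk1 : 1 ≤ k := le_trans (by norm_num) hk
  have hL := twelve_le_log hk
  have hS := TU_ge hk
  have hsq := sqrt_ge hk
  rw [T_mul_U hk1] at hS ⊢
  have hpos : 0 < Real.sqrt k * Real.log k := by linarith
  have h1 : Real.log (1 + Real.sqrt k * Real.log k) ≤ Real.log (2 * (Real.sqrt k * Real.log k)) :=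
    Real.log_le_log (by linarith) (by linarith)
  have h2 : Real.log (2 * (Real.sqrt k * Real.log k)) =
      Real.log 2 + Real.log k / 2 + Real.log (Real.log k) := by
    rw [Real.log_mul (by norm_num) hpos.ne', Real.log_mul (by linarith) (by linarith),
      Real.log_sqrt (Nat.cast_nonneg k)]
    ring
  linarith [Real.log_two_lt_d9, log_log_le hk]

/-- `log(1 + (9/10)T_kU_k) ≥ (log k)/2` (`1 + (9/10)√k log k ≥ √k`). [cite: Maynard2016DenseClusters, proof of Lemma 8.6] -/
theorem half_log_le (hk : 262144 ≤ k) : Real.log k / 2 ≤ Real.log (1 + T k * (9 / 10 * U k)) := by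
  have hk1 : 1 ≤ k := le_trans (by norm_num) hk
  have hL := twelve_le_log hk
  have hsq := sqrt_ge hk
  have hTU : T k * (9 / 10 * U k) = 9 / 10 * (Real.sqrt k * Real.log k) := by
    rw [← T_mul_U hk1]; ring
  rw [hTU, ← Real.log_sqrt (Nat.cast_nonneg k)]
  exact Real.log_le_log (by linarith) (by nlinarith)

/-- `1/(1 + (9/10)T_kU_k) ≤ 1/5000`. [cite: Maynard2016DenseClusters, proof of Lemma 8.6] -/
theorem eps_le (hk : 262144 ≤ k) : (1 + T k * (9 / 10 * U k))⁻¹ ≤ 1 / 5000 := by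
  have hS := TU_ge hk
  rw [← one_div]
  exact div_le_div_of_nonneg_left zero_le_one (by norm_num) (by nlinarith)

/-- `γ_k ≥ (4999/5000)/T_k`. [cite: Maynard2016DenseClusters, proof of Lemma 8.6, display (second line)] -/
theorem gam_ge' (hk : 262144 ≤ k) : 4999 / 5000 / T k ≤ gam k := by
  have hk2 : 2 ≤ k := le_trans (by norm_num) hk
  refine le_trans (div_le_div_of_nonneg_right ?_ (T_pos hk2).le) (gam_ge hk2)
  linarith [eps_le hk]

/-- `γ_k T_k ∈ [4999/5000, 1]`, multiplicative form: `4999/5000 ≤ γ_k T_k`. [cite: Maynard2016DenseClusters, proof of Lemma 8.6] -/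
theorem gam_mul_T_ge (hk : 262144 ≤ k) : 4999 / 5000 ≤ gam k * T k := by
  have hk2 : 2 ≤ k := le_trans (by norm_num) hk
  have := gam_ge' hk
  rwa [div_le_iff₀ (T_pos hk2)] at this

/-- `γ_k T_k ≤ 1`. [cite: Maynard2016DenseClusters, proof of Lemma 8.6] -/
theorem gam_mul_T_le (hk : 2 ≤ k) : gam k * T k ≤ 1 := by
  have h := gam_le_inv hk
  rw [← one_div] at h
  exact (le_div_iff₀ (T_pos hk)).1 h

/-- `L_k T_k ≥ (log k)/2`. [cite: Maynard2016DenseClusters, proof of Lemma 8.6, display (first line)] -/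
theorem ell_mul_T_ge (hk : 262144 ≤ k) : Real.log k / 2 ≤ ell k * T k := by
  have hk2 : 2 ≤ k := le_trans (by norm_num) hk
  have h := (div_le_div_of_nonneg_right (half_log_le hk) (T_pos hk2).le).trans (ell_ge hk2)
  rwa [div_le_iff₀ (T_pos hk2)] at h

/-- `L_k T_k ≤ 0.81 log k`. [cite: Maynard2016DenseClusters, proof of Lemma 8.6, display (first line)] -/
theorem ell_mul_T_le (hk : 262144 ≤ k) : ell k * T k ≤ 81 / 100 * Real.log k := by
  have hk2 : 2 ≤ k := le_trans (by norm_num) hk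
  have h := (ell_le hk2).trans (div_le_div_of_nonneg_right (log_one_add_TU_le hk) (T_pos hk2).le)
  rwa [le_div_iff₀ (T_pos hk2)] at h

/-- `(∫ h_k) T_k ≤ (5/2) log k` (`1 + 2T_k ≤ T_k²`, `log T_k = log k + log log k ≤ (5/4) log k`).
[cite: Maynard2016DenseClusters, proof of Lemma 8.6] -/
theorem ell₂_mul_T_le (hk : 262144 ≤ k) : ell₂ k * T k ≤ 5 / 2 * Real.log k := by
  have hk2 : 2 ≤ k := le_trans (by norm_num) hk
  have hL := twelve_le_log hk
  have hkr : (262144 : ℝ) ≤ k := by exact_mod_cast hk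
  have hT : T k = k * Real.log k := rfl
  have hTge : 3 ≤ T k := by rw [hT]; nlinarith
  have hlogT : Real.log (T k) = Real.log k + Real.log (Real.log k) := by
    rw [hT, Real.log_mul (by positivity) (by linarith)]
  have h1 : Real.log (1 + T k * 2) ≤ 2 * Real.log (T k) := by
    have : 2 * Real.log (T k) = Real.log (T k ^ 2) := by rw [Real.log_pow]; norm_num
    rw [this]
    exact Real.log_le_log (by linarith) (by nlinarith)
  have h := (ell₂_le hk2).trans (div_le_div_of_nonneg_right h1 (T_pos hk2).le)
  rw [le_div_iff₀ (T_pos hk2)] at h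
  linarith [log_log_le hk]

/-- `μ_k T_k² ≤ 0.81 log k`. [cite: MaynardAnnals2015, §8 (8.19)] -/
theorem mom_mul_T_sq_le (hk : 262144 ≤ k) : mom k * T k ^ 2 ≤ 81 / 100 * Real.log k := by
  have hk2 : 2 ≤ k := le_trans (by norm_num) hk
  have h := (mom_le' hk2).trans (div_le_div_of_nonneg_right (log_one_add_TU_le hk) (by positivity))
  rwa [le_div_iff₀ (by have := T_pos hk2; positivity)] at h

/-- **The centre of mass:** `k μ_k/γ_k ≤ 0.82` (`< 9/10`, which is what makes the cut-off `ψ(∑ tᵢ)`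
invisible in the main terms). [cite: Maynard2016DenseClusters, proof of Lemma 8.6 («concentration of measure argument»)] -/
theorem k_mul_nu_le (hk : 262144 ≤ k) : k * (mom k / gam k) ≤ 82 / 100 := by
  have hk2 : 2 ≤ k := le_trans (by norm_num) hk
  have hγ := gam_pos hk2
  have hT := T_pos hk2
  have hγT := gam_mul_T_ge hk
  have hμ := mom_mul_T_sq_le hk
  have hμ0 := mom_nonneg k
  have hL := twelve_le_log hk
  have hTdef : T k = k * Real.log k := rfl
  -- `k μ T² ≤ 0.81 k log k = 0.81 T`, so `k μ T ≤ 0.81 ≤ 0.82 γ T`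
  rw [mul_div_assoc', div_le_iff₀ hγ]
  have h1 : (k : ℝ) * mom k * T k ^ 2 ≤ 81 / 100 * T k := by
    calc (k : ℝ) * mom k * T k ^ 2 = k * (mom k * T k ^ 2) := by ring
      _ ≤ k * (81 / 100 * Real.log k) := mul_le_mul_of_nonneg_left hμ (Nat.cast_nonneg k)
      _ = 81 / 100 * T k := by rw [hTdef]; ring
  have h2 : (k : ℝ) * mom k * T k ≤ 81 / 100 := by
    by_contra h
    rw [not_le] at h
    nlinarith
  nlinarith

/-- The `I`-tail is at most half the main term: `k γ^{k−1} U_k μ_k/(9/10 − kμ_k/γ_k)² ≤ γ_k^k/2`.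
[cite: Maynard2016DenseClusters, proof of Lemma 8.6 (8.14)] -/
theorem tailI_le (hk : 262144 ≤ k) :
    k * gam k ^ (k - 1) * (U k * mom k) / (9 / 10 - k * (mom k / gam k)) ^ 2 ≤ gam k ^ k / 2 := by
  have hk2 : 2 ≤ k := le_trans (by norm_num) hk
  have hk0 : k ≠ 0 := by omega
  have hγ := gam_pos hk2
  have hν := k_mul_nu_le hk
  have hU := U_le hk
  have hU0 := (U_pos (le_trans (by norm_num) hk : 1 ≤ k)).le
  have hμ0 := mom_nonneg k
  have hm : (8 : ℝ) / 100 ≤ 9 / 10 - k * (mom k / gam k) := by linarith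
  have hpow : gam k ^ k = gam k ^ (k - 1) * gam k := (pow_sub_one_mul hk0 _).symm
  have hkm : (k : ℝ) * mom k ≤ 82 / 100 * gam k := by
    have := hν; rwa [mul_div_assoc', div_le_iff₀ hγ] at this
  rw [div_le_iff₀ (by positivity), hpow]
  have hg1 : 0 ≤ gam k ^ (k - 1) := by positivity
  -- `k γ^{k−1} U μ ≤ γ^{k−1} · 0.82 γ · (1/512)` and `(0.08)² · 512 / 0.82 ≥ 2`
  have h1 : (k : ℝ) * gam k ^ (k - 1) * (U k * mom k) ≤
      gam k ^ (k - 1) * (82 / 100 * gam k) * (1 / 512) := by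
    calc (k : ℝ) * gam k ^ (k - 1) * (U k * mom k) = gam k ^ (k - 1) * (k * mom k) * U k := by ring
      _ ≤ gam k ^ (k - 1) * (82 / 100 * gam k) * (1 / 512) := by gcongr
  have h2 : ((8 : ℝ) / 100) ^ 2 ≤ (9 / 10 - k * (mom k / gam k)) ^ 2 := by gcongr
  calc (k : ℝ) * gam k ^ (k - 1) * (U k * mom k)
      ≤ gam k ^ (k - 1) * (82 / 100 * gam k) * (1 / 512) := h1
    _ = gam k ^ (k - 1) * gam k * (82 / 100 / 512) := by ring
    _ ≤ gam k ^ (k - 1) * gam k * (((8 : ℝ) / 100) ^ 2 / 2) :=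
        mul_le_mul_of_nonneg_left (by norm_num) (mul_nonneg hg1 hγ.le)
    _ = gam k ^ (k - 1) * gam k / 2 * ((8 : ℝ) / 100) ^ 2 := by ring
    _ ≤ gam k ^ (k - 1) * gam k / 2 * (9 / 10 - k * (mom k / gam k)) ^ 2 :=
        mul_le_mul_of_nonneg_left h2 (by positivity)

/-- The `J`-tail is at most half the main term (`k = n + 1` variables, threshold `9/10 − U_k`):
`n γ^{n−1} U_k μ_k/(9/10 − U_k − nμ_k/γ_k)² ≤ γ_k^n/2`. [cite: Maynard2016DenseClusters, proof of Lemma 8.6 (8.13)] -/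
theorem tailJ_le {n : ℕ} (hk : 262144 ≤ n + 1) :
    n * gam (n + 1) ^ (n - 1) * (U (n + 1) * mom (n + 1)) /
        (9 / 10 - U (n + 1) - n * (mom (n + 1) / gam (n + 1))) ^ 2 ≤ gam (n + 1) ^ n / 2 := by
  have hk2 : 2 ≤ n + 1 := le_trans (by norm_num) hk
  have hn0 : n ≠ 0 := by omega
  have hγ := gam_pos hk2
  have hν := k_mul_nu_le hk
  have hU := U_le hk
  have hU0 := (U_pos (le_trans (by norm_num) hk : 1 ≤ n + 1)).le
  have hμ0 := mom_nonneg (n + 1)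
  have hνn : (n : ℝ) * (mom (n + 1) / gam (n + 1)) ≤ 82 / 100 := by
    refine le_trans ?_ hν
    push_cast
    exact mul_le_mul_of_nonneg_right (by linarith) (div_nonneg hμ0 hγ.le)
  have hm : (7 : ℝ) / 100 ≤ 9 / 10 - U (n + 1) - n * (mom (n + 1) / gam (n + 1)) := by linarith
  have hpow : gam (n + 1) ^ n = gam (n + 1) ^ (n - 1) * gam (n + 1) := (pow_sub_one_mul hn0 _).symm
  have hkm : (n : ℝ) * mom (n + 1) ≤ 82 / 100 * gam (n + 1) := by
    have := hνn; rwa [mul_div_assoc', div_le_iff₀ hγ] at this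
  rw [div_le_iff₀ (by positivity), hpow]
  have hg1 : 0 ≤ gam (n + 1) ^ (n - 1) := by positivity
  have h1 : (n : ℝ) * gam (n + 1) ^ (n - 1) * (U (n + 1) * mom (n + 1)) ≤
      gam (n + 1) ^ (n - 1) * (82 / 100 * gam (n + 1)) * (1 / 512) := by
    calc (n : ℝ) * gam (n + 1) ^ (n - 1) * (U (n + 1) * mom (n + 1))
        = gam (n + 1) ^ (n - 1) * (n * mom (n + 1)) * U (n + 1) := by ring
      _ ≤ gam (n + 1) ^ (n - 1) * (82 / 100 * gam (n + 1)) * (1 / 512) := by gcongr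
  have h2 : ((7 : ℝ) / 100) ^ 2 ≤ (9 / 10 - U (n + 1) - n * (mom (n + 1) / gam (n + 1))) ^ 2 := by
    gcongr
  calc (n : ℝ) * gam (n + 1) ^ (n - 1) * (U (n + 1) * mom (n + 1))
      ≤ gam (n + 1) ^ (n - 1) * (82 / 100 * gam (n + 1)) * (1 / 512) := h1
    _ = gam (n + 1) ^ (n - 1) * gam (n + 1) * (82 / 100 / 512) := by ring
    _ ≤ gam (n + 1) ^ (n - 1) * gam (n + 1) * (((7 : ℝ) / 100) ^ 2 / 2) :=
        mul_le_mul_of_nonneg_left (by norm_num) (mul_nonneg hg1 hγ.le)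
    _ = gam (n + 1) ^ (n - 1) * gam (n + 1) / 2 * ((7 : ℝ) / 100) ^ 2 := by ring
    _ ≤ gam (n + 1) ^ (n - 1) * gam (n + 1) / 2 *
          (9 / 10 - U (n + 1) - n * (mom (n + 1) / gam (n + 1))) ^ 2 :=
        mul_le_mul_of_nonneg_left h2 (by positivity)

/-- `k μ_k/γ_k < 9/10` (hypothesis of the concentration bound for `I`). [cite: Maynard2016DenseClusters, proof of Lemma 8.6] -/
theorem hD_I (hk : 262144 ≤ k) : k * (mom k / gam k) < 9 / 10 := by linarith [k_mul_nu_le hk]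

/-- `n μ_k/γ_k < 9/10 − U_k` (hypothesis of the concentration bound for `J`, `k = n + 1`).
[cite: Maynard2016DenseClusters, proof of Lemma 8.6] -/
theorem hD_J {n : ℕ} (hk : 262144 ≤ n + 1) :
    n * (mom (n + 1) / gam (n + 1)) < 9 / 10 - U (n + 1) := by
  have hk2 : 2 ≤ n + 1 := le_trans (by norm_num) hk
  have hν := k_mul_nu_le hk
  have hU := U_le hk
  have hνn : (n : ℝ) * (mom (n + 1) / gam (n + 1)) ≤ 82 / 100 := by
    refine le_trans ?_ hν
    push_cast
    exact mul_le_mul_of_nonneg_right (by linarith) (div_nonneg (mom_nonneg _) (gam_pos hk2).le)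
  linarith

end Numerics

/-! ## §10 Lemma 8.6, explicit (all `k ≥ 2^18`) -/

section Lemma86

variable {k n : ℕ}

/-- **`I_k(F) ≥ γ_k^k/2 = I_k(F₁)/2`.** [cite: Maynard2016DenseClusters, Lemma 8.6 with proof (8.14) («I_k(F) ≫ I_k(F_1)»)] -/
theorem orthantI_F_ge_half (hk : 262144 ≤ k) : gam k ^ k / 2 ≤ orthantI k (F k) := by
  have hk2 : 2 ≤ k := le_trans (by norm_num) hk
  have h := orthantI_F_ge hk2 (hD_I hk)
  have ht := tailI_le hk
  linarith

/-- **`I_k(F) > 0`.** [cite: Maynard2016DenseClusters, Lemma 8.6] -/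
theorem orthantI_F_pos (hk : 262144 ≤ k) : 0 < orthantI k (F k) := by
  have hk2 : 2 ≤ k := le_trans (by norm_num) hk
  have := orthantI_F_ge_half hk
  have := pow_pos (gam_pos hk2) k
  linarith

/-- ★ **`I_k(F) ≤ I_k(F₁) ≤ 2 I_k(F)`** (printed: `I_k(F) ≤ I_k(F₁) ≪ I_k(F)`).
[cite: Maynard2016DenseClusters, Lemma 8.6 («I_k(F) ≤ I_k(F_1) … ≪ I_k(F)»)] -/
theorem lemma86_I_F₁_le_two_mul (hk : 262144 ≤ k) : orthantI k (F₁ k) ≤ 2 * orthantI k (F k) := by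
  rw [orthantI_F₁]; linarith [orthantI_F_ge_half hk]

/-- ★ **`I_k(F₁) ≤ (k log k)^{−k}`** (hence the same for `I_k(F)`). [cite: Maynard2016DenseClusters, Lemma 8.6 («I_k(F) ≤ (k log k)^{-k}»)] -/
theorem lemma86_I_F₁_le (hk : 2 ≤ k) : orthantI k (F₁ k) ≤ ((k * Real.log k) ^ k)⁻¹ := by
  rw [orthantI_F₁, ← inv_pow]
  exact pow_le_pow_left₀ (gam_pos hk).le (gam_le_inv hk) k

/-- ★ **`I_k(F) ≤ (k log k)^{−k}`.** [cite: Maynard2016DenseClusters, Lemma 8.6 («I_k(F) ≤ (k log k)^{-k}»)] -/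
theorem lemma86_I_F_le (hk : 2 ≤ k) : orthantI k (F k) ≤ ((k * Real.log k) ^ k)⁻¹ :=
  (orthantI_F_le hk).trans (lemma86_I_F₁_le hk)

/-- `γ_k ≥ 1/(2 T_k)`. [cite: Maynard2016DenseClusters, proof of Lemma 8.6, display (second line)] -/
theorem inv_two_T_le_gam (hk : 262144 ≤ k) : (2 * k * Real.log k)⁻¹ ≤ gam k := by
  have hk2 : 2 ≤ k := le_trans (by norm_num) hk
  have hT := T_pos hk2
  have hTdef : T k = k * Real.log k := rfl
  refine le_trans ?_ (gam_ge' hk)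
  rw [le_div_iff₀ hT, hTdef, show (2 : ℝ) * k * Real.log k = 2 * (k * Real.log k) by ring, mul_inv,
    mul_assoc, inv_mul_cancel₀ (by rw [← hTdef]; exact hT.ne')]
  norm_num

/-- ★ **`I_k(F₁) ≥ (2k log k)^{−k}`.** [cite: Maynard2016DenseClusters, Lemma 8.6 («(2k log k)^{-k} ≪ I_k(F)»)] -/
theorem lemma86_I_F₁_ge (hk : 262144 ≤ k) : ((2 * k * Real.log k) ^ k)⁻¹ ≤ orthantI k (F₁ k) := by
  rw [orthantI_F₁, ← inv_pow]
  have hk2 : 2 ≤ k := le_trans (by norm_num) hk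
  have h0 : 0 ≤ (2 * (k : ℝ) * Real.log k)⁻¹ := by
    have := T_pos hk2; rw [T] at this; positivity
  exact pow_le_pow_left₀ h0 (inv_two_T_le_gam hk) k

/-- ★ **`I_k(F) ≥ (2k log k)^{−k}/2`.** [cite: Maynard2016DenseClusters, Lemma 8.6 («(2k log k)^{-k} ≪ I_k(F)»)] -/
theorem lemma86_I_F_ge (hk : 262144 ≤ k) : ((2 * k * Real.log k) ^ k)⁻¹ / 2 ≤ orthantI k (F k) := by
  have h1 := lemma86_I_F₁_ge hk
  rw [orthantI_F₁] at h1
  linarith [orthantI_F_ge_half hk]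

/-- `(∫ h_k²) γ_k^{k−1} ≤ (5000/4999) γ_k^k` (`∫ h_k² ≤ 1/T_k ≤ (5000/4999) γ_k`).
[cite: Maynard2016DenseClusters, proof of Lemma 8.6 («from these bounds it follows immediately»)] -/
theorem gam₂_mul_pow_le (hk : 262144 ≤ k) {n : ℕ} (hn : n ≠ 0) :
    gam₂ k * gam k ^ (n - 1) ≤ 5000 / 4999 * gam k ^ n := by
  have hk2 : 2 ≤ k := le_trans (by norm_num) hk
  have hγ := gam_pos hk2
  have hT := T_pos hk2
  have hγT := gam_mul_T_ge hk
  have h2 : gam₂ k ≤ 5000 / 4999 * gam k := by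
    refine (gam₂_le_inv hk2).trans ?_
    rw [inv_le_iff_one_le_mul₀ hT]
    nlinarith
  calc gam₂ k * gam k ^ (n - 1) ≤ 5000 / 4999 * gam k * gam k ^ (n - 1) :=
        mul_le_mul_of_nonneg_right h2 (by positivity)
    _ = 5000 / 4999 * gam k ^ n := by rw [mul_assoc, mul_comm (gam k), pow_sub_one_mul hn]

/-- ★ **`k² I_k(F₁) ≤ I_k(F₂) ≤ 2k² I_k(F₁)`** (upper half; the lower half is `orthantI_F₁_le_F₂`).
[cite: Maynard2016DenseClusters, Lemma 8.6 («I_k(F_1) ≤ I_k(F_2)/k² ≪ I_k(F)»)] -/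
theorem lemma86_I_F₂_le (hk : 262144 ≤ k) : orthantI k (F₂ k) ≤ 2 * k ^ 2 * orthantI k (F₁ k) := by
  have hk2 : 2 ≤ k := le_trans (by norm_num) hk
  have h1 := orthantI_F₂_le hk2
  have h2 := gam₂_mul_pow_le hk (n := k) (by omega)
  have hγk : 0 ≤ gam k ^ k := pow_nonneg (gam_pos hk2).le k
  rw [orthantI_F₁]
  have hk0 : (0 : ℝ) ≤ k ^ 2 := by positivity
  nlinarith [mul_le_mul_of_nonneg_left h2 hk0]

/-- ★ **`I_k(F₂) ≤ 4k² I_k(F)`.** [cite: Maynard2016DenseClusters, Lemma 8.6 («I_k(F_2)/k² ≪ I_k(F)»)] -/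
theorem lemma86_I_F₂_le' (hk : 262144 ≤ k) : orthantI k (F₂ k) ≤ 4 * k ^ 2 * orthantI k (F k) := by
  have h1 := lemma86_I_F₂_le hk
  have h2 := lemma86_I_F₁_le_two_mul hk
  have hk0 : (0 : ℝ) ≤ 2 * k ^ 2 := by positivity
  nlinarith [mul_le_mul_of_nonneg_left h2 hk0]

/-- **`J^{(m)}(F) ≥ J^{(m)}(F₁)/2`** (`k = n + 1 ≥ 2^18`). [cite: Maynard2016DenseClusters, Lemma 8.6 with proof (8.13) («J_k(F) ≫ J_k(F_1)»)] -/
theorem orthantJ_F_ge_half (hk : 262144 ≤ n + 1) (m : Fin (n + 1)) :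
    orthantJ n m (F₁ (n + 1)) / 2 ≤ orthantJ n m (F (n + 1)) := by
  have hk2 : 2 ≤ n + 1 := le_trans (by norm_num) hk
  rw [orthantJ_F₁]
  have h := orthantJ_F_ge hk2 m (hD_J hk)
  have ht := tailJ_le hk
  clear hk -- (a `262144 ≤ n + 1` hypothesis in ℕ makes `nlinarith` exceed the recursion limit)
  nlinarith [sq_nonneg (ell (n + 1))]

/-- ★ **`J_k(F) ≤ J_k(F₁) ≤ 2 J_k(F)`** (printed: `J_k(F) ≤ J_k(F₁) ≪ J_k(F)`; every coordinate `m`).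
[cite: Maynard2016DenseClusters, Lemma 8.6 («J_k(F) ≤ J_k(F_1) … ≪ J_k(F)»)] -/
theorem lemma86_J_F₁_le_two_mul (hk : 262144 ≤ n + 1) (m : Fin (n + 1)) :
    orthantJ n m (F₁ (n + 1)) ≤ 2 * orthantJ n m (F (n + 1)) := by
  linarith [orthantJ_F_ge_half hk m]

/-- **`J^{(m)}(F₁) > 0`.** [cite: Maynard2016DenseClusters, Lemma 8.6] -/
theorem orthantJ_F₁_pos (hk : 2 ≤ n + 1) (m : Fin (n + 1)) : 0 < orthantJ n m (F₁ (n + 1)) := by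
  rw [orthantJ_F₁]
  exact mul_pos (pow_pos (ell_pos hk) 2) (pow_pos (gam_pos hk) n)

/-- ★ **`k² J_k(F₁) ≤ J_k(F₂) ≤ 3k² J_k(F₁)`** (upper half; lower half `orthantJ_F₁_le_F₂`; `k = n + 1`).
[cite: Maynard2016DenseClusters, Lemma 8.6 («J_k(F_1) ≤ J_k(F_2)/k² ≪ J_k(F)»)] -/
theorem lemma86_J_F₂_le (hk : 262144 ≤ n + 1) (m : Fin (n + 1)) :
    orthantJ n m (F₂ (n + 1)) ≤ 3 * ((n + 1 : ℕ) : ℝ) ^ 2 * orthantJ n m (F₁ (n + 1)) := by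
  have hk2 : 2 ≤ n + 1 := le_trans (by norm_num) hk
  have hn0 : n ≠ 0 := by omega
  have hn6 : (6 : ℝ) ≤ n := by exact_mod_cast (show 6 ≤ n by omega)
  have h1 := orthantJ_F₂_le hk2 m
  have hγ := gam_pos hk2
  have hγn : 0 < gam (n + 1) ^ n := pow_pos hγ n
  have hell := ell_pos hk2
  have hT := T_pos hk2
  have ha := ell₂_mul_T_le hk
  have hb := ell_mul_T_ge hk
  -- `gam₂ γ^{n−1} ≤ (5000/4999) γ^n`
  have h2 := gam₂_mul_pow_le hk hn0 (n := n)
  have h20 := ell₂_nonneg hk2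
  clear hk
  -- `ell₂ ≤ 5 ell`
  have h5 : ell₂ (n + 1) ≤ 5 * ell (n + 1) := by nlinarith
  have h5sq : ell₂ (n + 1) ^ 2 ≤ 25 * ell (n + 1) ^ 2 := by nlinarith
  rw [orthantJ_F₁]
  have hA : 2 * ell₂ (n + 1) ^ 2 * gam (n + 1) ^ n ≤ 50 * (ell (n + 1) ^ 2 * gam (n + 1) ^ n) := by
    nlinarith [mul_le_mul_of_nonneg_right h5sq hγn.le]
  have hB : 2 * ell (n + 1) ^ 2 * (n ^ 2 * (gam₂ (n + 1) * gam (n + 1) ^ (n - 1))) ≤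
      2 * (5000 / 4999) * n ^ 2 * (ell (n + 1) ^ 2 * gam (n + 1) ^ n) := by
    have h0 : (0 : ℝ) ≤ 2 * ell (n + 1) ^ 2 * n ^ 2 := by positivity
    nlinarith [mul_le_mul_of_nonneg_left h2 h0]
  have hC : (50 : ℝ) + 2 * (5000 / 4999) * n ^ 2 ≤ 3 * ((n + 1 : ℕ) : ℝ) ^ 2 := by
    push_cast; nlinarith
  have hJ0 : 0 ≤ ell (n + 1) ^ 2 * gam (n + 1) ^ n := by positivity
  nlinarith [mul_le_mul_of_nonneg_right hC hJ0]

/-- ★ **`J_k(F₂) ≤ 6k² J_k(F)`** (`k = n + 1`). [cite: Maynard2016DenseClusters, Lemma 8.6 («J_k(F_2)/k² ≪ J_k(F)»)] -/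
theorem lemma86_J_F₂_le' (hk : 262144 ≤ n + 1) (m : Fin (n + 1)) :
    orthantJ n m (F₂ (n + 1)) ≤ 6 * ((n + 1 : ℕ) : ℝ) ^ 2 * orthantJ n m (F (n + 1)) := by
  have h1 := lemma86_J_F₂_le hk m
  have h2 := lemma86_J_F₁_le_two_mul hk m
  have h0 : (0 : ℝ) ≤ 3 * ((n + 1 : ℕ) : ℝ) ^ 2 := by positivity
  clear hk
  nlinarith [mul_le_mul_of_nonneg_left h2 h0]

/-- ★ **`J_k(F₁) ≥ (log k/(4k)) I_k(F₁)`** (printed: `J_k(F_1)/I_k(F_1) = (log k/(4k))(1 + O(1/log k))`).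
[cite: Maynard2016DenseClusters, proof of Lemma 8.6 (8.18)] -/
theorem lemma86_J_F₁_ge_ratio (hk : 262144 ≤ n + 1) (m : Fin (n + 1)) :
    Real.log ((n + 1 : ℕ) : ℝ) / (4 * ((n + 1 : ℕ) : ℝ)) * orthantI (n + 1) (F₁ (n + 1)) ≤
      orthantJ n m (F₁ (n + 1)) := by
  have hk2 : 2 ≤ n + 1 := le_trans (by norm_num) hk
  rw [orthantJ_F₁, orthantI_F₁, pow_succ]
  have hγ := gam_pos hk2
  have hγn : 0 < gam (n + 1) ^ n := pow_pos hγ n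
  have hT := T_pos hk2
  have hL := twelve_le_log hk
  have hk0 : (0 : ℝ) < ((n + 1 : ℕ) : ℝ) := by positivity
  have hTdef : T (n + 1) = ((n + 1 : ℕ) : ℝ) * Real.log ((n + 1 : ℕ) : ℝ) := rfl
  have ha := ell_mul_T_ge hk      -- `L/2 ≤ ell T`
  have hb := gam_mul_T_le hk2     -- `γ T ≤ 1`
  clear hk
  -- suffices: `(L/(4k)) γ ≤ ell²`, i.e. `L γ ≤ 4 k ell²`; both sides compared through `T = k L`
  suffices h : Real.log ((n + 1 : ℕ) : ℝ) / (4 * ((n + 1 : ℕ) : ℝ)) * gam (n + 1) ≤ ell (n + 1) ^ 2 by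
    calc Real.log ((n + 1 : ℕ) : ℝ) / (4 * ((n + 1 : ℕ) : ℝ)) * (gam (n + 1) ^ n * gam (n + 1))
        = (Real.log ((n + 1 : ℕ) : ℝ) / (4 * ((n + 1 : ℕ) : ℝ)) * gam (n + 1)) * gam (n + 1) ^ n := by
          ring
      _ ≤ ell (n + 1) ^ 2 * gam (n + 1) ^ n := mul_le_mul_of_nonneg_right h hγn.le
  rw [div_mul_eq_mul_div, div_le_iff₀ (by positivity)]
  -- `L γ ≤ L/T = 1/k` and `4 k ell² ≥ 4k (L/(2T))² = 1/k`
  have h1 : Real.log ((n + 1 : ℕ) : ℝ) * gam (n + 1) * T (n + 1) ≤ Real.log ((n + 1 : ℕ) : ℝ) := by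
    nlinarith
  have h2 : Real.log ((n + 1 : ℕ) : ℝ) ^ 2 ≤ 4 * (ell (n + 1) * T (n + 1)) ^ 2 := by nlinarith
  -- multiply the goal by `T² > 0`
  have hT2 : 0 < T (n + 1) ^ 2 := by positivity
  refine le_of_mul_le_mul_right ?_ hT2
  calc Real.log ((n + 1 : ℕ) : ℝ) * gam (n + 1) * T (n + 1) ^ 2
      = (Real.log ((n + 1 : ℕ) : ℝ) * gam (n + 1) * T (n + 1)) * T (n + 1) := by ring
    _ ≤ Real.log ((n + 1 : ℕ) : ℝ) * T (n + 1) := mul_le_mul_of_nonneg_right h1 hT.le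
    _ = ((n + 1 : ℕ) : ℝ) * Real.log ((n + 1 : ℕ) : ℝ) ^ 2 := by rw [hTdef]; ring
    _ ≤ ((n + 1 : ℕ) : ℝ) * (4 * (ell (n + 1) * T (n + 1)) ^ 2) :=
        mul_le_mul_of_nonneg_left h2 hk0.le
    _ = ell (n + 1) ^ 2 * (4 * ((n + 1 : ℕ) : ℝ)) * T (n + 1) ^ 2 := by ring

/-- ★ **`J_k(F₁) ≤ (log k/k) I_k(F₁)`.** [cite: Maynard2016DenseClusters, proof of Lemma 8.6 (8.18)] -/
theorem lemma86_J_F₁_le_ratio (hk : 262144 ≤ n + 1) (m : Fin (n + 1)) :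
    orthantJ n m (F₁ (n + 1)) ≤
      Real.log ((n + 1 : ℕ) : ℝ) / ((n + 1 : ℕ) : ℝ) * orthantI (n + 1) (F₁ (n + 1)) := by
  have hk2 : 2 ≤ n + 1 := le_trans (by norm_num) hk
  rw [orthantJ_F₁, orthantI_F₁, pow_succ]
  have hγ := gam_pos hk2
  have hγn : 0 < gam (n + 1) ^ n := pow_pos hγ n
  have hT := T_pos hk2
  have hL := twelve_le_log hk
  have hk0 : (0 : ℝ) < ((n + 1 : ℕ) : ℝ) := by positivity
  have hTdef : T (n + 1) = ((n + 1 : ℕ) : ℝ) * Real.log ((n + 1 : ℕ) : ℝ) := rfl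
  have ha := ell_mul_T_le hk      -- `ell T ≤ 0.81 L`
  have hb := gam_mul_T_ge hk      -- `0.9998 ≤ γ T`
  have hell := ell_pos hk2
  clear hk
  suffices h : ell (n + 1) ^ 2 ≤ Real.log ((n + 1 : ℕ) : ℝ) / ((n + 1 : ℕ) : ℝ) * gam (n + 1) by
    calc ell (n + 1) ^ 2 * gam (n + 1) ^ n
        ≤ (Real.log ((n + 1 : ℕ) : ℝ) / ((n + 1 : ℕ) : ℝ) * gam (n + 1)) * gam (n + 1) ^ n :=
          mul_le_mul_of_nonneg_right h hγn.le
      _ = _ := by ring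
  rw [div_mul_eq_mul_div, le_div_iff₀ hk0]
  have hT2 : 0 < T (n + 1) ^ 2 := by positivity
  refine le_of_mul_le_mul_right ?_ hT2
  have h1 : (ell (n + 1) * T (n + 1)) ^ 2 ≤ (81 / 100) ^ 2 * Real.log ((n + 1 : ℕ) : ℝ) ^ 2 := by
    have := mul_pos hell hT
    nlinarith
  calc ell (n + 1) ^ 2 * ((n + 1 : ℕ) : ℝ) * T (n + 1) ^ 2
      = (ell (n + 1) * T (n + 1)) ^ 2 * ((n + 1 : ℕ) : ℝ) := by ring
    _ ≤ (81 / 100) ^ 2 * Real.log ((n + 1 : ℕ) : ℝ) ^ 2 * ((n + 1 : ℕ) : ℝ) :=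
        mul_le_mul_of_nonneg_right h1 hk0.le
    _ ≤ 4999 / 5000 * Real.log ((n + 1 : ℕ) : ℝ) ^ 2 * ((n + 1 : ℕ) : ℝ) := by
        have : 0 ≤ Real.log ((n + 1 : ℕ) : ℝ) ^ 2 * ((n + 1 : ℕ) : ℝ) := by positivity
        nlinarith
    _ ≤ (gam (n + 1) * T (n + 1)) * Real.log ((n + 1 : ℕ) : ℝ) ^ 2 * ((n + 1 : ℕ) : ℝ) := by
        have : 0 ≤ Real.log ((n + 1 : ℕ) : ℝ) ^ 2 * ((n + 1 : ℕ) : ℝ) := by positivity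
        nlinarith
    _ = Real.log ((n + 1 : ℕ) : ℝ) * gam (n + 1) * T (n + 1) ^ 2 := by rw [hTdef]; ring

/-- ★ **Lemma 8.6, the ratio, lower half: `J_k(F) ≥ (log k/(8k)) I_k(F)`** (printed `J_k(F)/I_k(F) ≫ log k/k`).
[cite: Maynard2016DenseClusters, Lemma 8.6 («log k/k ≪ J_k(F)/I_k(F)»)] -/
theorem lemma86_ratio_ge (hk : 262144 ≤ n + 1) (m : Fin (n + 1)) :
    Real.log ((n + 1 : ℕ) : ℝ) / (8 * ((n + 1 : ℕ) : ℝ)) * orthantI (n + 1) (F (n + 1)) ≤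
      orthantJ n m (F (n + 1)) := by
  have hk2 : 2 ≤ n + 1 := le_trans (by norm_num) hk
  have h1 := lemma86_J_F₁_ge_ratio hk m
  have h2 := orthantJ_F_ge_half hk m
  have h3 := orthantI_F_le hk2 (k := n + 1)
  have hL : 0 ≤ Real.log ((n + 1 : ℕ) : ℝ) / (8 * ((n + 1 : ℕ) : ℝ)) := by
    have := twelve_le_log hk; positivity
  have h4 := mul_le_mul_of_nonneg_left h3 hL
  have : Real.log ((n + 1 : ℕ) : ℝ) / (8 * ((n + 1 : ℕ) : ℝ)) =
      Real.log ((n + 1 : ℕ) : ℝ) / (4 * ((n + 1 : ℕ) : ℝ)) / 2 := by ring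
  rw [this] at h4 ⊢
  linarith

/-- ★ **Lemma 8.6, the ratio, upper half: `J_k(F) ≤ 2 (log k/k) I_k(F)`** (printed `J_k(F)/I_k(F) ≪ log k/k`).
[cite: Maynard2016DenseClusters, Lemma 8.6 («J_k(F)/I_k(F) ≪ log k/k»)] -/
theorem lemma86_ratio_le (hk : 262144 ≤ n + 1) (m : Fin (n + 1)) :
    orthantJ n m (F (n + 1)) ≤
      2 * (Real.log ((n + 1 : ℕ) : ℝ) / ((n + 1 : ℕ) : ℝ)) * orthantI (n + 1) (F (n + 1)) := by
  have hk2 : 2 ≤ n + 1 := le_trans (by norm_num) hk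
  have h1 := lemma86_J_F₁_le_ratio hk m
  have h2 := orthantJ_F_le hk2 m
  have h3 := lemma86_I_F₁_le_two_mul hk (k := n + 1)
  have hL : 0 ≤ Real.log ((n + 1 : ℕ) : ℝ) / ((n + 1 : ℕ) : ℝ) := by
    have := twelve_le_log hk; positivity
  have h4 := mul_le_mul_of_nonneg_left h3 hL
  linarith

/-! ### The two sequences `I_k := I_k(F_k)`, `J_k := J_k(F_k)` and the input of [FGKMT, Thm 6] -/

/-- `I_k := I_k(F_k)`. [cite: Maynard2016DenseClusters, Prop. 6.1 («I_k»)] -/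
def IF (k : ℕ) : ℝ := orthantI k (F k)

/-- `J_k := J_k(F_k)` (the printed choice: the last coordinate integrated out; `J_0 := 0`).
[cite: Maynard2016DenseClusters, Prop. 6.1 («J_k»)] -/
def JF : ℕ → ℝ
  | 0 => 0
  | n + 1 => orthantJ n (Fin.last n) (F (n + 1))

/-- ★★ **The `I_k`, `J_k` block of [Maynard, Prop. 6.1] / [FGKMT, Thm 6], with `C = 2^18`, `K = 8`:**
for `k ≥ 2^18`, `I_k > 0`, `(2k log k)^{−k} ≤ 8 I_k`, `(log k/k) I_k ≤ 8 J_k`, `J_k ≤ 8 (log k/k) I_k` —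
exactly the shape of the first conjunct of `FGKMT2018Theorem6Decomposition.Maynard2016DenseClusters_prop61Z`
with `F := MaynardDense.F`, `I := IF`, `J := JF`.
[cite: Maynard2016DenseClusters, Lemma 8.6; FordGreenKonyaginMaynardTao2018, Thm 6 (7.10)–(7.11)] -/
theorem IF_JF_bounds (k : ℕ) (hk : 262144 ≤ k) :
    0 < IF k ∧ (2 * (k : ℝ) * Real.log k) ^ (-(k : ℝ)) ≤ 8 * IF k ∧
      Real.log k / k * IF k ≤ 8 * JF k ∧ JF k ≤ 8 * (Real.log k / k * IF k) := by
  obtain ⟨n, rfl⟩ : ∃ n, k = n + 1 := ⟨k - 1, by omega⟩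
  have hpos := orthantI_F_pos hk
  have hI := lemma86_I_F_ge hk
  have hlo := lemma86_ratio_ge hk (Fin.last n)
  have hhi := lemma86_ratio_le hk (Fin.last n)
  have hL : 0 ≤ Real.log ((n + 1 : ℕ) : ℝ) / ((n + 1 : ℕ) : ℝ) := by
    have := twelve_le_log hk; positivity
  have hrpow : (2 * ((n + 1 : ℕ) : ℝ) * Real.log ((n + 1 : ℕ) : ℝ)) ^ (-((n + 1 : ℕ) : ℝ)) =
      ((2 * ((n + 1 : ℕ) : ℝ) * Real.log ((n + 1 : ℕ) : ℝ)) ^ (n + 1))⁻¹ := by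
    have h0 : 0 ≤ 2 * ((n + 1 : ℕ) : ℝ) * Real.log ((n + 1 : ℕ) : ℝ) := by
      have := twelve_le_log hk; positivity
    rw [Real.rpow_neg h0, Real.rpow_natCast]
  clear hk
  refine ⟨hpos, ?_, ?_, ?_⟩
  · rw [IF, hrpow]; linarith
  · show Real.log ((n + 1 : ℕ) : ℝ) / ((n + 1 : ℕ) : ℝ) * orthantI (n + 1) (F (n + 1)) ≤
      8 * orthantJ n (Fin.last n) (F (n + 1))
    have : Real.log ((n + 1 : ℕ) : ℝ) / ((n + 1 : ℕ) : ℝ) =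
        8 * (Real.log ((n + 1 : ℕ) : ℝ) / (8 * ((n + 1 : ℕ) : ℝ))) := by
      field_simp
    rw [this, mul_assoc]
    linarith
  · show orthantJ n (Fin.last n) (F (n + 1)) ≤
      8 * (Real.log ((n + 1 : ℕ) : ℝ) / ((n + 1 : ℕ) : ℝ) * orthantI (n + 1) (F (n + 1)))
    nlinarith [mul_nonneg hL hpos.le]

/-- ★★ **Existential packaging** (`C = 2^18`, `K = 8`): the `I_k, J_k` hypotheses of
`Maynard2016DenseClusters_prop61Z` hold for `F := MaynardDense.F`, `I := IF`, `J := JF`.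
[cite: Maynard2016DenseClusters, Lemma 8.6; FordGreenKonyaginMaynardTao2018, Thm 6 (7.10)–(7.11)] -/
theorem exists_IF_JF_bounds :
    ∃ (C : ℕ) (K : ℝ), 0 < K ∧ ∀ k : ℕ, C ≤ k →
      0 < IF k ∧ (2 * (k : ℝ) * Real.log k) ^ (-(k : ℝ)) ≤ K * IF k ∧
        Real.log k / k * IF k ≤ K * JF k ∧ JF k ≤ K * (Real.log k / k * IF k) :=
  ⟨262144, 8, by norm_num, IF_JF_bounds⟩

end Lemma86

/-! ## §11 API for §8–§9 of the source: Lipschitz bounds (8.7), monotonicity of `F`, a globally smooth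
representative of the profile, and the derivative bound behind `Ω_G = O(kT_k)` (Lemma 8.5)

These are the properties of `ψ`, `g_k`, `F` that the proofs of Lemmas 8.2, 8.4, 8.5 and Propositions
9.1–9.4 consume: «`1/(1+T_k u) = (1+O(T_kε))/(1+T_k v)`, `ψ(u) = ψ(v) + O(ε)`» ((8.7)), «`F` is decreasing in
each argument» (proof of Lemma 8.5), and «we have a bound on `G, Φ` which corresponds to `Ω_G = O(kT_k)`»
(proof of Lemma 8.5, for Lemma 8.4 applied with `Φ = ψ`, `G = g_k`).  Lemma 8.3/8.4 want a `C¹(ℝ)` profile; the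
printed `g_k` has a pole at `t = −1/T_k < 0`, so we also provide `profExt k` — smooth on `ℝ`, equal to `g_k` on
`[0, ∞)`, vanishing on `(−∞, −1/(2T_k)]`. -/

section API

variable {k n : ℕ}

/-! ### (8.7): Lipschitz bounds for `ψ` and `t ↦ 1/(1 + T_k t)` -/

/-- `ψ' = −10 · smoothTransition'(10t − 9)`. [cite: Maynard2016DenseClusters, proof of Lemma 8.2 (8.7)] -/
theorem hasDerivAt_psi (t : ℝ) :
    HasDerivAt psi (-(10 * deriv Real.smoothTransition (10 * t - 9))) t := by
  have h1 : HasDerivAt (fun t : ℝ => 10 * t - 9) 10 t := by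
    simpa using ((hasDerivAt_id t).const_mul (10 : ℝ)).sub_const 9
  have h2 : HasDerivAt Real.smoothTransition (deriv Real.smoothTransition (10 * t - 9)) (10 * t - 9) :=
    ((Real.smoothTransition.contDiff (n := 1)).differentiable one_ne_zero _).hasDerivAt
  have h3 : HasDerivAt (fun x : ℝ => Real.smoothTransition (10 * x - 9))
      (deriv Real.smoothTransition (10 * t - 9) * 10) t := by
    have := h2.comp t h1
    simpa only [Function.comp_def] using this
  have h4 : HasDerivAt (fun x : ℝ => 1 - Real.smoothTransition (10 * x - 9))
      (0 - deriv Real.smoothTransition (10 * t - 9) * 10) t := (hasDerivAt_const t (1 : ℝ)).sub h3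
  unfold psi
  refine h4.congr_deriv ?_
  ring

/-- `|ψ'| ≤ 30` (from the tree's `|smoothTransition'| ≤ 3`). [cite: Maynard2016DenseClusters, proof of Lemma 8.2 (8.7)] -/
theorem abs_deriv_psi_le (t : ℝ) : |deriv psi t| ≤ 30 := by
  rw [(hasDerivAt_psi t).deriv, abs_neg, abs_mul, abs_of_pos (by norm_num : (0 : ℝ) < 10)]
  linarith [Literature.Analysis.Calculus.abs_deriv_smoothTransition_le_three (10 * t - 9)]

/-- `ψ` is differentiable. [cite: Maynard2016DenseClusters, §7 after (7.4)] -/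
theorem differentiable_psi : Differentiable ℝ psi := fun t => (hasDerivAt_psi t).differentiableAt

/-- **`ψ` is `30`-Lipschitz**: `|ψ(u) − ψ(v)| ≤ 30 |u − v|` («`ψ(u) = ψ(v) + O(ε)`»).
[cite: Maynard2016DenseClusters, proof of Lemma 8.2 (8.7)] -/
theorem abs_psi_sub_psi_le (u v : ℝ) : |psi u - psi v| ≤ 30 * |u - v| := by
  have hL : LipschitzWith 30 psi := by
    refine lipschitzWith_of_nnnorm_deriv_le differentiable_psi fun t => ?_
    have h := abs_deriv_psi_le t
    rw [← NNReal.coe_le_coe, coe_nnnorm, Real.norm_eq_abs]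
    exact_mod_cast h
  have := hL.dist_le_mul u v
  simpa [Real.dist_eq] using this

/-- **`|1/(1+T_k u) − 1/(1+T_k v)| ≤ T_k |u − v|` for `u, v ≥ 0`** (additive form of
«`1/(1+T_k u) = (1 + O(T_kε))/(1 + T_k v)`»). [cite: Maynard2016DenseClusters, proof of Lemma 8.2 (8.7)] -/
theorem abs_inv_sub_inv_le (hk : 2 ≤ k) {u v : ℝ} (hu : 0 ≤ u) (hv : 0 ≤ v) :
    |1 / (1 + T k * u) - 1 / (1 + T k * v)| ≤ T k * |u - v| := by
  have hT := T_pos hk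
  have hu1 : 1 ≤ 1 + T k * u := by nlinarith
  have hv1 : 1 ≤ 1 + T k * v := by nlinarith
  rw [div_sub_div _ _ (by linarith) (by linarith), abs_div, abs_mul, abs_of_pos (by linarith : (0:ℝ) < 1 + T k * u),
    abs_of_pos (by linarith : (0:ℝ) < 1 + T k * v), div_le_iff₀ (by positivity)]
  have h1 : |1 * (1 + T k * v) - (1 + T k * u) * 1| = T k * |u - v| := by
    rw [show 1 * (1 + T k * v) - (1 + T k * u) * 1 = T k * (v - u) by ring, abs_mul, abs_of_pos hT,
      abs_sub_comm]
  rw [h1]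
  have : 0 ≤ T k * |u - v| := by positivity
  have hP : 1 ≤ (1 + T k * u) * (1 + T k * v) := by nlinarith
  nlinarith [mul_le_mul_of_nonneg_left hP this]

/-- **Multiplicative form of (8.7)**: `|(1 + T_k v)/(1 + T_k u) − 1| ≤ T_k |u − v|` for `u, v ≥ 0`.
[cite: Maynard2016DenseClusters, proof of Lemma 8.2 (8.7)] -/
theorem abs_ratio_sub_one_le (hk : 2 ≤ k) {u : ℝ} (hu : 0 ≤ u) (v : ℝ) :
    |(1 + T k * v) / (1 + T k * u) - 1| ≤ T k * |u - v| := by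
  have hT := T_pos hk
  have hu1 : 1 ≤ 1 + T k * u := by nlinarith
  rw [div_sub_one (by linarith), abs_div, abs_of_pos (by linarith : (0:ℝ) < 1 + T k * u),
    div_le_iff₀ (by linarith)]
  rw [show 1 + T k * v - (1 + T k * u) = T k * (v - u) by ring, abs_mul, abs_of_pos hT, abs_sub_comm]
  have : 0 ≤ T k * |u - v| := by positivity
  nlinarith

/-! ### «`F` is decreasing in each argument» -/

/-- `g_k` is non-increasing on `[0, ∞)`. [cite: Maynard2016DenseClusters, proof of Lemma 8.5 («F is decreasing in each argument»)] -/
theorem prof_antitoneOn (hk : 2 ≤ k) : AntitoneOn (prof k) (Ici 0) := by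
  intro a ha b hb hab
  have hk1 : 1 ≤ k := le_trans (by norm_num) hk
  have hT := T_pos hk
  have hU := U_pos hk1
  have ha0 : (0 : ℝ) ≤ a := ha
  unfold prof
  have h1 : psi (b / U k) ≤ psi (a / U k) := psi_antitone (div_le_div_of_nonneg_right hab hU.le)
  have h2 : 1 / (1 + T k * b) ≤ 1 / (1 + T k * a) :=
    div_le_div_of_nonneg_left zero_le_one (by nlinarith) (by nlinarith)
  calc psi (b / U k) / (1 + T k * b) = psi (b / U k) * (1 / (1 + T k * b)) := by ring
    _ ≤ psi (a / U k) * (1 / (1 + T k * a)) :=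
        mul_le_mul h1 h2 (by have h0 : 0 ≤ T k * b := mul_nonneg hT.le hb; positivity) (psi_nonneg _)
    _ = psi (a / U k) / (1 + T k * a) := by ring

/-- `h_k` is non-increasing on `[0, ∞)`. [cite: Maynard2016DenseClusters, proof of Lemma 8.5] -/
theorem prof₂_antitoneOn (hk : 2 ≤ k) : AntitoneOn (prof₂ k) (Ici 0) := by
  intro a ha b hb hab
  have hT := T_pos hk
  have ha0 : (0 : ℝ) ≤ a := ha
  unfold prof₂
  have h1 : psi (b / 2) ≤ psi (a / 2) := psi_antitone (by linarith)
  have h2 : 1 / (1 + T k * b) ≤ 1 / (1 + T k * a) :=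
    div_le_div_of_nonneg_left zero_le_one (by nlinarith) (by nlinarith)
  calc psi (b / 2) / (1 + T k * b) = psi (b / 2) * (1 / (1 + T k * b)) := by ring
    _ ≤ psi (a / 2) * (1 / (1 + T k * a)) :=
        mul_le_mul h1 h2 (by have h0 : 0 ≤ T k * b := mul_nonneg hT.le hb; positivity) (psi_nonneg _)
    _ = psi (a / 2) / (1 + T k * a) := by ring

/-- **`F₁` is non-increasing in each argument on the orthant.** [cite: Maynard2016DenseClusters, proof of Lemma 8.5 («F is decreasing in each argument»)] -/
theorem F₁_anti (hk : 2 ≤ k) {s t : Fin k → ℝ} (hs : s ∈ orthant k) (hst : ∀ i, s i ≤ t i) :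
    F₁ k t ≤ F₁ k s := by
  have ht : t ∈ orthant k := mem_orthant.2 fun i => (mem_orthant.1 hs i).trans (hst i)
  unfold F₁
  exact Finset.prod_le_prod (fun i _ => prof_nonneg hk (mem_orthant.1 ht i))
    fun i _ => prof_antitoneOn hk (mem_orthant.1 hs i) (mem_orthant.1 ht i) (hst i)

/-- **`F` is non-increasing in each argument on the orthant.** [cite: Maynard2016DenseClusters, proof of Lemma 8.5 («F is decreasing in each argument»)] -/
theorem F_anti (hk : 2 ≤ k) {s t : Fin k → ℝ} (hs : s ∈ orthant k) (hst : ∀ i, s i ≤ t i) :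
    F k t ≤ F k s := by
  have ht : t ∈ orthant k := mem_orthant.2 fun i => (mem_orthant.1 hs i).trans (hst i)
  rw [F_eq_psi_mul_F₁, F_eq_psi_mul_F₁]
  exact mul_le_mul (psi_antitone (Finset.sum_le_sum fun i _ => hst i)) (F₁_anti hk hs hst)
    (F₁_nonneg hk ht) (psi_nonneg _)

/-- **`F₂` is non-increasing in each argument on the orthant.** [cite: Maynard2016DenseClusters, proof of Lemma 8.5] -/
theorem F₂_anti (hk : 2 ≤ k) {s t : Fin k → ℝ} (hs : s ∈ orthant k) (hst : ∀ i, s i ≤ t i) :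
    F₂ k t ≤ F₂ k s := by
  have ht : t ∈ orthant k := mem_orthant.2 fun i => (mem_orthant.1 hs i).trans (hst i)
  rw [F₂_eq_sumH, F₂_eq_sumH]
  unfold sumH
  refine Finset.sum_le_sum fun j _ => Finset.prod_le_prod (fun i _ => ?_) fun i _ => ?_
  · unfold profIte; split_ifs
    · exact prof₂_nonneg hk (mem_orthant.1 ht i)
    · exact prof_nonneg hk (mem_orthant.1 ht i)
  · unfold profIte; split_ifs
    · exact prof₂_antitoneOn hk (mem_orthant.1 hs i) (mem_orthant.1 ht i) (hst i)
    · exact prof_antitoneOn hk (mem_orthant.1 hs i) (mem_orthant.1 ht i) (hst i)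

/-! ### The derivative of `g_k` on `[0, ∞)` and the bound behind `Ω_G = O(kT_k)` -/

/-- The derivative of `g_k` at `t > −1/T_k` (quotient rule):
`g_k'(t) = (ψ'(t/U_k)/U_k · (1+T_kt) − T_k ψ(t/U_k))/(1+T_kt)²`. [cite: Maynard2016DenseClusters, proof of Lemma 8.5 («a bound on G … Ω_G = O(kT_k)»)] -/
theorem hasDerivAt_prof (hk : 2 ≤ k) {t : ℝ} (ht : -1 < T k * t) :
    HasDerivAt (prof k)
      ((deriv psi (t / U k) / U k * (1 + T k * t) - psi (t / U k) * T k) / (1 + T k * t) ^ 2) t := by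
  have hk1 : 1 ≤ k := le_trans (by norm_num) hk
  have hU := U_pos hk1
  have hden : 1 + T k * t ≠ 0 := by linarith
  have h1 : HasDerivAt (fun t => psi (t / U k)) (deriv psi (t / U k) / U k) t := by
    have ha : HasDerivAt (fun t : ℝ => t / U k) (1 / U k) t := by
      simpa using (hasDerivAt_id t).div_const (U k)
    have hb : HasDerivAt psi (deriv psi (t / U k)) (t / U k) := (differentiable_psi _).hasDerivAt
    have hc := hb.comp t ha
    have e : deriv psi (t / U k) * (1 / U k) = deriv psi (t / U k) / U k := by ring
    rw [e] at hc
    exact hc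
  have h2 : HasDerivAt (fun t => 1 + T k * t) (T k) t := by
    simpa using ((hasDerivAt_id t).const_mul (T k)).const_add 1
  have h' : HasDerivAt (fun t => psi (t / U k) / (1 + T k * t))
      ((deriv psi (t / U k) / U k * (1 + T k * t) - psi (t / U k) * T k) / (1 + T k * t) ^ 2) t :=
    h1.div h2 hden
  unfold prof
  exact h'

/-- **`|g_k'(t)| ≤ 30/U_k + T_k` for `t ≥ 0`.** [cite: Maynard2016DenseClusters, proof of Lemma 8.5 («Ω_G = O(kT_k)»)] -/
theorem abs_deriv_prof_le (hk : 2 ≤ k) {t : ℝ} (ht : 0 ≤ t) :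
    |deriv (prof k) t| ≤ 30 / U k + T k := by
  have hk1 : 1 ≤ k := le_trans (by norm_num) hk
  have hU := U_pos hk1
  have hT := T_pos hk
  have hTt : 0 ≤ T k * t := by positivity
  have hden1 : 1 ≤ 1 + T k * t := by linarith
  rw [(hasDerivAt_prof hk (by linarith)).deriv, abs_div,
    abs_of_pos (by positivity : (0:ℝ) < (1 + T k * t) ^ 2), div_le_iff₀ (by positivity)]
  have hA : |deriv psi (t / U k)| ≤ 30 := abs_deriv_psi_le _
  have hψ0 := psi_nonneg (t / U k)
  have hψ1 := psi_le_one (t / U k)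
  have h30 : 0 ≤ 30 / U k := by positivity
  have hX : 1 + T k * t ≤ (1 + T k * t) ^ 2 := by nlinarith
  have hX1 : (1 : ℝ) ≤ (1 + T k * t) ^ 2 := by nlinarith
  calc |deriv psi (t / U k) / U k * (1 + T k * t) - psi (t / U k) * T k|
      ≤ |deriv psi (t / U k) / U k * (1 + T k * t)| + |psi (t / U k) * T k| := abs_sub _ _
    _ = |deriv psi (t / U k)| / U k * (1 + T k * t) + psi (t / U k) * T k := by
        rw [abs_mul, abs_div, abs_of_pos hU, abs_of_pos (by linarith : (0:ℝ) < 1 + T k * t), abs_mul,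
          abs_of_nonneg hψ0, abs_of_pos hT]
    _ ≤ 30 / U k * (1 + T k * t) + 1 * T k := by gcongr
    _ ≤ (30 / U k + T k) * (1 + T k * t) ^ 2 := by
        nlinarith [mul_le_mul_of_nonneg_left hX h30, mul_le_mul_of_nonneg_left hX1 hT.le]

/-- **The `Ω_G`-shape bound of Lemma 8.4 for `G = g_k`**: `sup_{t ≥ 0} (|g_k(t)| + |g_k'(t)|) ≤ 1 + 30/U_k + T_k`
(a polynomial in `k`, as «`Ω_G = O(kT_k)`» after dividing by `∫ g_k ≥ log k/(2T_k)`, `ell_mul_T_ge`).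
[cite: Maynard2016DenseClusters, proof of Lemma 8.5 («a bound on G, Φ which corresponds to Ω_G = O(kT_k)»)] -/
theorem abs_prof_add_abs_deriv_le (hk : 2 ≤ k) {t : ℝ} (ht : 0 ≤ t) :
    |prof k t| + |deriv (prof k) t| ≤ 1 + 30 / U k + T k := by
  have h1 : |prof k t| ≤ 1 := by rw [abs_of_nonneg (prof_nonneg hk ht)]; exact prof_le_one hk ht
  linarith [abs_deriv_prof_le hk ht]

/-! ### A globally smooth representative of the profile -/

/-- `profExt k t = smoothTransition(2 + 4T_k t) · g_k(t)`: a `C^∞(ℝ)` function equal to `g_k` on `[0, ∞)`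
(indeed on `(−1/(4T_k), ∞)`) and to `0` on `(−∞, −1/(2T_k)]` — the representative to feed to Lemmas 8.3/8.4,
which ask for a smooth `G` on `ℝ`. [cite: Maynard2016DenseClusters, Lemma 8.4 («G : ℝ → ℝ … smooth»)] -/
def profExt (k : ℕ) (t : ℝ) : ℝ := Real.smoothTransition (2 + 4 * T k * t) * prof k t

/-- `profExt k = g_k` on `(−1/(4T_k), ∞)`, in particular on `[0, ∞)`. [cite: Maynard2016DenseClusters, Lemma 8.4] -/
theorem profExt_of_gt {t : ℝ} (ht : -1 < 4 * T k * t) : profExt k t = prof k t := by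
  unfold profExt
  rw [Real.smoothTransition.one_of_one_le (by linarith), one_mul]

/-- `profExt k = g_k` on `[0, ∞)`. [cite: Maynard2016DenseClusters, Lemma 8.4] -/
theorem profExt_of_nonneg (hk : 2 ≤ k) {t : ℝ} (ht : 0 ≤ t) : profExt k t = prof k t :=
  profExt_of_gt (by have := T_pos hk; nlinarith)

/-- `profExt k = 0` on `(−∞, −1/(2T_k)]`. [cite: Maynard2016DenseClusters, Lemma 8.4] -/
theorem profExt_of_le {t : ℝ} (ht : 2 + 4 * T k * t ≤ 0) : profExt k t = 0 := by
  unfold profExt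
  rw [Real.smoothTransition.zero_of_nonpos ht, zero_mul]

/-- `profExt k t = 0` for `t ≥ U_k`. [cite: Maynard2016DenseClusters, Lemma 8.4 («supported on [0,1]»)] -/
theorem profExt_eq_zero (hk : 2 ≤ k) {t : ℝ} (ht : U k ≤ t) : profExt k t = 0 := by
  unfold profExt
  rw [prof_eq_zero (le_trans (by norm_num) hk) ht, mul_zero]

/-- `0 ≤ profExt k ≤ 2`. [cite: Maynard2016DenseClusters, Lemma 8.4] -/
theorem profExt_mem_Icc (hk : 2 ≤ k) (t : ℝ) : profExt k t ∈ Set.Icc (0 : ℝ) 2 := by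
  have hk1 : 1 ≤ k := le_trans (by norm_num) hk
  have hT := T_pos hk
  by_cases h : 2 + 4 * T k * t ≤ 0
  · rw [profExt_of_le h]; exact ⟨le_rfl, by norm_num⟩
  · have ht : -1 / 2 < T k * t := by
      rw [not_le] at h; linarith
    have hden : 1 / 2 < 1 + T k * t := by linarith
    have hs0 := Real.smoothTransition.nonneg (2 + 4 * T k * t)
    have hs1 := Real.smoothTransition.le_one (2 + 4 * T k * t)
    have hp0 : 0 ≤ prof k t := by
      unfold prof; exact div_nonneg (psi_nonneg _) (by linarith)
    have hp2 : prof k t ≤ 2 := by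
      unfold prof
      rw [div_le_iff₀ (by linarith)]
      linarith [psi_le_one (t / U k)]
    unfold profExt
    exact ⟨mul_nonneg hs0 hp0, by nlinarith⟩

/-- **`profExt k` is smooth on `ℝ`.** [cite: Maynard2016DenseClusters, Lemma 8.4 («G : ℝ → ℝ … smooth»)] -/
theorem contDiff_profExt (hk : 2 ≤ k) {m : ℕ∞} : ContDiff ℝ m (profExt k) := by
  have hk1 : 1 ≤ k := le_trans (by norm_num) hk
  have hT := T_pos hk
  have hcut : ContDiff ℝ m (fun t : ℝ => Real.smoothTransition (2 + 4 * T k * t)) :=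
    Real.smoothTransition.contDiff.comp (contDiff_const.add (contDiff_const.mul contDiff_id))
  refine contDiff_iff_contDiffAt.2 fun t => ?_
  by_cases ht : -3 / 4 < T k * t
  · -- near `t` the denominator `1 + T_k t` does not vanish: a product/quotient of smooth functions
    have hden : 1 + T k * t ≠ 0 := by linarith
    have hprof : ContDiffAt ℝ m (prof k) t := by
      unfold prof
      refine ContDiffAt.div ?_ ?_ hden
      · exact (contDiff_psi.comp (contDiff_id.div_const _)).contDiffAt
      · exact (contDiff_const.add (contDiff_const.mul contDiff_id)).contDiffAt
    exact hcut.contDiffAt.mul hprof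
  · -- near `t` the cut-off vanishes identically
    rw [not_lt] at ht
    have hev : profExt k =ᶠ[𝓝 t] fun _ => (0 : ℝ) := by
      have hopen : IsOpen {u : ℝ | T k * u < -1 / 2} :=
        isOpen_lt (continuous_const.mul continuous_id) continuous_const
      filter_upwards [hopen.mem_nhds (show T k * t < -1 / 2 by linarith)] with u hu
      have hu' : T k * u < -1 / 2 := hu
      exact profExt_of_le (by linarith)
    exact (contDiffAt_const.congr_of_eventuallyEq hev)

/-- `∫₀^∞ profExt k = L_k`. [cite: Maynard2016DenseClusters, Lemma 8.4 («∫₀^∞ G»)] -/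
theorem setIntegral_Ici_profExt (hk : 2 ≤ k) : ∫ u in Ici (0 : ℝ), profExt k u = ell k := by
  rw [← setIntegral_Ici_prof]
  exact setIntegral_congr_fun measurableSet_Ici fun u hu => profExt_of_nonneg hk hu

/-- On `[0, ∞)` the derivative of `profExt k` is that of `g_k`. [cite: Maynard2016DenseClusters, Lemma 8.4] -/
theorem deriv_profExt_of_nonneg (hk : 2 ≤ k) {t : ℝ} (ht : 0 ≤ t) :
    deriv (profExt k) t = deriv (prof k) t := by
  have hT := T_pos hk
  refine Filter.EventuallyEq.deriv_eq ?_
  have hopen : IsOpen {u : ℝ | -1 < 4 * T k * u} :=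
    isOpen_lt continuous_const (continuous_const.mul continuous_id)
  filter_upwards [hopen.mem_nhds (show -1 < 4 * T k * t by nlinarith)] with u hu
  exact profExt_of_gt hu

/-- **`sup_{t ≥ 0} (|profExt| + |profExt'|) ≤ 1 + 30/U_k + T_k`** (the `Ω_G` input of Lemma 8.4 for
`G = profExt k`). [cite: Maynard2016DenseClusters, proof of Lemma 8.5 («Ω_G = O(kT_k)»)] -/
theorem abs_profExt_add_abs_deriv_le (hk : 2 ≤ k) {t : ℝ} (ht : 0 ≤ t) :
    |profExt k t| + |deriv (profExt k) t| ≤ 1 + 30 / U k + T k := by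
  rw [profExt_of_nonneg hk ht, deriv_profExt_of_nonneg hk ht]
  exact abs_prof_add_abs_deriv_le hk ht

end API

/-! ## §12 The hyperplane slice of `F₂²` (proof of Proposition 9.2, display before (9.17)):
`∫_{t ≥ 0, t_m = 0} F₂² ∏_{i≠m} dtᵢ ≤ k² (∫ g_k²)^{k−2} (∫ h_k²) ≪ k² T_k² J_k(F)` -/

section Slice

variable {n : ℕ}

/-- The slice functional `∫_{[0,∞)^{k−1}} G(t; t_m := 0)² ∏_{i ≠ m} dtᵢ` (`k = n + 1`).
[cite: Maynard2016DenseClusters, proof of Prop. 9.2 (the display «∫_{t_1,…,t_k ≥ 0, t_m = 0} F_2² ∏_{i≠m} dt_i»)] -/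
def sliceI (n : ℕ) (m : Fin (n + 1)) (G : (Fin (n + 1) → ℝ) → ℝ) : ℝ :=
  ∫ s in orthant n, G (Fin.insertNth m 0 s) ^ 2

/-- On the hyperplane `t_m = 0`: `F₂(s; s_m := 0) = ∏ⱼ g_k(sⱼ) + sumH k n s` (`h_k(0) = g_k(0) = 1`).
[cite: Maynard2016DenseClusters, proof of Prop. 9.2 («from the definition (7.6) of F_2»)] -/
theorem F₂_insertNth_zero (hn : 2 ≤ n + 1) (m : Fin (n + 1)) (s : Fin n → ℝ) :
    F₂ (n + 1) (Fin.insertNth m 0 s) = ∏ j, prof (n + 1) (s j) + sumH (n + 1) n s := by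
  have hk1 : 1 ≤ n + 1 := le_trans (by norm_num) hn
  have h0 : prof (n + 1) 0 = 1 := by
    rw [prof_eq_inv hk1 (by have := U_pos hk1; positivity)]; simp
  have h0' : prof₂ (n + 1) 0 = 1 := by
    unfold prof₂; rw [zero_div, psi_eq_one (by norm_num)]; simp
  rw [F₂_eq_sumH, sumH_insertNth m, h0, h0', one_mul, one_mul]

/-- **The slice bound, printed form** (`k = n + 1 ≥ 2`):
`∫_{t ≥ 0, t_m = 0} F₂² ∏_{i≠m} dtᵢ ≤ k² (∫₀^∞ h_k²) (∫₀^∞ g_k²)^{k−2}` (Cauchy–Schwarz over the `k` summands, and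
`∫ g_k² ≤ ∫ h_k²` for the summand without `h_k`).
[cite: Maynard2016DenseClusters, proof of Prop. 9.2 («≤ k²(∫ψ(t/U_k)²/(1+T_kt)²)^{k−2}(∫ψ(t/2)²/(1+T_kt)²)»)] -/
theorem sliceI_F₂_le (hn : 2 ≤ n + 1) (m : Fin (n + 1)) :
    sliceI n m (F₂ (n + 1)) ≤ ((n + 1 : ℕ) : ℝ) ^ 2 * (gam₂ (n + 1) * gam (n + 1) ^ (n - 1)) := by
  have hn0 : n ≠ 0 := by omega
  have hγ := gam_pos hn
  have hP := integrableOn_prod_sq hn n (k := n + 1)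
  have hQ := integrableOn_sumH_sq hn (n := n) (k := n + 1)
  -- `γ ≤ ∫ h²` since `g ≤ h`
  have hγ₂ : gam (n + 1) ≤ gam₂ (n + 1) := by
    rw [gam, gam₂]
    refine integral_mono (integrable_profCut_sq hn) (integrable_prof₂Cut_sq hn) fun x => ?_
    by_cases hx : 0 ≤ x
    · rw [profCut_of_nonneg hx, prof₂Cut_of_nonneg hx]
      exact pow_le_pow_left₀ (prof_nonneg hn hx) (prof_le_prof₂ hn hx) 2
    · rw [profCut_of_neg (not_le.1 hx), prof₂Cut_of_neg (not_le.1 hx)]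
  have hpow : gam (n + 1) ^ n ≤ gam₂ (n + 1) * gam (n + 1) ^ (n - 1) := by
    rw [← pow_sub_one_mul hn0 (gam (n + 1)), mul_comm]
    exact mul_le_mul_of_nonneg_right hγ₂ (by positivity)
  -- Cauchy–Schwarz over the `n + 1` summands `P, a_1, …, a_n` (`Q = Σ a_j`, `Q² ≤ n Σ a_j²`):
  -- `(P + Q)² ≤ (n+1)(P² + Σ_j a_j²)`
  have hmeas : Measurable fun s : Fin n → ℝ =>
      (∏ j, prof (n + 1) (s j) + sumH (n + 1) n s) ^ 2 :=
    ((Finset.measurable_prod _ fun i _ => (measurable_prof (n + 1)).comp (measurable_pi_apply i)).add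
      (measurable_sumH (n + 1) n)).pow_const 2
  have hnr : (0 : ℝ) < n := by exact_mod_cast Nat.pos_of_ne_zero hn0
  have hS : IntegrableOn (fun s : Fin n → ℝ => ∑ j, (∏ i, profIte (n + 1) j i (s i)) ^ 2) (orthant n) :=
    integrable_finsetSum _ fun j _ => integrableOn_prod_profIte_sq hn j
  have hdom : IntegrableOn (fun s : Fin n → ℝ =>
      (n + 1) * ((∏ j, prof (n + 1) (s j)) ^ 2 + ∑ j, (∏ i, profIte (n + 1) j i (s i)) ^ 2)) (orthant n) :=
    (hP.add hS).const_mul _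
  have hpt : ∀ s : Fin n → ℝ, (∏ j, prof (n + 1) (s j) + sumH (n + 1) n s) ^ 2 ≤
      (n + 1) * ((∏ j, prof (n + 1) (s j)) ^ 2 + ∑ j, (∏ i, profIte (n + 1) j i (s i)) ^ 2) := by
    intro s
    have hQ2 := sumH_sq_le (k := n + 1) (n := n) s
    set P := ∏ j, prof (n + 1) (s j)
    set Q := sumH (n + 1) n s
    set S := ∑ j, (∏ i, profIte (n + 1) j i (s i)) ^ 2
    have h3 : ((n : ℝ) + 1) * Q ^ 2 ≤ ((n : ℝ) + 1) * (n * S) :=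
      mul_le_mul_of_nonneg_left hQ2 (by positivity)
    nlinarith [sq_nonneg ((n : ℝ) * P - Q), hnr]
  have hint : IntegrableOn (fun s : Fin n → ℝ =>
      (∏ j, prof (n + 1) (s j) + sumH (n + 1) n s) ^ 2) (orthant n) :=
    Integrable.mono' hdom hmeas.aestronglyMeasurable (ae_of_all _ fun s => by
      rw [Real.norm_eq_abs, abs_of_nonneg (sq_nonneg _)]; exact hpt s)
  rw [sliceI]
  simp_rw [F₂_insertNth_zero hn m]
  calc ∫ s in orthant n, (∏ j, prof (n + 1) (s j) + sumH (n + 1) n s) ^ 2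
      ≤ ∫ s in orthant n,
          (n + 1) * ((∏ j, prof (n + 1) (s j)) ^ 2 + ∑ j, (∏ i, profIte (n + 1) j i (s i)) ^ 2) :=
        setIntegral_mono_on hint hdom (measurableSet_orthant n) fun s _ => hpt s
    _ = (n + 1) * (gam (n + 1) ^ n + ∑ j : Fin n, gam₂ (n + 1) * gam (n + 1) ^ (n - 1)) := by
        rw [integral_const_mul, integral_add hP hS, setIntegral_orthant_prod_sq,
          integral_finsetSum _ fun j _ => integrableOn_prod_profIte_sq hn j]
        simp_rw [setIntegral_orthant_prod_profIte_sq]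
    _ = (n + 1) * (gam (n + 1) ^ n + n * (gam₂ (n + 1) * gam (n + 1) ^ (n - 1))) := by
        rw [Finset.sum_const, Finset.card_univ, Fintype.card_fin, nsmul_eq_mul]
    _ ≤ (n + 1) * (gam₂ (n + 1) * gam (n + 1) ^ (n - 1) + n * (gam₂ (n + 1) * gam (n + 1) ^ (n - 1))) := by
        gcongr
    _ = ((n + 1 : ℕ) : ℝ) ^ 2 * (gam₂ (n + 1) * gam (n + 1) ^ (n - 1)) := by
        push_cast; ring

/-- **The slice bound in terms of `J_k(F)`** (`k = n + 1 ≥ 2^18`, any coordinate `m`):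
`∫_{t ≥ 0, t_m = 0} F₂² ∏_{i≠m} dtᵢ ≤ k² T_k² J_k^{(m)}(F)` (printed `≪ k² T_k² J_k(F)`; in fact `≤ k²T_k² J/16`).
[cite: Maynard2016DenseClusters, proof of Prop. 9.2 («≪ k² T_k² J_k(F)»)] -/
theorem sliceI_F₂_le' (hk : 262144 ≤ n + 1) (m : Fin (n + 1)) :
    sliceI n m (F₂ (n + 1)) ≤ ((n + 1 : ℕ) : ℝ) ^ 2 * T (n + 1) ^ 2 * orthantJ n m (F (n + 1)) := by
  have hn : 2 ≤ n + 1 := le_trans (by norm_num) hk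
  have hn0 : n ≠ 0 := by omega
  have h1 := sliceI_F₂_le hn m
  have hJ := orthantJ_F_ge_half hk m
  rw [orthantJ_F₁] at hJ
  have hγ := gam_pos hn
  have hT := T_pos hn
  have hγT := gam_mul_T_ge hk
  have hγT1 := gam_mul_T_le hn
  have hell := ell_mul_T_ge hk
  have hL := twelve_le_log hk
  have h2 : gam₂ (n + 1) ≤ (T (n + 1))⁻¹ := gam₂_le_inv hn
  clear hk
  -- `gam₂ γ^{n−1} ≤ (1/T) γ^{n−1}` and `T² ell² γ^n/2 ≥ T² (L/(2T))² γ^{n-1} γ /2 ≥ ...`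
  have hpow : gam (n + 1) ^ n = gam (n + 1) ^ (n - 1) * gam (n + 1) := (pow_sub_one_mul hn0 _).symm
  have hg1 : 0 ≤ gam (n + 1) ^ (n - 1) := by positivity
  have hk0 : (0 : ℝ) ≤ ((n + 1 : ℕ) : ℝ) ^ 2 := by positivity
  -- reduce to a comparison of the scalar factors
  have key : gam₂ (n + 1) * gam (n + 1) ^ (n - 1) ≤
      T (n + 1) ^ 2 * (ell (n + 1) ^ 2 * gam (n + 1) ^ n / 2) := by
    rw [hpow]
    -- `gam₂ ≤ 1/T` and `T² ell² γ / 2 ≥ T² (L/2T)² (0.9998/T)/2 = 0.9998 L²/8 /T ≥ 1/T` (L ≥ 12)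
    have hA : gam₂ (n + 1) * T (n + 1) ≤ 1 := by
      have := mul_le_mul_of_nonneg_right h2 hT.le
      rwa [inv_mul_cancel₀ hT.ne'] at this
    have hB : 1 ≤ T (n + 1) ^ 2 * (ell (n + 1) ^ 2 * gam (n + 1) / 2) * T (n + 1) := by
      have e : T (n + 1) ^ 2 * (ell (n + 1) ^ 2 * gam (n + 1) / 2) * T (n + 1) =
          (ell (n + 1) * T (n + 1)) ^ 2 * (gam (n + 1) * T (n + 1)) / 2 := by ring
      rw [e]
      have h3 : (Real.log ((n + 1 : ℕ) : ℝ) / 2) ^ 2 ≤ (ell (n + 1) * T (n + 1)) ^ 2 :=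
        pow_le_pow_left₀ (by positivity) hell 2
      nlinarith
    -- divide by `T > 0`
    have hC : gam₂ (n + 1) ≤ T (n + 1) ^ 2 * (ell (n + 1) ^ 2 * gam (n + 1) / 2) := by
      by_contra h
      rw [not_le] at h
      nlinarith
    calc gam₂ (n + 1) * gam (n + 1) ^ (n - 1)
        ≤ T (n + 1) ^ 2 * (ell (n + 1) ^ 2 * gam (n + 1) / 2) * gam (n + 1) ^ (n - 1) :=
          mul_le_mul_of_nonneg_right hC hg1
      _ = T (n + 1) ^ 2 * (ell (n + 1) ^ 2 * (gam (n + 1) ^ (n - 1) * gam (n + 1)) / 2) := by ring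
  calc sliceI n m (F₂ (n + 1)) ≤ ((n + 1 : ℕ) : ℝ) ^ 2 * (gam₂ (n + 1) * gam (n + 1) ^ (n - 1)) := h1
    _ ≤ ((n + 1 : ℕ) : ℝ) ^ 2 * (T (n + 1) ^ 2 * (ell (n + 1) ^ 2 * gam (n + 1) ^ n / 2)) :=
        mul_le_mul_of_nonneg_left key hk0
    _ ≤ ((n + 1 : ℕ) : ℝ) ^ 2 * T (n + 1) ^ 2 * orthantJ n m (F (n + 1)) := by
        rw [mul_assoc]
        exact mul_le_mul_of_nonneg_left (mul_le_mul_of_nonneg_left hJ (by positivity)) hk0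

end Slice

/-! ## §13 The analytic core of Lemma 8.2 (display (8.8)): shifting one coordinate of `F` costs `O(T_k ε F₂)` -/

section Shift

variable {k : ℕ}

/-- `∏ᵢ g_k((u; u_j := x)ᵢ) = g_k(x) ∏_{i ≠ j} g_k(uᵢ)`. [cite: Maynard2016DenseClusters, proof of Lemma 8.2 («multiplying by ∏_{i≠j} ψ(u_i/U_k)/(1+T_ku_i)»)] -/
theorem prod_prof_update (u : Fin k → ℝ) (j : Fin k) (x : ℝ) :
    ∏ i, prof k (Function.update u j x i) = prof k x * ∏ i ∈ univ.erase j, prof k (u i) := by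
  have h : ∀ i, prof k (Function.update u j x i) = Function.update (fun i => prof k (u i)) j (prof k x) i :=
    fun i => by rw [Function.apply_update (fun _ => prof k) u j x i]
  simp_rw [h]
  rw [Finset.prod_update_of_mem (Finset.mem_univ j), Finset.sdiff_singleton_eq_erase]

/-- `∑ᵢ (u; u_j := x)ᵢ = x + ∑_{i ≠ j} uᵢ`. [cite: Maynard2016DenseClusters, proof of Lemma 8.2] -/
theorem sum_update (u : Fin k → ℝ) (j : Fin k) (x : ℝ) :
    ∑ i, Function.update u j x i = x + ∑ i ∈ univ.erase j, u i := by
  rw [Finset.sum_update_of_mem (Finset.mem_univ j), Finset.sdiff_singleton_eq_erase]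

/-- `∑ᵢ uᵢ = u_j + ∑_{i ≠ j} uᵢ`. [cite: Maynard2016DenseClusters, proof of Lemma 8.2] -/
theorem sum_eq_add_sum_erase (u : Fin k → ℝ) (j : Fin k) : ∑ i, u i = u j + ∑ i ∈ univ.erase j, u i :=
  (Finset.add_sum_erase _ _ (Finset.mem_univ j)).symm

/-- `F` with the `j`-th coordinate singled out: `F(u) = ψ(u_j + Σ_{i≠j} u_i)·g_k(u_j)·∏_{i≠j} g_k(u_i)`.
[cite: Maynard2016DenseClusters, proof of Lemma 8.2] -/
theorem F_eq_erase (u : Fin k → ℝ) (j : Fin k) :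
    F k u = psi (u j + ∑ i ∈ univ.erase j, u i) * (prof k (u j) * ∏ i ∈ univ.erase j, prof k (u i)) := by
  unfold F
  rw [← Finset.mul_prod_erase univ (fun i => prof k (u i)) (Finset.mem_univ j), ← sum_eq_add_sum_erase u j]

/-- `F` at the point with the `j`-th coordinate replaced by `x`:
`F(u; u_j := x) = ψ(x + Σ_{i≠j} u_i)·g_k(x)·∏_{i≠j} g_k(u_i)`. [cite: Maynard2016DenseClusters, proof of Lemma 8.2] -/
theorem F_update_eq (u : Fin k → ℝ) (j : Fin k) (x : ℝ) :
    F k (Function.update u j x) =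
      psi (x + ∑ i ∈ univ.erase j, u i) * (prof k x * ∏ i ∈ univ.erase j, prof k (u i)) := by
  unfold F
  rw [prod_prof_update, sum_update]

/-- The `j`-th summand of `F₂` is at most `F₂` (on the orthant). [cite: Maynard2016DenseClusters, (7.6)] -/
theorem summand_le_F₂ (hk : 2 ≤ k) {u : Fin k → ℝ} (hu : u ∈ orthant k) (j : Fin k) :
    prof₂ k (u j) * ∏ i ∈ univ.erase j, prof k (u i) ≤ F₂ k u := by
  unfold F₂
  exact Finset.single_le_sum (f := fun j => prof₂ k (u j) * ∏ i ∈ univ.erase j, prof k (u i))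
    (fun j' _ => mul_nonneg (prof₂_nonneg hk (mem_orthant.1 hu j'))
      (Finset.prod_nonneg fun i _ => prof_nonneg hk (mem_orthant.1 hu i))) (Finset.mem_univ j)

/-- **(8.7)–(8.8) for the profile**: for `0 ≤ u ≤ 9/5` and `ε ≥ 0`,
`|g_k(u + ε) − g_k(u)| ≤ (30/U_k + T_k) · ε · h_k(u)` (there `h_k(u) = 1/(1 + T_k u)` since `ψ(u/2) = 1`).
[cite: Maynard2016DenseClusters, proof of Lemma 8.2 (8.7)–(8.8)] -/
theorem abs_prof_shift_sub_le (hk : 2 ≤ k) {u ε : ℝ} (hu : 0 ≤ u) (hu2 : u ≤ 9 / 5) (hε : 0 ≤ ε) :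
    |prof k (u + ε) - prof k u| ≤ (30 / U k + T k) * ε * prof₂ k u := by
  have hk1 : 1 ≤ k := le_trans (by norm_num) hk
  have hU := U_pos hk1
  have hT := T_pos hk
  have hTe : 0 ≤ T k * ε := by positivity
  have hden : 0 < 1 + T k * u := by positivity
  have hden' : 0 < 1 + T k * (u + ε) := by positivity
  have hmono : 1 + T k * u ≤ 1 + T k * (u + ε) := by rw [mul_add]; linarith
  have h2 : prof₂ k u = 1 / (1 + T k * u) := by
    unfold prof₂; rw [psi_eq_one (by linarith)]
  rw [h2]
  unfold prof
  -- split as `(ψ(v/U) − ψ(u/U))/(1+Tv) + ψ(u/U)(1/(1+Tv) − 1/(1+Tu))`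
  have hsplit : psi ((u + ε) / U k) / (1 + T k * (u + ε)) - psi (u / U k) / (1 + T k * u) =
      (psi ((u + ε) / U k) - psi (u / U k)) / (1 + T k * (u + ε)) +
        psi (u / U k) * (1 / (1 + T k * (u + ε)) - 1 / (1 + T k * u)) := by
    field_simp
    ring
  rw [hsplit]
  have hA : |(psi ((u + ε) / U k) - psi (u / U k)) / (1 + T k * (u + ε))| ≤
      30 / U k * ε * (1 / (1 + T k * u)) := by
    rw [abs_div, abs_of_pos hden']
    have h1 : |psi ((u + ε) / U k) - psi (u / U k)| ≤ 30 * (ε / U k) := by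
      have := abs_psi_sub_psi_le ((u + ε) / U k) (u / U k)
      rwa [show (u + ε) / U k - u / U k = ε / U k by ring, abs_of_nonneg (div_nonneg hε hU.le)] at this
    calc |psi ((u + ε) / U k) - psi (u / U k)| / (1 + T k * (u + ε))
        ≤ 30 * (ε / U k) / (1 + T k * (u + ε)) := div_le_div_of_nonneg_right h1 hden'.le
      _ ≤ 30 * (ε / U k) / (1 + T k * u) := div_le_div_of_nonneg_left (by positivity) hden hmono
      _ = 30 / U k * ε * (1 / (1 + T k * u)) := by ring
  have hB : |psi (u / U k) * (1 / (1 + T k * (u + ε)) - 1 / (1 + T k * u))| ≤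
      T k * ε * (1 / (1 + T k * u)) := by
    rw [abs_mul, abs_of_nonneg (psi_nonneg _)]
    have h1 : |1 / (1 + T k * (u + ε)) - 1 / (1 + T k * u)| ≤ T k * ε * (1 / (1 + T k * u)) := by
      rw [div_sub_div _ _ hden'.ne' hden.ne', abs_div, abs_of_pos (mul_pos hden' hden),
        show 1 * (1 + T k * u) - (1 + T k * (u + ε)) * 1 = -(T k * ε) by ring, abs_neg,
        abs_of_nonneg hTe, div_le_iff₀ (mul_pos hden' hden)]
      have : T k * ε * (1 / (1 + T k * u)) * ((1 + T k * (u + ε)) * (1 + T k * u)) =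
          T k * ε * (1 + T k * (u + ε)) := by
        field_simp
      rw [this]
      exact le_mul_of_one_le_right hTe (le_add_of_nonneg_right (by positivity))
    calc psi (u / U k) * |1 / (1 + T k * (u + ε)) - 1 / (1 + T k * u)|
        ≤ |1 / (1 + T k * (u + ε)) - 1 / (1 + T k * u)| :=
          mul_le_of_le_one_left (abs_nonneg _) (psi_le_one _)
      _ ≤ _ := h1
  calc |(psi ((u + ε) / U k) - psi (u / U k)) / (1 + T k * (u + ε)) +
        psi (u / U k) * (1 / (1 + T k * (u + ε)) - 1 / (1 + T k * u))|
      ≤ |(psi ((u + ε) / U k) - psi (u / U k)) / (1 + T k * (u + ε))| +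
        |psi (u / U k) * (1 / (1 + T k * (u + ε)) - 1 / (1 + T k * u))| := abs_add_le _ _
    _ ≤ 30 / U k * ε * (1 / (1 + T k * u)) + T k * ε * (1 / (1 + T k * u)) := add_le_add hA hB
    _ = (30 / U k + T k) * ε * (1 / (1 + T k * u)) := by ring

/-- **The analytic core of Lemma 8.2 (display (8.8))**: on the orthant, increasing the `j`-th argument of
`F` by `ε ≥ 0` changes `F` by at most `(30 + 30/U_k + T_k)·ε·F₂` («`y_s = y_r + O(T_k Y_r log A/log R)`»
after multiplying by the common prefactor of `y_r`, `Y_r`; `30 + 30/U_k + T_k ≤ 3T_k` for large `k`,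
`shift_const_le`). [cite: Maynard2016DenseClusters, Lemma 8.2 (i) with proof (8.7)–(8.8)] -/
theorem abs_F_update_sub_le (hk : 2 ≤ k) {u : Fin k → ℝ} (hu : u ∈ orthant k) (j : Fin k) {ε : ℝ}
    (hε : 0 ≤ ε) :
    |F k (Function.update u j (u j + ε)) - F k u| ≤ (30 + 30 / U k + T k) * ε * F₂ k u := by
  have hk1 : 1 ≤ k := le_trans (by norm_num) hk
  have hU := U_pos hk1
  have hU1 := U_le_one hk1
  have hT := T_pos hk
  have huj : 0 ≤ u j := mem_orthant.1 hu j
  have hF2 := summand_le_F₂ hk hu j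
  have hP0 : 0 ≤ ∏ i ∈ univ.erase j, prof k (u i) :=
    Finset.prod_nonneg fun i _ => prof_nonneg hk (mem_orthant.1 hu i)
  rw [F_update_eq, F_eq_erase u j]
  generalize ∏ i ∈ univ.erase j, prof k (u i) = P at hF2 hP0 ⊢
  generalize ∑ i ∈ univ.erase j, u i = S
  have hF2nn : 0 ≤ F₂ k u := le_trans (mul_nonneg (prof₂_nonneg hk huj) hP0) hF2
  have hC : 0 ≤ (30 + 30 / U k + T k) * ε := mul_nonneg (by positivity) hε
  by_cases hbig : 9 / 5 < u j
  · -- then `u_j, u_j + ε ≥ U_k`: both values vanish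
    have h1 : prof k (u j) = 0 := prof_eq_zero hk1 (by linarith)
    have h2 : prof k (u j + ε) = 0 := prof_eq_zero hk1 (by linarith)
    rw [h1, h2, zero_mul, mul_zero, mul_zero, sub_self, abs_zero]
    exact mul_nonneg hC hF2nn
  · rw [not_lt] at hbig
    have hujε : 0 ≤ u j + ε := add_nonneg huj hε
    have hprof := abs_prof_shift_sub_le hk huj hbig hε
    have hpv : prof k (u j + ε) ≤ prof₂ k (u j) :=
      (prof_le_prof₂ hk hujε).trans
        (prof₂_antitoneOn hk (Set.mem_Ici.2 huj) (Set.mem_Ici.2 hujε) (le_add_of_nonneg_right hε))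
    have hpv0 : 0 ≤ prof k (u j + ε) := prof_nonneg hk hujε
    -- `F(v) − F(u) = (ψ(v_j+S) − ψ(u_j+S))·g(v_j)·P + ψ(u_j+S)·(g(v_j) − g(u_j))·P`
    have hdiff : psi (u j + ε + S) * (prof k (u j + ε) * P) - psi (u j + S) * (prof k (u j) * P) =
        (psi (u j + ε + S) - psi (u j + S)) * (prof k (u j + ε) * P) +
          psi (u j + S) * ((prof k (u j + ε) - prof k (u j)) * P) := by ring
    rw [hdiff]
    have hA : |(psi (u j + ε + S) - psi (u j + S)) * (prof k (u j + ε) * P)| ≤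
        30 * ε * (prof₂ k (u j) * P) := by
      rw [abs_mul, abs_of_nonneg (mul_nonneg hpv0 hP0)]
      have h1 : |psi (u j + ε + S) - psi (u j + S)| ≤ 30 * ε := by
        have := abs_psi_sub_psi_le (u j + ε + S) (u j + S)
        rwa [show u j + ε + S - (u j + S) = ε by ring, abs_of_nonneg hε] at this
      calc |psi (u j + ε + S) - psi (u j + S)| * (prof k (u j + ε) * P)
          ≤ 30 * ε * (prof k (u j + ε) * P) := mul_le_mul_of_nonneg_right h1 (mul_nonneg hpv0 hP0)
        _ ≤ 30 * ε * (prof₂ k (u j) * P) :=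
            mul_le_mul_of_nonneg_left (mul_le_mul_of_nonneg_right hpv hP0) (by positivity)
    have hB : |psi (u j + S) * ((prof k (u j + ε) - prof k (u j)) * P)| ≤
        (30 / U k + T k) * ε * (prof₂ k (u j) * P) := by
      rw [abs_mul, abs_of_nonneg (psi_nonneg _), abs_mul, abs_of_nonneg hP0]
      calc psi (u j + S) * (|prof k (u j + ε) - prof k (u j)| * P)
          ≤ |prof k (u j + ε) - prof k (u j)| * P :=
            mul_le_of_le_one_left (mul_nonneg (abs_nonneg _) hP0) (psi_le_one _)
        _ ≤ (30 / U k + T k) * ε * prof₂ k (u j) * P := mul_le_mul_of_nonneg_right hprof hP0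
        _ = (30 / U k + T k) * ε * (prof₂ k (u j) * P) := by ring
    calc |(psi (u j + ε + S) - psi (u j + S)) * (prof k (u j + ε) * P) +
          psi (u j + S) * ((prof k (u j + ε) - prof k (u j)) * P)|
        ≤ |(psi (u j + ε + S) - psi (u j + S)) * (prof k (u j + ε) * P)| +
          |psi (u j + S) * ((prof k (u j + ε) - prof k (u j)) * P)| := abs_add_le _ _
      _ ≤ 30 * ε * (prof₂ k (u j) * P) + (30 / U k + T k) * ε * (prof₂ k (u j) * P) := add_le_add hA hB
      _ = (30 + 30 / U k + T k) * ε * (prof₂ k (u j) * P) := by ring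
      _ ≤ (30 + 30 / U k + T k) * ε * F₂ k u := mul_le_mul_of_nonneg_left hF2 hC

/-- `30 + 30/U_k + T_k ≤ 3 T_k` for `k ≥ 2^18` (so the constant above is `O(T_k)` as printed).
[cite: Maynard2016DenseClusters, Lemma 8.2 («O(T_k …)»)] -/
theorem shift_const_le (hk : 262144 ≤ k) : 30 + 30 / U k + T k ≤ 3 * T k := by
  have hk1 : 1 ≤ k := le_trans (by norm_num) hk
  have hL := twelve_le_log hk
  have hs := sqrt_ge hk
  have hU := U_pos hk1
  have hUs := U_mul_sqrt hk1
  have hkr : (262144 : ℝ) ≤ k := by exact_mod_cast hk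
  have hsk : Real.sqrt k * Real.sqrt k = k := Real.mul_self_sqrt (Nat.cast_nonneg k)
  have h1 : 30 / U k = 30 * Real.sqrt k := by
    rw [div_eq_iff hU.ne', mul_assoc, mul_comm (Real.sqrt (k : ℝ)) (U k), hUs, mul_one]
  have ha : 30 * Real.sqrt k ≤ Real.sqrt k * Real.sqrt k :=
    mul_le_mul_of_nonneg_right (by linarith) (Real.sqrt_nonneg _)
  have hkL : (k : ℝ) * 12 ≤ k * Real.log k := mul_le_mul_of_nonneg_left hL (Nat.cast_nonneg k)
  rw [h1]
  unfold T
  linarith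

end Shift

/-! ## §14 Lemma 8.2 (ii), analytic form («applying part (i) to each component in turn») and the `Ω_G` of Lemma 8.4 for `G = g_k` -/

section ShiftAll

variable {k : ℕ}

/-- `F₂ ≥ 0` on the orthant. [cite: Maynard2016DenseClusters, (7.6)] -/
theorem F₂_nonneg (hk : 2 ≤ k) {u : Fin k → ℝ} (hu : u ∈ orthant k) : 0 ≤ F₂ k u := by
  unfold F₂
  exact Finset.sum_nonneg fun j _ => mul_nonneg (prof₂_nonneg hk (mem_orthant.1 hu j))
    (Finset.prod_nonneg fun i _ => prof_nonneg hk (mem_orthant.1 hu i))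

/-- The intermediate points of the coordinate-by-coordinate passage from `u` to `v`: the first `m`
coordinates are those of `v`, the others those of `u`.
[cite: Maynard2016DenseClusters, proof of Lemma 8.2 (ii) («applying part (i) to each component in turn»)] -/
def mixPt (u v : Fin k → ℝ) (m : ℕ) : Fin k → ℝ := fun i => if (i : ℕ) < m then v i else u i

/-- `mixPt u v 0 = u`. [cite: Maynard2016DenseClusters, proof of Lemma 8.2 (ii)] -/
theorem mixPt_zero (u v : Fin k → ℝ) : mixPt u v 0 = u := by
  funext i; simp [mixPt]

/-- `mixPt u v m = v` once `m ≥ k`. [cite: Maynard2016DenseClusters, proof of Lemma 8.2 (ii)] -/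
theorem mixPt_of_le (u v : Fin k → ℝ) {m : ℕ} (hm : k ≤ m) : mixPt u v m = v := by
  funext i; simp [mixPt, lt_of_lt_of_le i.2 hm]

/-- The `m`-th coordinate of `mixPt u v m` is still that of `u`. [cite: Maynard2016DenseClusters, proof of Lemma 8.2 (ii)] -/
theorem mixPt_apply_self (u v : Fin k → ℝ) {m : ℕ} (hm : m < k) : mixPt u v m ⟨m, hm⟩ = u ⟨m, hm⟩ := by
  simp [mixPt]

/-- One more step: `mixPt u v (m+1)` is `mixPt u v m` with the `m`-th coordinate updated to `v_m`.
[cite: Maynard2016DenseClusters, proof of Lemma 8.2 (ii)] -/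
theorem mixPt_succ (u v : Fin k → ℝ) {m : ℕ} (hm : m < k) :
    mixPt u v (m + 1) = Function.update (mixPt u v m) ⟨m, hm⟩ (v ⟨m, hm⟩) := by
  funext i
  by_cases h : i = ⟨m, hm⟩
  · subst h; simp [mixPt]
  · have hne : (i : ℕ) ≠ m := fun h' => h (Fin.ext h')
    rw [Function.update_of_ne h]
    simp only [mixPt]
    split_ifs <;> first | rfl | omega

/-- `mixPt u v m` lies in the orthant when `u`, `v` do. [cite: Maynard2016DenseClusters, proof of Lemma 8.2 (ii)] -/
theorem mixPt_mem_orthant {u v : Fin k → ℝ} (hu : u ∈ orthant k) (hv : v ∈ orthant k) (m : ℕ) :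
    mixPt u v m ∈ orthant k := by
  rw [mem_orthant] at hu hv ⊢
  intro i; unfold mixPt; split_ifs; exacts [hv i, hu i]

/-- `u ≤ mixPt u v m` coordinatewise when `u ≤ v`. [cite: Maynard2016DenseClusters, proof of Lemma 8.2 (ii)] -/
theorem le_mixPt {u v : Fin k → ℝ} (huv : ∀ i, u i ≤ v i) (m : ℕ) (i : Fin k) : u i ≤ mixPt u v m i := by
  unfold mixPt; split_ifs; exacts [huv i, le_rfl]

/-- The induction of Lemma 8.2 (ii): after `m` coordinate updates,
`|F(mixPt u v m) − F(u)| ≤ (30 + 30/U_k + T_k)·(Σ_{i<m} (vᵢ − uᵢ))·F₂(u)` (each step is (8.8) at a point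
`≥ u`, where `F₂ ≤ F₂(u)` since `F₂` is decreasing). [cite: Maynard2016DenseClusters, proof of Lemma 8.2 (ii)] -/
theorem abs_F_mixPt_sub_le (hk : 2 ≤ k) {u v : Fin k → ℝ} (hu : u ∈ orthant k) (huv : ∀ i, u i ≤ v i)
    (m : ℕ) :
    |F k (mixPt u v m) - F k u| ≤
      (30 + 30 / U k + T k) * (∑ i : Fin k, if (i : ℕ) < m then v i - u i else 0) * F₂ k u := by
  have hk1 : 1 ≤ k := le_trans (by norm_num) hk
  have hC : 0 ≤ 30 + 30 / U k + T k := by have := U_pos hk1; have := T_pos hk; positivity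
  have hv : v ∈ orthant k := mem_orthant.2 fun i => (mem_orthant.1 hu i).trans (huv i)
  have hF2 : 0 ≤ F₂ k u := F₂_nonneg hk hu
  induction m with
  | zero =>
    rw [mixPt_zero, sub_self, abs_zero]
    refine mul_nonneg (mul_nonneg hC (Finset.sum_nonneg fun i _ => ?_)) hF2
    simp
  | succ m ih =>
    by_cases hm : m < k
    · have hε : 0 ≤ v ⟨m, hm⟩ - u ⟨m, hm⟩ := sub_nonneg.2 (huv ⟨m, hm⟩)
      have hstep := abs_F_update_sub_le hk (mixPt_mem_orthant hu hv m) ⟨m, hm⟩ hε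
      have hupd : Function.update (mixPt u v m) ⟨m, hm⟩ (mixPt u v m ⟨m, hm⟩ + (v ⟨m, hm⟩ - u ⟨m, hm⟩)) =
          mixPt u v (m + 1) := by
        rw [mixPt_apply_self u v hm, add_sub_cancel, mixPt_succ u v hm]
      rw [hupd] at hstep
      have hF2m : F₂ k (mixPt u v m) ≤ F₂ k u := F₂_anti hk hu (le_mixPt huv m)
      have hsum : (∑ i : Fin k, if (i : ℕ) < m + 1 then v i - u i else 0) =
          (∑ i : Fin k, if (i : ℕ) < m then v i - u i else 0) + (v ⟨m, hm⟩ - u ⟨m, hm⟩) := by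
        have : ∀ i : Fin k, (if (i : ℕ) < m + 1 then v i - u i else 0) =
            (if (i : ℕ) < m then v i - u i else 0) + (if i = ⟨m, hm⟩ then v i - u i else 0) := by
          intro i
          by_cases h : i = ⟨m, hm⟩
          · subst h; simp
          · have hne : (i : ℕ) ≠ m := fun h' => h (Fin.ext h')
            simp only [h, if_false, add_zero]
            split_ifs <;> first | rfl | omega
        rw [Finset.sum_congr rfl fun i _ => this i, Finset.sum_add_distrib,
          Finset.sum_ite_eq' univ (⟨m, hm⟩ : Fin k), if_pos (Finset.mem_univ _)]
      calc |F k (mixPt u v (m + 1)) - F k u|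
          ≤ |F k (mixPt u v (m + 1)) - F k (mixPt u v m)| + |F k (mixPt u v m) - F k u| :=
            abs_sub_le _ _ _
        _ ≤ (30 + 30 / U k + T k) * (v ⟨m, hm⟩ - u ⟨m, hm⟩) * F₂ k (mixPt u v m) +
            (30 + 30 / U k + T k) * (∑ i : Fin k, if (i : ℕ) < m then v i - u i else 0) * F₂ k u :=
            add_le_add hstep ih
        _ ≤ (30 + 30 / U k + T k) * (v ⟨m, hm⟩ - u ⟨m, hm⟩) * F₂ k u +
            (30 + 30 / U k + T k) * (∑ i : Fin k, if (i : ℕ) < m then v i - u i else 0) * F₂ k u :=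
            add_le_add (mul_le_mul_of_nonneg_left hF2m (mul_nonneg hC hε)) le_rfl
        _ = (30 + 30 / U k + T k) * (∑ i : Fin k, if (i : ℕ) < m + 1 then v i - u i else 0) *
            F₂ k u := by rw [hsum]; ring
    · -- `m ≥ k`: nothing changes any more
      rw [not_lt] at hm
      have h1 : mixPt u v (m + 1) = mixPt u v m := by
        rw [mixPt_of_le u v hm, mixPt_of_le u v (Nat.le_succ_of_le hm)]
      have h2 : (∑ i : Fin k, if (i : ℕ) < m + 1 then v i - u i else 0) =
          (∑ i : Fin k, if (i : ℕ) < m then v i - u i else 0) :=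
        Finset.sum_congr rfl fun i _ => by
          rw [if_pos (lt_of_lt_of_le i.2 (Nat.le_succ_of_le hm)), if_pos (lt_of_lt_of_le i.2 hm)]
      rw [h1, h2]; exact ih

/-- **Lemma 8.2, analytic form (all coordinates)**: for `u ≤ v` coordinatewise in the orthant,
`|F(v) − F(u)| ≤ (30 + 30/U_k + T_k)·(Σᵢ (vᵢ − uᵢ))·F₂(u)` — with `u_i = log r_i/log R`,
`v_i = log s_i/log R` (`r_i ∣ s_i`) this is `y_s = y_r + O(T_k Y_r log(s/r)/log R)`.
[cite: Maynard2016DenseClusters, Lemma 8.2 (i)–(ii) with proof] -/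
theorem abs_F_sub_F_le_of_le (hk : 2 ≤ k) {u v : Fin k → ℝ} (hu : u ∈ orthant k) (huv : ∀ i, u i ≤ v i) :
    |F k v - F k u| ≤ (30 + 30 / U k + T k) * (∑ i, (v i - u i)) * F₂ k u := by
  have h := abs_F_mixPt_sub_le hk hu huv k
  have hs : (∑ i : Fin k, if (i : ℕ) < k then v i - u i else 0) = ∑ i, (v i - u i) :=
    Finset.sum_congr rfl fun i _ => if_pos i.2
  rw [mixPt_of_le u v le_rfl, hs] at h
  exact h

/-- **Lemma 8.2 (ii), analytic form**: for two points `u`, `v` of the orthant below a common point `t`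
(printed: `t_i = log [r_i, s_i]/log R`),
`|F(v) − F(u)| ≤ (30 + 30/U_k + T_k)·((Σᵢ (tᵢ − uᵢ))·F₂(u) + (Σᵢ (tᵢ − vᵢ))·F₂(v))`
(«`y_s = y_r + O(T_k (Y_r + Y_s) log A/log R)`»). [cite: Maynard2016DenseClusters, Lemma 8.2 (ii) with proof] -/
theorem abs_F_sub_F_le_of_le_of_le (hk : 2 ≤ k) {u v t : Fin k → ℝ} (hu : u ∈ orthant k)
    (hv : v ∈ orthant k) (hut : ∀ i, u i ≤ t i) (hvt : ∀ i, v i ≤ t i) :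
    |F k v - F k u| ≤
      (30 + 30 / U k + T k) * ((∑ i, (t i - u i)) * F₂ k u + (∑ i, (t i - v i)) * F₂ k v) := by
  have h1 := abs_F_sub_F_le_of_le hk hu hut
  have h2 : |F k v - F k t| ≤ (30 + 30 / U k + T k) * (∑ i, (t i - v i)) * F₂ k v := by
    rw [abs_sub_comm]; exact abs_F_sub_F_le_of_le hk hv hvt
  calc |F k v - F k u| ≤ |F k v - F k t| + |F k t - F k u| := abs_sub_le _ _ _
    _ ≤ (30 + 30 / U k + T k) * (∑ i, (t i - v i)) * F₂ k v +
        (30 + 30 / U k + T k) * (∑ i, (t i - u i)) * F₂ k u := add_le_add h2 h1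
    _ = _ := by ring

/-- **The `Ω_G` hypothesis of Lemma 8.4 for `G = g_k`** (as used in Lemma 8.5 and Propositions 9.1–9.4): for
`k ≥ 2^18`, `sup_{t ∈ [0,1]} (|G(t)| + |G'(t)|) ≤ Ω_G ∫₀^∞ G` with `G = profExt k` (the smooth representative of
`g_k`) and `Ω_G = 4kT_k` (printed: `Ω_G ≪ kT_k`; here `|G| + |G'| ≤ 1 + 30/U_k + T_k ≤ 2T_k` and
`∫₀^∞ g_k = L_k ≥ log k/(2T_k)`). [cite: Maynard2016DenseClusters, Lemma 8.4 (hypothesis on `Ω_G`), Lemma 8.5 (proof)] -/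
theorem profExt_sup_le_omega_mul_integral (hk : 262144 ≤ k) {t : ℝ} (ht : t ∈ Set.Icc (0 : ℝ) 1) :
    |profExt k t| + |deriv (profExt k) t| ≤ 4 * k * T k * ∫ x in Ici (0 : ℝ), profExt k x := by
  have hk2 : 2 ≤ k := le_trans (by norm_num) hk
  have hk1 : 1 ≤ k := le_trans (by norm_num) hk
  have hL := twelve_le_log hk
  have hs := sqrt_ge hk
  have hU := U_pos hk1
  have hUs := U_mul_sqrt hk1
  have hkr : (262144 : ℝ) ≤ k := by exact_mod_cast hk
  have hsk : Real.sqrt k * Real.sqrt k = k := Real.mul_self_sqrt (Nat.cast_nonneg k)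
  have hell := ell_mul_T_ge hk
  rw [setIntegral_Ici_profExt hk2]
  refine (abs_profExt_add_abs_deriv_le hk2 ht.1).trans ?_
  have h1 : 30 / U k = 30 * Real.sqrt k := by
    rw [div_eq_iff hU.ne', mul_assoc, mul_comm (Real.sqrt (k : ℝ)) (U k), hUs, mul_one]
  have ha : 30 * Real.sqrt k ≤ Real.sqrt k * Real.sqrt k :=
    mul_le_mul_of_nonneg_right (by linarith) (Real.sqrt_nonneg _)
  have hkL : (k : ℝ) * 12 ≤ k * Real.log k := mul_le_mul_of_nonneg_left hL (Nat.cast_nonneg k)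
  -- `1 + 30/U + T ≤ 2T` and `4kT·L ≥ 4k·(log k)/2 = 2T`
  have h2 : 1 + 30 / U k + T k ≤ 2 * T k := by rw [h1]; unfold T; linarith
  have h3 : 2 * T k ≤ 4 * k * T k * ell k := by
    have hk0 : (0 : ℝ) ≤ 4 * k := by positivity
    calc 2 * T k = 4 * k * (Real.log k / 2) := by unfold T; ring
      _ ≤ 4 * k * (ell k * T k) := mul_le_mul_of_nonneg_left hell hk0
      _ = 4 * k * T k * ell k := by ring
  exact h2.trans h3

end ShiftAll

end MaynardDense

end Literature.NumberTheory.Sieve
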